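import Summits.AtomisticToContinuum.HydrodynamicLimit.Theses.AntiMazurCoboundaries
import Literature.MathematicalPhysics.KineticTheory.HardSphereEulerProofs
import Literature.MathematicalPhysics.KineticTheory.HardSphereBBGKYLiouvilleFlow
import Literature.Analysis.FluidPDE.HardSphereAlexander
import Literature.Analysis.FluidPDE.HardSphereTorusMeasure
import Literature.Barriers.AtomisticToContinuum.BoltzmannHypothesis
import Summits.AtomisticToContinuum.HydrodynamicLimit.Theorems.BoltzmannGreenKubo.Negative.MazurFloor
import Summits.AtomisticToContinuum.HydrodynamicLimit.Theorems.BoltzmannGreenKubo.Negative.EnergyFloor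
import Literature.Analysis.UnboundedOperators.LinearizedBoltzmannPositivityProofs
import Summits.AtomisticToContinuum.HydrodynamicLimit.Theorems.CorrectorPressureDecay.Negative.Frame
import Summits.AtomisticToContinuum.HydrodynamicLimit.Theorems.CorrectorPressureDecay.Negative.WithoutOrthogonality
import Summits.AtomisticToContinuum.HydrodynamicLimit.Theorems.CorrectorPressureDecay.Negative.Statics
import Summits.AtomisticToContinuum.HydrodynamicLimit.Theorems.CorrectorPressureDecay.Negative.AllAmplitudes
import Summits.AtomisticToContinuum.HydrodynamicLimit.Theorems.CorrectorPressureDecay.Negative.MazurFloor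
import Summits.AtomisticToContinuum.HydrodynamicLimit.Theorems.CorrectorPressureDecay.Negative.FreeFlow

/-!
# Disproof of `CorrectorPressureDecay` — findings

Standing disprover's work file (cdisprove seats `refuter-cdisprove-stmt-AtomisticToContinuum-14135-0` = cycle 1,
`…-14135-g2-0` = cycle 2) for crux
`stmt-AtomisticToContinuum-14135` =
`Summit.AtomisticToContinuum.HydrodynamicLimit.Theses.AntiMazurCoboundaries.CorrectorPressureDecay` ("X"):
`∀ a θ u₀ > 0 ∃σ₀ ∀σ<σ₀: (G_N prob.) ∧ ∃κ ∀(φ,g admissible, |g| ≤ κ, g ⊥ 1,v,|v|²) ∀δ ∃τ₀ N₀ ∀N≥N₀ ∀Φ ∃lag W: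
 ∫e^{2(F − lag⁻¹(W∘Φ_lag − W))}dG_N ≤ e^{δ(N+1)} ∧ ∫e^{4|W|/h₀}dG_N ≤ e^{δ(N+1)}`, `h₀ = τ₀(N+1)^{-1/3}`,
`F = Σᵢ φ(xᵢ) g((vᵢ−u₀)/√θ)`.

VERDICT SO FAR (end of cycle 2): NO KILL. X is consistent as stated; every cheap attack lands on a hypothesis that is
present, and the only logical kill channel (an extensive invariant/charged structure, (f)) has no known inhabitant.
All theorems in this file are SORRY-FREE (axioms propext / Classical.choice / Quot.sound); there is no near-miss sorry.

CYCLE 2 ADDITIONS (2026-08-16, seat g2): (b) the LD MAZUR FLOOR as theorems (`tilted_jensen`; invariant-observable and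
invariant-event forms) — the charge side of the route's coboundary certificates; (a.3′) the free gas CONSTRUCTED as a
diameter-0 `HardSphereFlow` (`FreeFlow.freeFlow₀`, so `FreeFlowZeroDiameter` is a theorem) and (a.3″) X at σ = 0 is
FALSE UNCONDITIONALLY (`not_correctorPressureDecayZeroDiameter`, no certificate, no cost clause); (c.2) the natural
strengthening `c·h₀ ≤ lag` (corrector lag at least c cost windows, ANY fixed c > 0) is FALSE for every flow
(`not_correctorPressureDecayLagGeWindow` — lag rigidity `lag ≲ h₀√δ/s_g` as a theorem); (f) the kill criterion `ChargedInvariantEvents → ¬X` as a theorem; (d) the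
four stubs of the registered line `almost-invariant-duality` audited (stub 2 PROVED here, stubs 1, 3 true, stub 4 ⇔ X).

## Index of findings

* FRAME FACTS (usable by provers):
  - `nonempty_flow` — flows EXIST for `0 < σ < 1/2`, all `N` (Alexander on `𝕋³` is PROVED in the tree,
    `HardSphereFlow.nonempty_torus_holds`), so every `∀ Φ` clause of X is instantiable and nothing below is
    "modulo flow existence".
  - `measurePreserving_flow_localGibbsLaw` — the ZERO-DRIFT global Gibbs law `localGibbsLaw σ a 0 θ N Φ` is
    invariant under every `Φ.flow t` (= support item HomogeneousInvariance, stmt-9621, in the case `u₀ = 0`;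
    proof: Liouville preservation + `HardSphereFlow.configEnergy_flow` + `good ⊆ D_ε`). General `u₀` needs
    momentum conservation along the flow, not yet a tree theorem.
  - `lintegral_prod_vel_localGibbsMeasure`, `lintegral_exp_sum_vel_localGibbsMeasure` — PRODUCT FORMULA:
    `∫ exp(Σᵢψ(vᵢ)) dG_N = (∫e^ψ dN(u₀,θ))^{N+1}` (positions ⊥ velocities, i.i.d. Maxwellian velocities).
  - `gW`, `gW_orthogonal` — an explicit ADMISSIBLE observable `g(v) = κ sin v₀ sin v₁` (continuous, `|g| ≤ κ`,
    `⊥ span(1,v,|v|²)` by coordinate-reflection oddness), with `1 + E g² ≤ E e^{2g}` and `E g² > 0`.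
  - `ofReal_exp_le_lintegral_exp_sub_coboundary` — Jensen: a bounded coboundary `lag⁻¹(W∘T − W)` has mean 0
    under a `T`-invariant law, so it never lowers the exponential moment of a constant.

* (a) LOAD-BEARING HYPOTHESES (any proof must use them):
  - (a.1) `not_correctorPressureDecayWithoutOrthogonality` — drop `g ⊥ 1`: FALSE (g ≡ κ, φ ≡ 1: `F ≡ κ(N+1)`,
    Jensen+invariance floor `e^{2κ(N+1)}` for EVERY flow/lag/corrector). PROVED.
  - (a.1′) CYCLE 2 — `not_correctorPressureDecayWithoutOrthMomentum`: drop ONLY `⊥ v` (keep `⊥ 1, |v|²`): FALSE for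
    EVERY κ (witness g = κ sin v₀; invariant UNBOUNDED tilt βP₀ by the conserved momentum, `tilted_jensen'`,
    `E sin(β+Z) = e^{−1/2}sin β`; β = min(κ,1)/4, δ = min(κ,1)²/20): first-order shell floors are amplitude-independent,
    only orthogonality to v / |v|² removes them. PROVED.
  - (a.1″) CYCLE 2 — `not_correctorPressureDecayWithoutOrthEnergy`: drop ONLY `⊥ |v|²` (keep `⊥ 1, v`): FALSE for
    EVERY κ (even witness g = κ(c_E − v₀²/(10+v₀²)); invariant COOLING tilt −(t/2)Σ(|vᵢ|²−3) by the conserved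
    energy, bounded above; two tilted Jensens + `cool_ratio_le` ((1+t)² ≤ (1+2t)e^{t²}) give 2κE[ĝ(sZ)] ≤ δ + (3/2)t²
    against the first-order response E[ĝ(sZ)] ≥ t/50; t = min(κ,1)/100, δ = min(κ,1)²/10⁵). PROVED.
  - (a.2) `not_correctorPressureDecayAllAmplitudes` — drop the amplitude clause (`∃κ … |g| ≤ κ` ↦ `g bounded`,
    the frame of BoltzmannGreenKubo 13985): FALSE. Witness `g = K·hW`, `hW` RADIAL admissible (`= 1` on the unit
    ball; two tents in `|v|²` with coefficients solving `E h = E|v|²h = 0`, determinant `≥ e₁e₂ > 0` without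
    evaluating any Gaussian integral), low-energy band `B = {E ≤ (N+1)η/2}` (Φ-invariant a.e. by
    `configEnergy_flow`, mass `≥ q^{N+1}` by the product formula), per-particle `g ≥ K − K(1+H)|v|²` ⇒ `2F ≥ K(N+1)`
    on `B`, conditional Jensen for the normalised invariant law on `B`: defect `≥ e^{(N+1)(K + log q)}`,
    `K = 2 − 2 log q`. PROVED. (= the energy-shell Donsker–Varadhan floor of the earlier passes, as a theorem:
    the prover's `κ < κ*` is exactly what removes it.)
  - (a.3) cycle 1: σ = 0 FALSE modulo `FreeFlowZeroDiameter ∧ ExponentialCertificate` (conditional theorem of the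
    cycle-1 file, now REMOVED as superseded by the unconditional (a.3″); the definitions
    `CorrectorPressureDecayZeroDiameter`, `FreeFlowZeroDiameter` are kept).
  - (a.3′/a.3″) CYCLE 2 — UNCONDITIONAL: `FreeFlow.freeFlow₀ N : Flow 0 N` (the free gas IS a diameter-0 hard-sphere
    flow: good set = no pair ever collinear with a lattice translate; measurable, invariant, collision-free,
    Liouville-conull by Fubini one particle at a time), `freeFlowZeroDiameter_holds : FreeFlowZeroDiameter`, and
    `not_correctorPressureDecayZeroDiameter : ¬ CorrectorPressureDecayZeroDiameter` by the Mazur floor (b) — the defect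
    ALONE is `≥ (E_γe^{2g})^{N+1}` for every lag/corrector; the cost clause is not used. PROVED.
  - (a.4) the COST clause carries the N-uniformity, not the truth (paper): at FIXED N, with the true-flow Fejér
    corrector `W_H = −∫₀ᴴ(1−t/H)F∘Φ_t dt` and lag → 0 then H → ∞, the defect tends to `∫exp(2E[F | Inv])dG_N`
    (Birkhoff + dominated convergence), which is `≤ e^{δ(N+1)}` for κ < κ* IF the flow is ergodic on (P,E)-shells
    (Simányi) — i.e. "X without the cost clause" is (finite-N ergodicity + the slice floor); every difficulty of X is
    the requirement that `H` and `‖W‖` stay `O(τ₀ℓ)` uniformly in N.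

* (b) THE LD MAZUR FLOOR (cycle 2; abstract, any measure-preserving `T`): `tilted_jensen`
  (`(∫e^V)·exp(∫(Y−V)d(μ.tilted V)) ≤ ∫e^Y`), `measurePreserving_tilted`,
  `integral_exp_le_integral_exp_sub_coboundary_of_invariant` (F∘T = F ⇒ `∫e^F ≤ ∫e^{F − s(W∘T−W)}` ∀ W, s) and
  `mul_exp_average_le_setIntegral_exp_sub_coboundary` (T⁻¹A = A ⇒ `μ(A)e^{⨍_A F} ≤ ∫_A e^{F − s(W∘T−W)}`): correctors
  are blind on the invariant σ-algebra — the defect pressure of ANY corrector is at least the invariant-slice dual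
  value. PROVED; this is the kernel of (a.1), (a.2), (a.3″) and of the kill criterion (f).

* (c) NATURAL STRENGTHENINGS REFUTED:
  - (c.1) `not_staticPressureDecay`, `not_correctorPressureDecayZeroCorrector` — `W = 0` (no corrector) is FALSE:
    the static moment is EXACTLY `(E_γ e^{2φ̄g})^{N+1}`; with `gW` it is `≥ e^{2δ(N+1)}` at
    `δ = ½log(1 + E g²)`. PROVED (sanity: the variant implies X, `correctorPressureDecay_of_zeroCorrector`).
  - (c.2) CYCLE 2 — `not_correctorPressureDecayLagGeWindow`: for EVERY fixed ratio c > 0, X with the extra conjunct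
    `c·h₀ ≤ lag` (lag at least c cost windows, `h₀ = τ₀ℓ`) is FALSE, for every flow and every N (witness φ ≡ 1,
    g = gW κ, tilt ε₀Σg(vᵢ) with ε₀ = 2c/(1+c), δ = ½log E_γe^{ε₀g}; three Gibbs inequalities + invariance +
    `4c/lag ≤ 4/h₀` + product formula; the weights (2c,1,1) cancel the corrector AND the tilted mean E_Q F exactly,
    leaving δ ≥ log E_γe^{ε₀g}). LAG RIGIDITY as a theorem — `lagRigidity` (the INEQUALITY, stated for arbitrary
    bounded measurable g, any flow, any (lag, W, h₀) satisfying the two clauses): `log E_γ exp((2lag/(lag+h₀))g) ≤ δ`,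
    i.e. `lag ≲ h₀√δ/s_g` (crux NOTES S3) — the lag of every witness is asymptotically SHORTER than the cost window.
    Sanity: `correctorPressureDecay_of_lagGeWindow` (the variant implies X). PROVED.

* (f) KILL CRITERION (cycle 2): `correctorPressureDecay_false_of_chargedInvariantEvents :
  ChargedInvariantEvents → ¬ CorrectorPressureDecay` — a family of FLOW-INVARIANT events `A_N` with
  `G_N(A_N)·exp(⨍_{A_N}2F) > e^{δ(N+1)}` at every amplitude κ refutes X whatever the lag, corrector and cost. (a.2) is
  the instance `A = {E ≤ (N+1)η/2}` at LARGE κ; at small κ every (P,E)-measurable event is beaten by the shell rate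
  ((e).3), so an inhabitant needs an invariant structure NOT measurable w.r.t. (P,E): a hidden conserved quantity of
  N+1 hard spheres on 𝕋³ overlapping a one-body fast g. None exists at the level of EXACT invariants: under G_N the
  velocities are i.i.d. Maxwellian independent of ALL position information 𝒫, so `E[F | 𝒫, P, E] =
  E[Σφ(xᵢ) | 𝒫]·m(P,E)` — position-side invariants (the resonances `k·Σxᵢ` on `{k·P = 0}`, G_N-null anyway) add no
  bias, and by ergodicity of hard balls on each (P,E)-shell (Sinai–Chernov K-property, Simányi 2013; tree fact
  `simanyi_hardBall_ergodic`, unproved) every flow-invariant event is σ(P,E)-measurable mod G_N-null sets, where the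
  shell rate beats the bias for κ < κ* ((e).3). Hence `ChargedInvariantEvents` is FALSE modulo Simányi and is
  deliberately NOT filed as a wanted construction; a kill of X must come from APPROXIMATELY invariant (metastable on
  the scale `lag`) charged states — the dual of the line's stub 4 — against which the corrector's payment
  `(2/lag)∫W d(Φ_lag#ρG_N − ρG_N)` is NOT controlled by the floors of this file. PROVED (the implication).

* PROVED ON THE WAY (positive, for provers): `HomInv.homogeneousInvariance : HomogeneousInvariance` (stmt-9621, ALL
  drifts u₀; momentum conservation along trajectories + density a function of (E,P)); candidate proof attached to
  9621. Closes the line's stub `GibbsFlowInvariance` — restated and proved verbatim as `gibbsFlowInvariance_holds` in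
  section (d) Targets (cycle 2).

* SLIMMING (cycle 2, v9): everything LANDED is now IMPORTED and re-exported by name (aliases `not_…`), so this file
  stays under the 200 kB workfile cap; the cycle-1 proofs live in the landed files listed next.

* LANDED under `Theorems/CorrectorPressureDecay/Negative/` (all ACCEPTED, axioms propext/Classical.choice/Quot.sound):
  `Frame.lean` (p74062: flows exist, zero-drift Gibbs invariance, Jensen floor, product formula, Gaussian reflections);
  `WithoutOrthogonality.lean` (p75770, (a.1) `correctorPressureDecay_false_without_orthogonality`);
  `Statics.lean` (p75902, (c.1) `staticPressureDecay_false`, `correctorPressureDecay_false_zeroCorrector`; reuses the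
  sibling crux's witness `CellForecastPressureDecay.gW` from `CellForecastPressureDecay/Negative/PerParticle.lean`);
  `AmplitudeWitness.lean` (p75729, `hW`) + `AllAmplitudes.lean` (p75738, (a.2)
  `correctorPressureDecay_false_without_amplitude`). CYCLE 2: `MazurFloor.lean` (p77895 ACCEPTED: `tilted_jensen`,
  `measurePreserving_tilted`, `integral_exp_le_integral_exp_sub_coboundary_of_invariant`,
  `mul_exp_average_le_setIntegral_exp_sub_coboundary`); `FreeFlow.lean` (p77921 ACCEPTED: `FreeFlow.freeFlow`,
  `freeFlow₀`, the diameter-0 free gas as a `HardSphereFlow`); `OrthMomentumTools.lean` (p78634 ACCEPTED: `tilted_jensen'`,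
  `measurePreserving_tilted_ae`, the 1-d Gaussian facts and the N-body product integrals). Submitted, pending at the
  time of writing (05:18Z; the first submissions p78738/p78739 were bounced only by a gate restart, p78742 by the
  gate's own relocation of the believed-false hypothesis `ChargedInvariantEvents` — now inlined, no named def):
  `ZeroDiameter.lean` (p81477, (a.3″)), `LagWindow.lean` (p81885, `lagRigidity` + (c.2)), `KillCriterion.lean` (p81905,
  (f)), `OrthMomentum.lean` (p81072, (a.1′)), `OrthEnergyTools.lean` (p81201); to be proposed once their import lands:
  `OrthEnergyWitness.lean`, `OrthEnergy.lean` ((a.1″); all rc0 locally, seat folder `neg/`).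
  Importable by ideators/planners/provers.

* (d) TARGETS: payload `stuck_stubs = []`. PICKED line (02:55Z) = `kinetic-entropy-collision-budget` (6 stubs, all survived
  the drefute pass; wall = `FastSectorDominance`); cross-checks from this file's theorems in section (d) (σ = 0 exclusion
  necessary, lag design consistent with `lagRigidity`, stub 1 ⊇ `tilted_jensen`, FSD fails iff a metastable one-body charge
  exists). Earlier skeleton `Lines/almost-invariant-duality.lean` (unpicked) has four stubs; audit in section (d): `CorrectorMinimax` TRUE (Sion; cost ball weak*-compact),
  `GibbsFlowInvariance` PROVED (`gibbsFlowInvariance_holds`), `ThermodynamicSliceFloor` TRUE (Gibbs on σ(P,E) +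
  equivalence of ensembles + Cramér, κ* universal), `AlmostInvariantRigidity` ⇔ X (no independent attack surface; by
  (c.2) its witnesses need `lag < h₀`, and the product tilt `ρ ∝ e^{Σg(vᵢ)}` is the concrete test state).

* (e) WHY X RESISTS (paper analysis; nothing here is a near-kill):
  1. No junk model: `HardSphereFlow.isTrajectory` forces free flight between collisions and elastic jumps on a
     Liouville-conull good set; flows agree a.e.; `G_N ≪ liouville` makes off-good junk invisible.
  2. Normalisation is right: `G_N` prob. for `σ ≤ 1/2` (`isProbabilityMeasure_localGibbsLaw`), velocities are
     exactly `N(u₀,θ)` so `(v−u₀)/√θ ~ stdGaussian`, matching the orthogonality clause; `κ, τ₀, N₀, lag, W` are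
     quantified in the prover-friendly order (`τ₀` after `δ`; `lag, W` after `N, Φ`).
  3. Conserved-quantity (Donsker–Varadhan) floors: energy/momentum shells give gain `2|m_g(e,p)|` vs cost
     `I(e,p) = |p|²/2 + (3/2)(e−1−log e)`; `g ⊥ 1,v,|v|²` kills the first-order terms and `|m_g| ≤ κ·ρ(e,p)`
     with `inf I/ρ =: 2κ* > 0`, so the prover's `∃κ` (κ < κ*) removes every such floor; (a.2) shows it is needed.
     NUMBERS (cycle 2): for the witness `gW κ = κ sin v₀ sin v₁`, `Ḡ(p,θ') = κ sin p₀ sin p₁ e^{−θ'}` exactly, and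
     `sup_{p,θ'}[2Ḡ − I] = 0` iff `κ ≤ e/2 ≈ 1.359` (optimum on the diagonal p₀ = p₁ → 0 at θ' = 1; grid check of the
     off-diagonal and θ' < 1 directions, seat folder) — the shell floor never bites gW at the small κ of (a.1)/(c.1)/(c.2),
     whose mechanisms (invariance, statics, lag rigidity) are different and κ-free.
  4. Macroscopic inhomogeneities (cold/hot/rarefied bubbles, aligned lanes): LD cost ≥ c·(#particles involved)
     with `c = O(1)`, gain ≤ `2κ²Var g` per particle ⇒ net negative for small κ; rarefied bubbles of density r
     keep `g` unrelaxed only for `r ≲ 1/T`, gain `r·O(κ²)` vs cost `1 − r + r log r → 1`.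
  5. Pre-collisional pair-correlation tilts: entropy `ε` per particle biases post-collisional `E g` by `O(κ√ε)`
     for O(1) collision times; sustaining over a window of `T` mean free times costs `Tε`: optimum `κ²c²/T → 0`.
     Consistent with Drude fraction `~ 2τ_rel/T` (linearised Boltzmann, gap proved in tree) and MD long-time
     tails `t^{-3/2}` (integrable).
  6. Equivalence with shared 10967 (`KineticFluxLdDecay`): X ⇒ 10967 by ExponentialCertificate; 10967(2κ) ⇒ X(κ)
     by the discrete Fejér corrector `W = −lag Σ_{k<n}(1−k/n)F∘Φ_{k·lag}` with `τ₀ := max(τ, 4κτ/δ)`. So a kill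
     of X is a uniform-in-N positive LD-Drude weight for a fast one-body observable of 3-d hard spheres at fixed
     small density: a hidden extensive quasi-local conserved quantity. None is known (finite-N: Simányi
     ergodicity; kinetic limit: linearised Boltzmann has a gap; literature search: no candidate).
  KILL CHANNEL (logic only): `¬KineticFluxLdDecay → PressureCertificateTransfer → ¬X` (contrapositive of the
  route's glue 14139); an MD plateau of `S·r(S)` off the Green–Kubo value would be the empirical signal.
  6′. CAVEAT on "X ⇔ 10967" (cycle 2): X ⇒ 10967 is the certificate (rigorous). The converse by the DISCRETE Fejér
     corrector `W = −lag Σ_{k<n}(1−k/n)F∘Φ_{k·lag}` gives `F − D_W = n⁻¹Σ_{k=1}^{n} F∘Φ_{k·lag}` EXACTLY (no shot noise),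
     so as pure logic 10967 ⇒ X holds only for the DISCRETE-average form of 10967; from the continuous window
     average one inherits the shot-noise term `F − lag⁻¹∫₀^{lag}F∘Φ`, whose pressure `≈ (N+1)(lag/t_mf)O(κ)` needs a
     short-time collision-count bound under `G_N` uniformly in the flow — true but an InfluenceLocality-type input,
     not logic. Planners citing the equivalence should read "up to short-time collision statistics".
  7′. LAG RIGIDITY is now a theorem ((c.2)): `lag < c·h₀` for every fixed c once δ < δ(c, g) — `lag ≲ h₀√δ/s_g`.
  7. EMPIRICAL (kit, route falsifier (ii), jobs QUEUED 2026-08-16T02:35Z, results attach to the item automatically):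
     `j010682` (event-driven MD, N = 512, σ = 0.3, 600 t₀) and `j010684` (N = 256, σ = 0.15, 400 t₀) measure
     `r_g(S) = Var(window average)/(N Var g)` for g ∈ {shear vₓv_y, gW, radial Laguerre s²−10s+15, heat vₓ(|v|²−5)},
     S = 0.05…20 t₀, and the autocorrelations; prediction r(S) ≈ 2τ_g/S (no Drude weight); a plateau = kill signal.
     Script: seat folder `md/hs_edmd.py`.
-/

noncomputable section

open MeasureTheory ProbabilityTheory Set Filter Topology
open scoped ENNReal

namespace Summit.AtomisticToContinuum.HydrodynamicLimit.Cruxes.CorrectorPressureDecay.Disproof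

open Literature.MathematicalPhysics.KineticTheory (T3 V3 hsDiameter localGibbsLaw localGibbsMeasure
  localGibbsProfile)
open Literature.Analysis.FluidPDE (HardSphereFlow Config configEnergy)
open Summit.AtomisticToContinuum.HydrodynamicLimit.Theses.AntiMazurCoboundaries (CorrectorPressureDecay)

/-! ## Landed negative knowledge is IMPORTED (cycle 2 slimming): the frame facts, the Mazur floor, the free flow and
the cycle-1 refutations live under `Theorems/CorrectorPressureDecay/Negative/`; this work file keeps the index, the
not-yet-landed theorems and the paper analysis. -/

open Summit.AtomisticToContinuum.HydrodynamicLimit.Theorems.CorrectorPressureDecayNegative (nonempty_flow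
  tensorPow_localGibbsProfile_const measurePreserving_flow_localGibbsLaw ofReal_exp_le_lintegral_exp_sub_coboundary
  lintegral_prod_vel_localGibbsMeasure lintegral_exp_sum_vel_localGibbsMeasure gaussMeasure_zero_one tilted_jensen
  measurePreserving_tilted integral_exp_le_integral_exp_sub_coboundary_of_invariant
  mul_exp_average_le_setIntegral_exp_sub_coboundary integrable_exp_of_abs_le integrable_of_abs_le)

/-! ## Frame -/

/-- Hard-sphere flows of `N + 1` spheres of reduced diameter `σ` on `𝕋³` (the crux's `Φ`). -/
abbrev Flow (σ : ℝ) (N : ℕ) : Type :=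
  HardSphereFlow (Literature.Analysis.FluidPDE.Torus.geometry (Fin 3)) (hsDiameter σ N) (N + 1)

/-- Phase space of `N + 1` spheres on `𝕋³`. -/
abbrev Phase (N : ℕ) : Type := Config (N + 1) (Fin 3) T3

/-! ## (a) Load-bearing hypotheses

### (a.1) Orthogonality to the constants is load-bearing — LANDED `Negative/WithoutOrthogonality.lean` (p75770) -/

/-- (a.1) `CorrectorPressureDecay` with the clause `g ⊥ span(1, v, |v|²)` DELETED is FALSE (landed theorem,
re-exported by name for the index; witness `g ≡ κ`, Jensen + invariance). -/
theorem not_correctorPressureDecayWithoutOrthogonality :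
    ¬ Summit.AtomisticToContinuum.HydrodynamicLimit.Theorems.CorrectorPressureDecayNegative.CorrectorPressureDecayWithoutOrthogonality :=
  Summit.AtomisticToContinuum.HydrodynamicLimit.Theorems.CorrectorPressureDecayNegative.correctorPressureDecay_false_without_orthogonality

/-! ## Static toolkit: exponential moments of one-body velocity sums under the global Gibbs law -/

section Static

open Literature.MathematicalPhysics.KineticTheory


/-! ### Coordinate reflections of `ℝ³` and odd Gaussian integrals -/

/-- Sign flip of the `k`-th coordinate of `ℝ³`, a linear isometry. -/
def flipLIE (k : Fin 3) : V3 ≃ₗᵢ[ℝ] V3 :=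
  LinearIsometryEquiv.piLpCongrRight 2 fun i =>
    if i = k then LinearIsometryEquiv.neg ℝ else LinearIsometryEquiv.refl ℝ ℝ

theorem flipLIE_apply (k : Fin 3) (v : V3) (i : Fin 3) :
    flipLIE k v i = if i = k then -v i else v i := by
  simp only [flipLIE, LinearIsometryEquiv.piLpCongrRight_apply, PiLp.toLp_apply]
  split_ifs <;> simp

/-- Coordinate reflections preserve the standard Gaussian. -/
theorem measurePreserving_flipLIE (k : Fin 3) :
    MeasurePreserving (flipLIE k) (stdGaussian V3) (stdGaussian V3) :=
  ⟨(flipLIE k).continuous.measurable, stdGaussian_map (flipLIE k)⟩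

/-- A function odd under a coordinate reflection has zero standard-Gaussian integral. -/
theorem integral_stdGaussian_eq_zero_of_odd (k : Fin 3) {f : V3 → ℝ} (hf : ∀ v, f (flipLIE k v) = -f v) :
    ∫ v, f v ∂stdGaussian V3 = 0 := by
  have h1 : ∫ v, f (flipLIE k v) ∂stdGaussian V3 = ∫ v, f v ∂stdGaussian V3 :=
    (measurePreserving_flipLIE k).integral_comp (flipLIE k).toHomeomorph.measurableEmbedding f
  simp_rw [hf, integral_neg] at h1
  linarith

/-- An even/invariant integrand has the same integral after reflection (used for `E e^{2g} = E e^{-2g}`). -/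
theorem integral_stdGaussian_comp_flipLIE (k : Fin 3) (f : V3 → ℝ) :
    ∫ v, f (flipLIE k v) ∂stdGaussian V3 = ∫ v, f v ∂stdGaussian V3 :=
  (measurePreserving_flipLIE k).integral_comp (flipLIE k).toHomeomorph.measurableEmbedding f

/-! ### The witness observable `g(v) = κ sin v₀ sin v₁` -/

/-- The witness: `gW κ v = κ sin(v₀) sin(v₁)` — continuous, `|gW| ≤ κ`, odd in `v₀` and in `v₁`. -/
def gW (κ : ℝ) (v : V3) : ℝ := κ * (Real.sin (v 0) * Real.sin (v 1))

@[fun_prop]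
theorem continuous_gW (κ : ℝ) : Continuous (gW κ) := by
  unfold gW
  fun_prop

theorem abs_gW_le {κ : ℝ} (hκ : 0 ≤ κ) (v : V3) : |gW κ v| ≤ κ := by
  rw [gW, abs_mul, abs_of_nonneg hκ, abs_mul]
  calc κ * (|Real.sin (v 0)| * |Real.sin (v 1)|) ≤ κ * (1 * 1) := by
        gcongr
        · exact Real.abs_sin_le_one _
        · exact Real.abs_sin_le_one _
    _ = κ := by ring

theorem gW_flip0 (κ : ℝ) (v : V3) : gW κ (flipLIE 0 v) = -gW κ v := by
  simp [gW, flipLIE_apply, Real.sin_neg]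

theorem gW_flip1 (κ : ℝ) (v : V3) : gW κ (flipLIE 1 v) = -gW κ v := by
  simp [gW, flipLIE_apply, Real.sin_neg]

/-- The quadratic weight `c₀ + ⟪b, v⟫ + c₂|v|²` in coordinates. -/
theorem quadWeight_eq (c₀ c₂ : ℝ) (b v : V3) :
    c₀ + inner ℝ b v + c₂ * ‖v‖ ^ 2 =
      (c₀ + (b 1 * v 1 + b 2 * v 2) + c₂ * (v 0 ^ 2 + v 1 ^ 2 + v 2 ^ 2)) + b 0 * v 0 := by
  rw [EuclideanSpace.real_norm_sq_eq, real_inner_comm, EuclideanSpace.inner_eq_star_dotProduct]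
  simp [dotProduct, Fin.sum_univ_three]
  ring

/-- **The witness is admissible**: `gW κ ⊥ span(1, v, |v|²)` in `L²(stdGaussian)` — every term of
`gW · (c₀ + ⟪b,v⟫ + c₂|v|²)` is odd under the reflection of `v₀` or of `v₁`. -/
theorem gW_orthogonal (κ c₀ c₂ : ℝ) (b : V3) :
    ∫ v, gW κ v * (c₀ + inner ℝ b v + c₂ * ‖v‖ ^ 2) ∂stdGaussian V3 = 0 := by
  simp_rw [quadWeight_eq, mul_add (gW κ _) _ (b 0 * _)]
  -- integrability of the two pieces: bounded continuous `gW` times a polynomial weight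
  have hgm : AEStronglyMeasurable (gW κ) (stdGaussian V3) := (continuous_gW κ).aestronglyMeasurable
  have hgb : ∀ v, ‖gW κ v‖ ≤ |κ| := fun v => by
    rw [Real.norm_eq_abs, gW, abs_mul, abs_mul]
    calc |κ| * (|Real.sin (v 0)| * |Real.sin (v 1)|) ≤ |κ| * (1 * 1) := by
          gcongr
          · exact Real.abs_sin_le_one _
          · exact Real.abs_sin_le_one _
      _ = |κ| := by ring
  have hcoord : ∀ l : Fin 3, Integrable (fun v : V3 => v l) (stdGaussian V3) := fun l =>
    (memLp_coord_stdGaussian l 2 (by simp)).integrable one_le_two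
  have hcoord2 : ∀ l : Fin 3, Integrable (fun v : V3 => v l ^ 2) (stdGaussian V3) := fun l =>
    (memLp_coord_stdGaussian l 2 (by simp)).integrable_sq
  have hA : Integrable (fun v : V3 => c₀ + (b 1 * v 1 + b 2 * v 2) + c₂ * (v 0 ^ 2 + v 1 ^ 2 + v 2 ^ 2))
      (stdGaussian V3) :=
    ((integrable_const c₀).add (((hcoord 1).const_mul _).add ((hcoord 2).const_mul _))).add
      ((((hcoord2 0).add (hcoord2 1)).add (hcoord2 2)).const_mul _)
  have hB : Integrable (fun v : V3 => b 0 * v 0) (stdGaussian V3) := (hcoord 0).const_mul _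
  have hI1 : Integrable (fun v : V3 => gW κ v * (c₀ + (b 1 * v 1 + b 2 * v 2) +
      c₂ * (v 0 ^ 2 + v 1 ^ 2 + v 2 ^ 2))) (stdGaussian V3) :=
    hA.bdd_mul hgm (ae_of_all _ hgb)
  have hI2 : Integrable (fun v : V3 => gW κ v * (b 0 * v 0)) (stdGaussian V3) :=
    hB.bdd_mul hgm (ae_of_all _ hgb)
  rw [integral_add hI1 hI2, integral_stdGaussian_eq_zero_of_odd 0, integral_stdGaussian_eq_zero_of_odd 1,
    add_zero]
  · intro v
    rw [gW_flip1]
    simp [flipLIE_apply]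
  · intro v
    rw [gW_flip0]
    simp [flipLIE_apply]

end Static

/-! ### The static one-body floor `E e^{2g} ≥ 1 + E g² > 1` -/

section StaticFloor

open Literature.MathematicalPhysics.KineticTheory

/-- `e^y + e^{-y} ≥ 2 + y²/2` (from Mathlib's `1 + x + x²/2 ≤ eˣ` for `x ≥ 0` and `x + 1 ≤ eˣ`). -/
theorem two_add_sq_div_two_le_exp_add_exp_neg (y : ℝ) : 2 + y ^ 2 / 2 ≤ Real.exp y + Real.exp (-y) := by
  rcases le_total 0 y with hy | hy
  · have h1 := Real.quadratic_le_exp_of_nonneg hy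
    have h2 := Real.add_one_le_exp (-y)
    linarith
  · have h1 := Real.quadratic_le_exp_of_nonneg (neg_nonneg.2 hy)
    have h2 := Real.add_one_le_exp y
    rw [neg_sq] at h1
    linarith

theorem norm_gW_le (κ : ℝ) (v : V3) : ‖gW κ v‖ ≤ |κ| := by
  rw [Real.norm_eq_abs, gW, abs_mul, abs_mul]
  calc |κ| * (|Real.sin (v 0)| * |Real.sin (v 1)|) ≤ |κ| * (1 * 1) := by
        gcongr
        · exact Real.abs_sin_le_one _
        · exact Real.abs_sin_le_one _
    _ = |κ| := by ring

theorem integrable_exp_mul_gW (c κ : ℝ) : Integrable (fun v => Real.exp (c * gW κ v)) (stdGaussian V3) := by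
  refine (integrable_const (Real.exp (|c| * |κ|))).mono' (by fun_prop : Continuous fun v =>
    Real.exp (c * gW κ v)).aestronglyMeasurable (ae_of_all _ fun v => ?_)
  rw [Real.norm_eq_abs, abs_of_pos (Real.exp_pos _), Real.exp_le_exp]
  have hb : |gW κ v| ≤ |κ| := by simpa [Real.norm_eq_abs] using norm_gW_le κ v
  calc c * gW κ v ≤ |c * gW κ v| := le_abs_self _
    _ = |c| * |gW κ v| := abs_mul _ _
    _ ≤ |c| * |κ| := mul_le_mul_of_nonneg_left hb (abs_nonneg c)

theorem integrable_gW_sq (κ : ℝ) : Integrable (fun v => gW κ v ^ 2) (stdGaussian V3) := by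
  refine (integrable_const (|κ| ^ 2)).mono' (by fun_prop : Continuous fun v =>
    gW κ v ^ 2).aestronglyMeasurable (ae_of_all _ fun v => ?_)
  rw [Real.norm_eq_abs, abs_of_nonneg (sq_nonneg _)]
  have hb : |gW κ v| ≤ |κ| := by simpa [Real.norm_eq_abs] using norm_gW_le κ v
  calc gW κ v ^ 2 = |gW κ v| ^ 2 := (sq_abs _).symm
    _ ≤ |κ| ^ 2 := pow_le_pow_left₀ (abs_nonneg _) hb 2

/-- **Static one-body floor** for the witness: `1 + E_γ (gW κ)² ≤ E_γ e^{2 gW κ}` (symmetrise with the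
reflection of `v₀`, under which `gW` is odd and `γ` invariant, then `cosh y ≥ 1 + y²/2`). -/
theorem one_add_integral_sq_le_integral_exp_gW (κ : ℝ) :
    1 + ∫ v, gW κ v ^ 2 ∂stdGaussian V3 ≤ ∫ v, Real.exp (2 * gW κ v) ∂stdGaussian V3 := by
  have hexp := integrable_exp_mul_gW 2 κ
  have hexpn := integrable_exp_mul_gW (-2) κ
  have hsq := integrable_gW_sq κ
  have hsym : ∫ v, Real.exp (-2 * gW κ v) ∂stdGaussian V3 = ∫ v, Real.exp (2 * gW κ v) ∂stdGaussian V3 := by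
    have h := integral_stdGaussian_comp_flipLIE 0 (fun v => Real.exp (2 * gW κ v))
    simp only [gW_flip0, mul_neg] at h
    simpa [neg_mul] using h
  have hpt : ∀ v : V3, 2 + 2 * gW κ v ^ 2 ≤ Real.exp (2 * gW κ v) + Real.exp (-2 * gW κ v) := by
    intro v
    have h := two_add_sq_div_two_le_exp_add_exp_neg (2 * gW κ v)
    have h2 : (2 * gW κ v) ^ 2 / 2 = 2 * gW κ v ^ 2 := by ring
    rw [h2, ← neg_mul] at h
    exact h
  have hL : Integrable (fun v => 2 + 2 * gW κ v ^ 2) (stdGaussian V3) :=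
    (integrable_const (2 : ℝ)).add (hsq.const_mul 2)
  have hR : Integrable (fun v => Real.exp (2 * gW κ v) + Real.exp (-2 * gW κ v)) (stdGaussian V3) :=
    hexp.add hexpn
  have hmono : ∫ v, (2 + 2 * gW κ v ^ 2) ∂stdGaussian V3 ≤
      ∫ v, (Real.exp (2 * gW κ v) + Real.exp (-2 * gW κ v)) ∂stdGaussian V3 := integral_mono hL hR hpt
  have h1 : ∫ v, (2 + 2 * gW κ v ^ 2) ∂stdGaussian V3 = 2 + 2 * ∫ v, gW κ v ^ 2 ∂stdGaussian V3 := by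
    rw [integral_add (integrable_const _) (hsq.const_mul 2), integral_const_mul]
    simp
  have h2 : ∫ v, (Real.exp (2 * gW κ v) + Real.exp (-2 * gW κ v)) ∂stdGaussian V3 =
      2 * ∫ v, Real.exp (2 * gW κ v) ∂stdGaussian V3 := by
    rw [integral_add hexp hexpn, hsym]
    ring
  rw [h1, h2] at hmono
  linarith

/-- The witness is not a.e. zero: `E_γ (gW κ)² > 0` for `κ ≠ 0` (continuity, `gW κ (π/2, π/2, ·) = κ`, and the
standard Gaussian charges open sets since it has the everywhere-positive Maxwellian density). -/
theorem integral_gW_sq_pos {κ : ℝ} (hκ : κ ≠ 0) : 0 < ∫ v, gW κ v ^ 2 ∂stdGaussian V3 := by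
  rw [integral_pos_iff_support_of_nonneg (fun v => sq_nonneg _) (integrable_gW_sq κ)]
  have hopen : IsOpen (Function.support fun v : V3 => gW κ v ^ 2) :=
    isOpen_ne_fun (by fun_prop) continuous_const
  have hne : (Function.support fun v : V3 => gW κ v ^ 2).Nonempty := by
    refine ⟨WithLp.toLp 2 (fun _ : Fin 3 => Real.pi / 2), ?_⟩
    rw [Function.mem_support]
    simp [gW, hκ]
  have hac : (volume : Measure V3) ≪ stdGaussian V3 := by
    rw [show stdGaussian V3 = (volume : Measure V3).withDensity
        (fun v => ENNReal.ofReal (Literature.Analysis.FluidPDE.globalMaxwellian v)) from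
      Literature.Analysis.FluidPDE.stdGaussian_eq_withDensity_globalMaxwellian_holds]
    exact withDensity_absolutelyContinuous'
      (Literature.Analysis.FluidPDE.continuous_globalMaxwellian.measurable.ennreal_ofReal.aemeasurable)
      (ae_of_all _ fun v => (ENNReal.ofReal_pos.2 (Literature.Analysis.FluidPDE.globalMaxwellian_pos v)).ne')
  have hvol : 0 < (volume : Measure V3) (Function.support fun v : V3 => gW κ v ^ 2) :=
    hopen.measure_pos volume hne
  exact pos_iff_ne_zero.2 fun h0 => hvol.ne' (hac h0)

end StaticFloor

/-! ## (c) Natural strengthenings refuted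

### (c.1) No corrector (`W = 0`) — LANDED `Negative/Statics.lean` (p75902) -/

/-- (c.1) the flow-free static variant is FALSE (landed; re-exported by name). -/
theorem not_staticPressureDecay :
    ¬ Summit.AtomisticToContinuum.HydrodynamicLimit.Theorems.CorrectorPressureDecayNegative.Statics.StaticPressureDecay :=
  Summit.AtomisticToContinuum.HydrodynamicLimit.Theorems.CorrectorPressureDecayNegative.Statics.staticPressureDecay_false

/-- (c.1) the crux with `W = 0` is FALSE (landed; re-exported by name). -/
theorem not_correctorPressureDecayZeroCorrector :
    ¬ Summit.AtomisticToContinuum.HydrodynamicLimit.Theorems.CorrectorPressureDecayNegative.Statics.CorrectorPressureDecayZeroCorrector :=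
  Summit.AtomisticToContinuum.HydrodynamicLimit.Theorems.CorrectorPressureDecayNegative.Statics.correctorPressureDecay_false_zeroCorrector

/-! ### (a.2) The amplitude clause `∃κ` is load-bearing — LANDED `Negative/AmplitudeWitness.lean` (p75729) +
`Negative/AllAmplitudes.lean` (p75738) -/

/-- (a.2) `CorrectorPressureDecay` with `∃κ … |g| ≤ κ` replaced by `g bounded` is FALSE (landed; re-exported by name;
radial witness `hW`, low-energy invariant band, conditional Jensen — the energy-shell DV floor as a theorem). -/
theorem not_correctorPressureDecayAllAmplitudes :
    ¬ Summit.AtomisticToContinuum.HydrodynamicLimit.Theorems.CorrectorPressureDecayNegative.Amplitude.CorrectorPressureDecayAllAmplitudes :=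
  Summit.AtomisticToContinuum.HydrodynamicLimit.Theorems.CorrectorPressureDecayNegative.Amplitude.correctorPressureDecay_false_without_amplitude

/-! ### (a.3) Collisions (`σ > 0`) are load-bearing: the free gas (`σ = 0`) fails the crux

Cycle 1 proved this modulo `FreeFlowZeroDiameter ∧ ExponentialCertificate`; cycle 2 discharges the first (the free
gas IS a diameter-0 hard-sphere flow, landed `Negative/FreeFlow.lean`) and removes the second (the Mazur floor needs
no certificate): see (a.3″) below; only the two definitions are kept here. -/

section ZeroDiameter

open Literature.MathematicalPhysics.KineticTheory

/-- The crux's inner statement at reduced diameter `σ = 0` (the `∃σ₀ ∀σ<σ₀` prefix dropped and `σ := 0`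
substituted; `hsDiameter 0 N = 0`: point particles, free flight). -/
def CorrectorPressureDecayZeroDiameter : Prop :=
  ∀ (a θ : ℝ) (u₀ : V3), 0 < a → 0 < θ →
    (∀ (N : ℕ) (Φ : Flow 0 N),
      IsProbabilityMeasure (localGibbsLaw 0 (fun _ => a) (fun _ => u₀) (fun _ => θ) N Φ)) ∧
    ∃ κ : ℝ, 0 < κ ∧ ∀ (φ : T3 → ℝ) (g : V3 → ℝ), Continuous φ → Continuous g → (∀ x, |φ x| ≤ 1) →
      (∀ v, |g v| ≤ κ) →
      (∀ (c₀ c₂ : ℝ) (b : V3), ∫ v, g v * (c₀ + inner ℝ b v + c₂ * ‖v‖ ^ 2) ∂stdGaussian V3 = 0) →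
      ∀ δ : ℝ, 0 < δ → ∃ τ₀ : ℝ, 0 < τ₀ ∧ ∃ N₀ : ℕ, ∀ N : ℕ, N₀ ≤ N → ∀ Φ : Flow 0 N,
        ∃ lag : ℝ, 0 < lag ∧ ∃ W : Phase N → ℝ, Measurable W ∧ (∃ C : ℝ, ∀ z, |W z| ≤ C) ∧
          ∫⁻ z, ENNReal.ofReal (Real.exp (2 * ((∑ i, φ (z i).1 * g ((Real.sqrt θ)⁻¹ • ((z i).2 - u₀))) -
              lag⁻¹ * (W (Φ.flow lag z) - W z))))
            ∂(localGibbsLaw 0 (fun _ => a) (fun _ => u₀) (fun _ => θ) N Φ) ≤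
            ENNReal.ofReal (Real.exp (δ * (N + 1))) ∧
          ∫⁻ z, ENNReal.ofReal (Real.exp (4 * (τ₀ * ((N + 1 : ℕ) : ℝ) ^ (-(1 / 3 : ℝ)))⁻¹ * |W z|))
            ∂(localGibbsLaw 0 (fun _ => a) (fun _ => u₀) (fun _ => θ) N Φ) ≤
            ENNReal.ofReal (Real.exp (δ * (N + 1)))

/-- H₀: at diameter `0` there is, for every `N`, a hard-sphere flow structure whose flow map is free flight
(TRUE: free flight preserves Lebesgue measure — `measurePreserving_freeFlight_torus_holds` — and is a group of
collision-free trajectories off the Lebesgue-null coincidence set; NOT yet constructed in the tree, whose Alexander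
theorem `HardSphereFlow.nonempty_torus_holds` assumes `0 < ε`). -/
def FreeFlowZeroDiameter : Prop :=
  ∀ N : ℕ, ∃ Φ : Flow 0 N, ∀ (t : ℝ) (z : Phase N),
    Φ.flow t z = Literature.Analysis.FluidPDE.freeFlight (Literature.Analysis.FluidPDE.Torus.geometry (Fin 3)) t z

end ZeroDiameter

/-! ## Frame fact proved on the way (positive; for PROVERS): full `HomogeneousInvariance` (stmt-9621)

The all-drift invariance is now a LANDED theorem of the sibling crux's library
(`BoltzmannGreenKuboOrthMomentum.measurePreserving_flow_localGibbsLaw`, file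
`Theorems/BoltzmannGreenKubo/Negative/Stationarity.lean`); the by-name candidate proof of the support item is kept. -/

namespace HomInv

/-- **The constant-profile local Gibbs law is invariant under every hard-sphere flow** (any drift `u₀`). [cite: CIP1994, §4.2] -/
theorem measurePreserving_flow_localGibbsLaw (σ a θ : ℝ) (u₀ : V3) (N : ℕ)
    (Φ : HardSphereFlow (Literature.Analysis.FluidPDE.Torus.geometry (Fin 3)) (hsDiameter σ N) (N + 1)) (t : ℝ) :
    MeasurePreserving (Φ.flow t) (localGibbsLaw σ (fun _ => a) (fun _ => u₀) (fun _ => θ) N Φ)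
      (localGibbsLaw σ (fun _ => a) (fun _ => u₀) (fun _ => θ) N Φ) :=
  Summit.AtomisticToContinuum.HydrodynamicLimit.Theorems.BoltzmannGreenKuboOrthMomentum.measurePreserving_flow_localGibbsLaw
    a θ u₀ Φ t

/-- **Candidate proof of the support item `HomogeneousInvariance`** (stmt-AtomisticToContinuum-9621). [folklore] -/
theorem homogeneousInvariance :
    Summit.AtomisticToContinuum.HydrodynamicLimit.Theses.AntiMazurCoboundaries.HomogeneousInvariance := by
  intro σ c θc uc _hσ _hc _hθ N Φ t
  rw [HardSphereFlow.lawAt_eq]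
  exact (measurePreserving_flow_localGibbsLaw σ c θc uc N Φ t).map_eq

end HomInv

/-! ## (b) The LD Mazur floor — LANDED `Negative/MazurFloor.lean` (p77895; cycle 2)

`tilted_jensen`, `measurePreserving_tilted`, `integral_exp_le_integral_exp_sub_coboundary_of_invariant` (invariant
OBSERVABLE form), `mul_exp_average_le_setIntegral_exp_sub_coboundary` (invariant EVENT form = the kill criterion) are
imported by name above and used below.

## (a.3′) The free gas IS a hard-sphere flow of diameter `0` — LANDED `Negative/FreeFlow.lean` (p77921; cycle 2)

`FreeFlow.freeFlow`, `FreeFlow.freeFlow₀ N : Flow 0 N` (good set = no pair ever collinear with a lattice translate;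
measurable, invariant, collision-free, Liouville-conull by Fubini one particle at a time). -/

/-! ## (a.1′) Orthogonality to the MOMENTUM is load-bearing at EVERY amplitude (cycle 2)

Landing copy: `Theorems/CorrectorPressureDecay/Negative/OrthMomentum.lean`. Refines (a.1): only the momentum part of
the clause is dropped (`g ⊥ span(1, |v|²)` kept) and X is still FALSE for every κ. Mechanism: the exponential Mazur
charge bound with the UNBOUNDED invariant tilt `βP₀ = βΣᵢ(vᵢ)₀` (momentum conservation, sibling crux
BoltzmannGreenKubo's landed `Pobs_flow`): the tilted Gibbs law is flow-invariant, coboundaries have tilted mean zero,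
and `tilted_jensen'` (integrability form) gives per particle `β²/2 + 2κe^{−1/2} sin β − β² ≤ δ` — after bounding
`E_β[βP₀] ≤ log E e^{2βP₀} − log E e^{βP₀}` by a second tilted Jensen — for the odd witness `g = κ sin v₀`
(`E sin(β + Z) = e^{−1/2} sin β` from the Gaussian characteristic function): a FIRST-order gain against a SECOND-order
price, positive for small β WHATEVER κ. So the linear-response shell floors are amplitude-independent: only `⊥ v`
(and `⊥ |v|²`, the energy twin (a.1″) below) removes them, while `∃κ` removes the quadratic ones ((a.2)). -/

section OrthMomentum

open Literature.MathematicalPhysics.KineticTheory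
open Summit.AtomisticToContinuum.HydrodynamicLimit.Theorems.BoltzmannGreenKuboOrthMomentum (velOf measurable_velOf
  integral_velOf_localGibbsLaw integrable_velOf_localGibbsLaw Pobs Pobs_flow measurable_Pobs measurePreserving_coord
  integral_exp_mul_gaussianReal)

variable {Ω : Type*} [MeasurableSpace Ω]

/-! ## §1 Tilted Jensen, integrability form; a.e.-invariant tilts -/

/-- **Jensen under the tilted law, integrability form** (for unbounded tilts such as `βP₀`):
`(∫ e^V dμ) · exp(∫ (Y − V) d(μ.tilted V)) ≤ ∫ e^Y dμ`. [folklore] -/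
theorem tilted_jensen' {μ : Measure Ω} [IsProbabilityMeasure μ] {V Y : Ω → ℝ}
    (hV : Integrable (fun x => Real.exp (V x)) μ) (hY : Integrable (fun x => Real.exp (Y x)) μ)
    (hYV : Integrable (fun x => Y x - V x) (μ.tilted V)) :
    (∫ x, Real.exp (V x) ∂μ) * Real.exp (∫ x, (Y x - V x) ∂(μ.tilted V)) ≤ ∫ x, Real.exp (Y x) ∂μ := by
  haveI : IsProbabilityMeasure (μ.tilted V) := isProbabilityMeasure_tilted hV
  set Z : ℝ := ∫ x, Real.exp (V x) ∂μ with hZ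
  have hZpos : 0 < Z := by
    rw [hZ]; exact integral_exp_pos hV
  have hexpDint : Integrable (fun x => Real.exp (Y x - V x)) (μ.tilted V) := by
    rw [integrable_tilted_iff hV]
    refine hY.congr (ae_of_all _ fun x => ?_)
    simp only [smul_eq_mul, Real.exp_sub]
    rw [mul_div_cancel₀ _ (Real.exp_pos _).ne']
  have hJ := ConvexOn.map_integral_le convexOn_exp Real.continuous_exp.continuousOn isClosed_univ
    (ae_of_all _ fun x => mem_univ _) hYV hexpDint
  have hcomp : ∫ x, Real.exp (Y x - V x) ∂(μ.tilted V) = Z⁻¹ * ∫ x, Real.exp (Y x) ∂μ := by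
    rw [integral_tilted]
    simp_rw [smul_eq_mul, ← hZ]
    rw [← integral_const_mul]
    refine integral_congr_ae (ae_of_all _ fun x => ?_)
    show Real.exp (V x) / Z * Real.exp (Y x - V x) = Z⁻¹ * Real.exp (Y x)
    rw [Real.exp_sub, div_eq_mul_inv, mul_comm (Real.exp (V x)) Z⁻¹, mul_assoc,
      mul_div_cancel₀ _ (Real.exp_pos _).ne']
  rw [hcomp] at hJ
  have := mul_le_mul_of_nonneg_left hJ hZpos.le
  rwa [← mul_assoc, mul_inv_cancel₀ hZpos.ne', one_mul] at this

/-- Tilting by an a.e.-`T`-invariant potential keeps a measure-preserving `T` measure-preserving. [folklore] -/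
theorem measurePreserving_tilted_ae {μ : Measure Ω} {T : Ω → Ω} (hT : MeasurePreserving T μ μ)
    {V : Ω → ℝ} (hVm : Measurable V) (hinv : ∀ᵐ x ∂μ, V (T x) = V x) :
    MeasurePreserving T (μ.tilted V) (μ.tilted V) := by
  refine ⟨hT.measurable, ?_⟩
  set ρ : Ω → ℝ≥0∞ := fun x => ENNReal.ofReal (Real.exp (V x) / ∫ x, Real.exp (V x) ∂μ) with hρ
  have hρm : Measurable ρ := ((Real.continuous_exp.measurable.comp hVm).div_const _).ennreal_ofReal
  have htilt : μ.tilted V = μ.withDensity ρ := rfl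
  ext A hA
  rw [Measure.map_apply hT.measurable hA, htilt, withDensity_apply _ (hT.measurable hA), withDensity_apply _ hA,
    ← lintegral_indicator (hT.measurable hA), ← lintegral_indicator hA]
  have hae : (fun x => (T ⁻¹' A).indicator ρ x) =ᵐ[μ] fun x => (A.indicator ρ) (T x) := by
    filter_upwards [hinv] with x hx
    simp only [Set.indicator, mem_preimage, hρ, hx]
    rfl
  rw [lintegral_congr_ae hae, hT.lintegral_comp (hρm.indicator hA)]

/-! ## §2 One-dimensional Gaussian facts -/

/-- **Cameron–Martin in one dimension**: `∫ h(x) e^{βx} dγ₁(x) = e^{β²/2} ∫ h dN(β, 1)`. [folklore] -/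
theorem integral_mul_exp_mul_gaussianReal (h : ℝ → ℝ) (β : ℝ) :
    ∫ x, h x * Real.exp (β * x) ∂gaussianReal 0 1 = Real.exp (β ^ 2 / 2) * ∫ x, h x ∂gaussianReal β 1 := by
  rw [integral_gaussianReal_eq_integral_smul one_ne_zero, integral_gaussianReal_eq_integral_smul one_ne_zero,
    ← integral_const_mul]
  refine integral_congr_ae (ae_of_all _ fun x => ?_)
  simp only [smul_eq_mul, gaussianPDFReal_def, NNReal.coe_one, mul_one, sub_zero]
  have : Real.exp (-x ^ 2 / 2) * Real.exp (β * x) = Real.exp (β ^ 2 / 2) * Real.exp (-(x - β) ^ 2 / 2) := by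
    rw [← Real.exp_add, ← Real.exp_add]
    congr 1
    ring
  calc (Real.sqrt (2 * Real.pi))⁻¹ * Real.exp (-x ^ 2 / 2) * (h x * Real.exp (β * x))
      = (Real.sqrt (2 * Real.pi))⁻¹ * (Real.exp (-x ^ 2 / 2) * Real.exp (β * x)) * h x := by ring
    _ = Real.exp (β ^ 2 / 2) * ((Real.sqrt (2 * Real.pi))⁻¹ * Real.exp (-(x - β) ^ 2 / 2) * h x) := by
        rw [this]; ring

/-- … and with the shift made explicit: `∫ h(x) e^{βx} dγ₁ = e^{β²/2} ∫ h(x + β) dγ₁`. [folklore] -/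
theorem integral_mul_exp_mul_gaussianReal' {h : ℝ → ℝ} (hh : Measurable h) (β : ℝ) :
    ∫ x, h x * Real.exp (β * x) ∂gaussianReal 0 1 = Real.exp (β ^ 2 / 2) * ∫ x, h (x + β) ∂gaussianReal 0 1 := by
  rw [integral_mul_exp_mul_gaussianReal]
  congr 1
  have := gaussianReal_map_add_const (μ := 0) (v := 1) β
  rw [zero_add] at this
  rw [← this, integral_map (measurable_add_const β).aemeasurable hh.aestronglyMeasurable]

/-- `E cos Z = e^{−1/2}` for `Z ∼ N(0,1)` (real part of the characteristic function at `1`). [folklore] -/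
theorem integral_cos_gaussianReal : ∫ x, Real.cos x ∂gaussianReal 0 1 = Real.exp (-(1 / 2)) := by
  have h := charFun_gaussianReal (μ := 0) (v := 1) 1
  rw [charFun_apply_real] at h
  have hint : Integrable (fun x : ℝ => Complex.exp (((1 : ℝ) : ℂ) * x * Complex.I)) (gaussianReal 0 1) := by
    refine (integrable_const (1 : ℝ)).mono' (by fun_prop) (ae_of_all _ fun x => ?_)
    rw [Complex.norm_exp]
    simp
  have hre := integral_re hint
  rw [h] at hre
  simp only [Complex.ofReal_one, one_mul, Complex.ofReal_zero, mul_zero, zero_mul, NNReal.coe_one,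
    one_pow, mul_one, zero_sub] at hre
  have h1 : ∀ x : ℝ, RCLike.re (Complex.exp (↑x * Complex.I)) = Real.cos x := fun x => Complex.exp_ofReal_mul_I_re x
  simp_rw [h1] at hre
  rw [hre]
  have : (-((1 : ℂ) / 2)) = ((-(1 / 2) : ℝ) : ℂ) := by push_cast; ring
  rw [this, RCLike.re_eq_complex_re, Complex.exp_ofReal_re]

/-- `E sin Z = 0` for `Z ∼ N(0,1)` (imaginary part of the characteristic function at `1`). [folklore] -/
theorem integral_sin_gaussianReal : ∫ x, Real.sin x ∂gaussianReal 0 1 = 0 := by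
  have h := charFun_gaussianReal (μ := 0) (v := 1) 1
  rw [charFun_apply_real] at h
  have hint : Integrable (fun x : ℝ => Complex.exp (((1 : ℝ) : ℂ) * x * Complex.I)) (gaussianReal 0 1) := by
    refine (integrable_const (1 : ℝ)).mono' (by fun_prop) (ae_of_all _ fun x => ?_)
    rw [Complex.norm_exp]
    simp
  have him := integral_im hint
  rw [h] at him
  simp only [Complex.ofReal_one, one_mul, Complex.ofReal_zero, mul_zero, zero_mul, NNReal.coe_one,
    one_pow, mul_one, zero_sub] at him
  have h1 : ∀ x : ℝ, RCLike.im (Complex.exp (↑x * Complex.I)) = Real.sin x := fun x => Complex.exp_ofReal_mul_I_im x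
  simp_rw [h1] at him
  rw [him]
  have : (-((1 : ℂ) / 2)) = ((-(1 / 2) : ℝ) : ℂ) := by push_cast; ring
  rw [this, RCLike.im_eq_complex_im, Complex.exp_ofReal_im]

/-- `E sin(Z + β) = e^{−1/2} sin β`. [folklore] -/
theorem integral_sin_add_gaussianReal (β : ℝ) :
    ∫ x, Real.sin (x + β) ∂gaussianReal 0 1 = Real.exp (-(1 / 2)) * Real.sin β := by
  simp_rw [Real.sin_add]
  have hs : Integrable (fun x => Real.sin x * Real.cos β) (gaussianReal 0 1) :=
    (integrable_of_abs_le Real.continuous_sin.measurable (C := 1) fun x => Real.abs_sin_le_one x).mul_const _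
  have hc : Integrable (fun x => Real.cos x * Real.sin β) (gaussianReal 0 1) :=
    (integrable_of_abs_le Real.continuous_cos.measurable (C := 1) fun x => Real.abs_cos_le_one x).mul_const _
  rw [integral_add hs hc, integral_mul_const, integral_mul_const, integral_sin_gaussianReal, integral_cos_gaussianReal]
  ring

/-- `∫ sin(x) e^{βx} dγ₁ = e^{β²/2} e^{−1/2} sin β`. [folklore] -/
theorem integral_sin_mul_exp_gaussianReal (β : ℝ) :
    ∫ x, Real.sin x * Real.exp (β * x) ∂gaussianReal 0 1 = Real.exp (β ^ 2 / 2) * (Real.exp (-(1 / 2)) * Real.sin β) := by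
  rw [integral_mul_exp_mul_gaussianReal' Real.continuous_sin.measurable, integral_sin_add_gaussianReal]

/-- `∫ x e^{βx} dγ₁ = e^{β²/2} β`. [folklore] -/
theorem integral_id_mul_exp_gaussianReal (β : ℝ) :
    ∫ x, x * Real.exp (β * x) ∂gaussianReal 0 1 = Real.exp (β ^ 2 / 2) * β := by
  rw [integral_mul_exp_mul_gaussianReal, integral_id_gaussianReal]

/-! ## §3 Lifting to `ℝ³` and to the `N`-body product Gaussian -/

/-- Functions of one coordinate integrate against the one-dimensional Gaussian. [folklore] -/
theorem integral_coord_stdGaussian (k : Fin 3) {h : ℝ → ℝ} (hh : Measurable h) :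
    ∫ w, h (w k) ∂stdGaussian V3 = ∫ x, h x ∂gaussianReal 0 1 := by
  have hmp := measurePreserving_coord k
  rw [← hmp.map_eq, integral_map hmp.measurable.aemeasurable hh.aestronglyMeasurable]

/-- The product standard Gaussian on `(ℝ³)^{N+1}`. -/
abbrev piGauss (N : ℕ) : Measure (Fin (N + 1) → V3) := Measure.pi fun _ : Fin (N + 1) => stdGaussian V3

/-- Moment generating function of `βΣᵢ(vᵢ)₀`: `∫ e^{βΣ(vᵢ)₀} d⊗γ = (e^{β²/2})^{N+1}`. [folklore] -/
theorem integral_exp_mul_sum_coord (N : ℕ) (β : ℝ) :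
    ∫ v, Real.exp (β * ∑ i, v i 0) ∂piGauss N = Real.exp (β ^ 2 / 2) ^ (N + 1) := by
  have : ∀ v : Fin (N + 1) → V3, Real.exp (β * ∑ i, v i 0) = ∏ i, Real.exp (β * v i 0) := by
    intro v
    rw [Finset.mul_sum, Real.exp_sum]
  simp_rw [this]
  rw [integral_fintype_prod_eq_prod (fun (_ : Fin (N + 1)) (w : V3) => Real.exp (β * w 0))]
  simp only [Finset.prod_const, Finset.card_univ, Fintype.card_fin]
  congr 1
  rw [integral_coord_stdGaussian 0 (by fun_prop : Measurable fun x : ℝ => Real.exp (β * x)),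
    integral_exp_mul_gaussianReal]

/-- One distinguished factor: `∫ h((vᵢ)₀) e^{βΣ(vⱼ)₀} d⊗γ = (∫ h e^{β·} dγ₁)·(e^{β²/2})^N`. [folklore] -/
theorem integral_mul_exp_mul_sum_coord (N : ℕ) (β : ℝ) {h : ℝ → ℝ} (hh : Measurable h) (i : Fin (N + 1)) :
    ∫ v, h (v i 0) * Real.exp (β * ∑ j, v j 0) ∂piGauss N =
      (∫ x, h x * Real.exp (β * x) ∂gaussianReal 0 1) * Real.exp (β ^ 2 / 2) ^ N := by
  classical
  set f : Fin (N + 1) → V3 → ℝ := fun j w => (if j = i then h (w 0) else 1) * Real.exp (β * w 0) with hf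
  have hprod : ∀ v : Fin (N + 1) → V3, h (v i 0) * Real.exp (β * ∑ j, v j 0) = ∏ j, f j (v j) := by
    intro v
    rw [hf]
    simp only
    rw [Finset.prod_mul_distrib, Finset.prod_ite_eq' Finset.univ i (fun j => h (v j 0)), if_pos (Finset.mem_univ i),
      Finset.mul_sum, Real.exp_sum]
  simp_rw [hprod]
  rw [integral_fintype_prod_eq_prod f]
  have hsplit : ∏ j, ∫ w, f j w ∂stdGaussian V3 =
      (∫ w, f i w ∂stdGaussian V3) * ∏ j ∈ Finset.univ.erase i, ∫ w, f j w ∂stdGaussian V3 :=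
    (Finset.mul_prod_erase Finset.univ (fun j => ∫ w, f j w ∂stdGaussian V3) (Finset.mem_univ i)).symm
  rw [hsplit]
  have hi : ∫ w, f i w ∂stdGaussian V3 = ∫ x, h x * Real.exp (β * x) ∂gaussianReal 0 1 := by
    simp only [hf, if_true]
    exact integral_coord_stdGaussian 0 (h := fun x => h x * Real.exp (β * x))
      (hh.mul (by fun_prop : Measurable fun x : ℝ => Real.exp (β * x)))
  have hj : ∀ j ∈ Finset.univ.erase i, ∫ w, f j w ∂stdGaussian V3 = Real.exp (β ^ 2 / 2) := by
    intro j hj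
    have hji : j ≠ i := Finset.ne_of_mem_erase hj
    simp only [hf, if_neg hji, one_mul]
    rw [integral_coord_stdGaussian 0 (by fun_prop : Measurable fun x : ℝ => Real.exp (β * x)),
      integral_exp_mul_gaussianReal]
  rw [hi, Finset.prod_congr rfl hj, Finset.prod_const, Finset.card_erase_of_mem (Finset.mem_univ i),
    Finset.card_univ, Fintype.card_fin, Nat.add_sub_cancel]

/-- Integrability of the momentum mgf family on the product Gaussian. [folklore] -/
theorem integrable_exp_mul_sum_coord (N : ℕ) (β : ℝ) :
    Integrable (fun v : Fin (N + 1) → V3 => Real.exp (β * ∑ i, v i 0)) (piGauss N) := by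
  have : (fun v : Fin (N + 1) → V3 => Real.exp (β * ∑ i, v i 0)) =
      fun v => ∏ i, (fun (_ : Fin (N + 1)) (w : V3) => Real.exp (β * w 0)) i (v i) := by
    funext v
    rw [Finset.mul_sum, Real.exp_sum]
  rw [this]
  refine Integrable.fintype_prod (f := fun (_ : Fin (N + 1)) (w : V3) => Real.exp (β * w 0))
    (μ := fun _ : Fin (N + 1) => stdGaussian V3) fun i => ?_
  have hmp := measurePreserving_coord (0 : Fin 3)
  exact (hmp.integrable_comp (by fun_prop : Measurable fun x : ℝ => Real.exp (β * x)).aestronglyMeasurable).2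
    (integrable_exp_mul_gaussianReal β)

/-! ## §4 The refutation -/

/-- `CorrectorPressureDecay` with the orthogonality clause WEAKENED to `g ⊥ span(1, |v|²)` (the momentum term
`inner b v` deleted; all other tokens verbatim). A variant statement refuted below, not a fact. -/
def CorrectorPressureDecayWithoutOrthMomentum : Prop :=
  ∀ (a θ : ℝ) (u₀ : V3), 0 < a → 0 < θ → ∃ σ₀ : ℝ, 0 < σ₀ ∧ ∀ σ : ℝ, 0 < σ → σ < σ₀ →
    (∀ (N : ℕ) (Φ : Flow σ N),
      IsProbabilityMeasure (localGibbsLaw σ (fun _ => a) (fun _ => u₀) (fun _ => θ) N Φ)) ∧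
    ∃ κ : ℝ, 0 < κ ∧ ∀ (φ : T3 → ℝ) (g : V3 → ℝ), Continuous φ → Continuous g → (∀ x, |φ x| ≤ 1) →
      (∀ v, |g v| ≤ κ) →
      (∀ (c₀ c₂ : ℝ), ∫ v, g v * (c₀ + c₂ * ‖v‖ ^ 2) ∂stdGaussian V3 = 0) →
      ∀ δ : ℝ, 0 < δ → ∃ τ₀ : ℝ, 0 < τ₀ ∧ ∃ N₀ : ℕ, ∀ N : ℕ, N₀ ≤ N → ∀ Φ : Flow σ N,
        ∃ lag : ℝ, 0 < lag ∧ ∃ W : Phase N → ℝ, Measurable W ∧ (∃ C : ℝ, ∀ z, |W z| ≤ C) ∧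
          ∫⁻ z, ENNReal.ofReal (Real.exp (2 * ((∑ i, φ (z i).1 * g ((Real.sqrt θ)⁻¹ • ((z i).2 - u₀))) -
              lag⁻¹ * (W (Φ.flow lag z) - W z))))
            ∂(localGibbsLaw σ (fun _ => a) (fun _ => u₀) (fun _ => θ) N Φ) ≤
            ENNReal.ofReal (Real.exp (δ * (N + 1))) ∧
          ∫⁻ z, ENNReal.ofReal (Real.exp (4 * (τ₀ * ((N + 1 : ℕ) : ℝ) ^ (-(1 / 3 : ℝ)))⁻¹ * |W z|))
            ∂(localGibbsLaw σ (fun _ => a) (fun _ => u₀) (fun _ => θ) N Φ) ≤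
            ENNReal.ofReal (Real.exp (δ * (N + 1)))

/-- The witness `g(v) = κ sin v₀` is `γ`-orthogonal to `span(1, |v|²)` (odd under `v ↦ −v`). [folklore] -/
theorem sin_coord_orth (κ c₀ c₂ : ℝ) :
    ∫ v, κ * Real.sin (v 0) * (c₀ + c₂ * ‖v‖ ^ 2) ∂stdGaussian V3 = 0 := by
  refine integral_stdGaussian_eq_zero_of_odd 0 fun v => ?_
  rw [LinearIsometryEquiv.norm_map, flipLIE_apply, if_pos rfl, Real.sin_neg]
  ring

/-- `|x| ≤ eˣ + e⁻ˣ`. [folklore] -/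
theorem abs_le_exp_add_exp_neg (x : ℝ) : |x| ≤ Real.exp x + Real.exp (-x) := by
  have h1 := Real.add_one_le_exp x
  have h2 := Real.add_one_le_exp (-x)
  have h3 := Real.exp_pos x
  have h4 := Real.exp_pos (-x)
  rw [abs_le]
  constructor <;> linarith

/-- **Orthogonality to the MOMENTUM is load-bearing at every amplitude: X so weakened is FALSE.** Witness
`a = θ = 1`, `u₀ = 0`, `σ = min(σ₀/2, 1/4)`, `φ ≡ 1`, `g = κ sin v₀` (the prover's own `κ`), `m = min(κ, 1)`,
`β = m/4`, `δ = m²/20`, `N = N₀`, any flow: the momentum tilt `βΣᵢ(vᵢ)₀` of `G_N` is flow-invariant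
(`Pobs_flow` a.e.), so by `tilted_jensen'` the defect pressure per particle is at least
`β²/2 + 2κ e^{−1/2} sin β − β² ≥ (83/384) m² > δ`. [folklore] -/
theorem not_correctorPressureDecayWithoutOrthMomentum : ¬ CorrectorPressureDecayWithoutOrthMomentum := by
  intro h
  obtain ⟨σ₀, hσ₀, hσ⟩ := h 1 1 0 one_pos one_pos
  set σ : ℝ := min (σ₀ / 2) 4⁻¹ with hσdef
  have hσpos : 0 < σ := lt_min (by linarith) (by norm_num)
  have hσlt : σ < σ₀ := (min_le_left _ _).trans_lt (by linarith)
  have hσ2 : σ ≤ 1 / 2 := (min_le_right _ _).trans (by norm_num)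
  have hσ2' : σ < 2⁻¹ := (min_le_right _ _).trans_lt (by norm_num)
  obtain ⟨hprob, κ, hκ, hmain⟩ := hσ σ hσpos hσlt
  -- parameters
  set m : ℝ := min κ 1 with hm
  have hm0 : 0 < m := lt_min hκ one_pos
  have hmκ : m ≤ κ := min_le_left _ _
  have hm1 : m ≤ 1 := min_le_right _ _
  set β : ℝ := m / 4 with hβ
  have hβpos : 0 < β := by positivity
  have hβle : β ≤ 1 / 4 := by rw [hβ]; linarith
  set δ : ℝ := m ^ 2 / 20 with hδ
  have hδpos : 0 < δ := by positivity
  -- the witness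
  set g : V3 → ℝ := fun v => κ * Real.sin (v 0) with hg
  have hgc : Continuous g := by
    have h0 : Continuous fun w : V3 => w 0 := (EuclideanSpace.proj (𝕜 := ℝ) (0 : Fin 3)).continuous
    exact continuous_const.mul (Real.continuous_sin.comp h0)
  have hgκ : ∀ v, |g v| ≤ κ := fun v => by
    rw [hg, abs_mul, abs_of_pos hκ]
    exact mul_le_of_le_one_right hκ.le (Real.abs_sin_le_one _)
  obtain ⟨τ₀, _hτ₀, N₀, hN⟩ := hmain (fun _ => 1) g continuous_const hgc (fun _ => by simp) hgκ
    (fun c₀ c₂ => sin_coord_orth κ c₀ c₂) δ hδpos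
  obtain ⟨Φ⟩ := nonempty_flow hσpos hσ2' N₀
  obtain ⟨lag, hlag, W, hWm, ⟨CW, hW⟩, h1, _h2⟩ := hN N₀ le_rfl Φ
  haveI := hprob N₀ Φ
  set G := localGibbsLaw σ (fun _ => (1 : ℝ)) (fun _ => (0 : V3)) (fun _ => (1 : ℝ)) N₀ Φ with hGdef
  have hT : MeasurePreserving (Φ.flow lag) G G := measurePreserving_flow_localGibbsLaw 1 1 N₀ Φ lag
  have hgood : G Φ.goodᶜ = 0 := by
    rw [hGdef, localGibbsLaw_eq]
    exact localGibbsMeasure_absolutelyContinuous σ _ _ _ N₀ Φ Φ.measure_compl_good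
  -- the invariant tilt `V = β P₀`
  set V : Phase N₀ → ℝ := fun z => β * Pobs z with hV
  have hVm : Measurable V := measurable_const.mul measurable_Pobs
  have hVinv : ∀ᵐ z ∂G, V (Φ.flow lag z) = V z := by
    have : ∀ᵐ z ∂G, z ∈ Φ.good := mem_ae_iff.2 hgood
    filter_upwards [this] with z hz
    simp only [hV, Pobs_flow Φ hz lag]
  -- velocity-only reduction data
  have hVvel : ∀ z : Phase N₀, V z = (fun v : Fin (N₀ + 1) → V3 => β * ∑ i, v i 0) (velOf z) := fun z => rfl
  have hexpV : ∀ c : ℝ, Integrable (fun z : Phase N₀ => Real.exp (c * Pobs z)) G := by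
    intro c
    have := integrable_velOf_localGibbsLaw hσ2 N₀ Φ (integrable_exp_mul_sum_coord N₀ c)
    exact this
  have hVexp : Integrable (fun z => Real.exp (V z)) G := hexpV β
  -- the tilted law `Q` is flow-invariant
  set Q : Measure (Phase N₀) := G.tilted V with hQ
  haveI hQprob : IsProbabilityMeasure Q := isProbabilityMeasure_tilted hVexp
  have hTQ : MeasurePreserving (Φ.flow lag) Q Q := measurePreserving_tilted_ae hT hVm hVinv
  -- the defect integrand `Y = F − 2 lag⁻¹ (W∘Φ − W)`, `F = Σ 2κ sin (vᵢ)₀`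
  set F : Phase N₀ → ℝ := fun z => ∑ i, 2 * κ * Real.sin ((z i).2 0) with hF
  have hFm : Measurable F := by
    refine Finset.measurable_sum _ fun i _ => ?_
    exact measurable_const.mul (Real.continuous_sin.measurable.comp
      ((EuclideanSpace.proj (𝕜 := ℝ) (0 : Fin 3)).continuous.measurable.comp (measurable_pi_apply i).snd))
  have hFb : ∀ z, |F z| ≤ ∑ _i : Fin (N₀ + 1), 2 * κ := fun z =>
    (Finset.abs_sum_le_sum_abs _ _).trans (Finset.sum_le_sum fun i _ => by
      rw [abs_mul, abs_of_pos (by positivity : (0 : ℝ) < 2 * κ)]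
      exact mul_le_of_le_one_right (by positivity) (Real.abs_sin_le_one _))
  set Y : Phase N₀ → ℝ := fun z => F z - 2 * lag⁻¹ * (W (Φ.flow lag z) - W z) with hY
  have hrw1 : ∀ z : Phase N₀, Real.exp (2 * ((∑ i, (fun _ : T3 => (1 : ℝ)) (z i).1 *
      g ((Real.sqrt 1)⁻¹ • ((z i).2 - 0))) - lag⁻¹ * (W (Φ.flow lag z) - W z))) = Real.exp (Y z) := by
    intro z
    simp only [hY, hF, hg, Real.sqrt_one, inv_one, sub_zero, one_smul, one_mul]
    congr 1
    rw [mul_sub, Finset.mul_sum]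
    congr 1
    · exact Finset.sum_congr rfl fun i _ => by ring
    · ring
  simp_rw [hrw1] at h1
  have hWΦm : Measurable fun z => W (Φ.flow lag z) := hWm.comp (Φ.measurable_flow lag)
  have hYm : Measurable Y := hFm.sub (measurable_const.mul (hWΦm.sub hWm))
  have hYb : ∀ z, |Y z| ≤ (∑ _i : Fin (N₀ + 1), 2 * κ) + |2 * lag⁻¹| * (CW + CW) := by
    intro z
    calc |Y z| ≤ |F z| + |2 * lag⁻¹ * (W (Φ.flow lag z) - W z)| := abs_sub _ _
      _ = |F z| + |2 * lag⁻¹| * |W (Φ.flow lag z) - W z| := by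
          rw [abs_mul (2 * lag⁻¹) (W (Φ.flow lag z) - W z)]
      _ ≤ _ := by
          gcongr
          · exact hFb z
          · exact (abs_sub _ _).trans (add_le_add (hW _) (hW _))
  have hYexp : Integrable (fun z => Real.exp (Y z)) G := integrable_exp_of_abs_le hYm hYb
  have hI1 : ∫ z, Real.exp (Y z) ∂G ≤ Real.exp (δ * (N₀ + 1)) := by
    rw [← ofReal_integral_eq_lintegral_ofReal hYexp (ae_of_all _ fun _ => (Real.exp_pos _).le),
      ENNReal.ofReal_le_ofReal_iff (Real.exp_pos _).le] at h1
    exact h1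
  -- integrability of `V` under `Q`
  have hVQ : Integrable V Q := by
    rw [hQ, integrable_tilted_iff hVexp]
    have hbound : Integrable (fun z => β * (Real.exp ((β + 1) * Pobs z) + Real.exp ((β - 1) * Pobs z))) G :=
      ((hexpV (β + 1)).add (hexpV (β - 1))).const_mul β
    refine hbound.mono' ((Real.continuous_exp.measurable.comp hVm).smul hVm).aestronglyMeasurable
      (ae_of_all _ fun z => ?_)
    simp only [hV, smul_eq_mul, Real.norm_eq_abs]
    rw [abs_mul, abs_of_pos (Real.exp_pos _), abs_mul, abs_of_pos hβpos]
    have hx := abs_le_exp_add_exp_neg (Pobs z)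
    have hpos := Real.exp_pos (β * Pobs z)
    calc Real.exp (β * Pobs z) * (β * |Pobs z|) = β * (Real.exp (β * Pobs z) * |Pobs z|) := by ring
      _ ≤ β * (Real.exp (β * Pobs z) * (Real.exp (Pobs z) + Real.exp (-Pobs z))) := by gcongr
      _ = β * (Real.exp ((β + 1) * Pobs z) + Real.exp ((β - 1) * Pobs z)) := by
          rw [mul_add, ← Real.exp_add, ← Real.exp_add]
          congr 2 <;> congr 1 <;> ring
  have hYQ : Integrable Y Q := integrable_of_abs_le hYm hYb
  have hYV : Integrable (fun z => Y z - V z) Q := hYQ.sub hVQ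
  -- TILTED JENSEN
  have hJ := tilted_jensen' (μ := G) hVexp hYexp hYV
  -- evaluate `∫ (Y − V) dQ = E_Q F − E_Q V` (the coboundary drops by invariance of `Q`)
  have hFQ : Integrable F Q := integrable_of_abs_le hFm hFb
  have hWQ : Integrable W Q := integrable_of_abs_le hWm hW
  have hWΦQ : Integrable (fun z => W (Φ.flow lag z)) Q := integrable_of_abs_le hWΦm fun z => hW _
  have hWT : ∫ z, W (Φ.flow lag z) ∂Q = ∫ z, W z ∂Q := by
    rw [← integral_map hTQ.measurable.aemeasurable hWm.aestronglyMeasurable, hTQ.map_eq]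
  have hmean : ∫ z, (Y z - V z) ∂Q = (∫ z, F z ∂Q) - ∫ z, V z ∂Q := by
    have hD : Integrable (fun z => 2 * lag⁻¹ * (W (Φ.flow lag z) - W z)) Q := (hWΦQ.sub hWQ).const_mul _
    have hFD : Integrable (fun z => F z - 2 * lag⁻¹ * (W (Φ.flow lag z) - W z)) Q := hFQ.sub hD
    have e1 : (fun z => Y z - V z) = fun z => (F z - 2 * lag⁻¹ * (W (Φ.flow lag z) - W z)) - V z := rfl
    rw [e1, integral_sub hFD hVQ, integral_sub hFQ hD, integral_const_mul, integral_sub hWΦQ hWQ, hWT,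
      sub_self, mul_zero, sub_zero]
  -- the three Gaussian values
  set E1 : ℝ := Real.exp (β ^ 2 / 2) with hE1
  have hZ : ∫ z, Real.exp (V z) ∂G = E1 ^ (N₀ + 1) := by
    have := integral_velOf_localGibbsLaw hσ2 N₀ Φ (H := fun v : Fin (N₀ + 1) → V3 => Real.exp (β * ∑ i, v i 0))
      (by fun_prop)
    rw [integral_exp_mul_sum_coord] at this
    exact this
  have hnumF : ∫ z, F z * Real.exp (V z) ∂G =
      ((N₀ : ℝ) + 1) * (2 * κ * (E1 * (Real.exp (-(1 / 2)) * Real.sin β))) * E1 ^ N₀ := by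
    have hH : Measurable fun v : Fin (N₀ + 1) → V3 =>
        ∑ i, 2 * κ * Real.sin (v i 0) * Real.exp (β * ∑ j, v j 0) := by
      fun_prop
    have := integral_velOf_localGibbsLaw hσ2 N₀ Φ hH
    have hlhs : (fun z : Phase N₀ => F z * Real.exp (V z)) =
        fun z => (fun v : Fin (N₀ + 1) → V3 => ∑ i, 2 * κ * Real.sin (v i 0) * Real.exp (β * ∑ j, v j 0))
          (velOf z) := by
      funext z
      show F z * Real.exp (V z) = ∑ i, 2 * κ * Real.sin ((velOf z) i 0) * Real.exp (β * ∑ j, (velOf z) j 0)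
      rw [hF, hV, Finset.sum_mul]
      rfl
    rw [hlhs, this]
    have hterm : ∀ i : Fin (N₀ + 1), Integrable (fun v : Fin (N₀ + 1) → V3 =>
        2 * κ * Real.sin (v i 0) * Real.exp (β * ∑ j, v j 0)) (piGauss N₀) := by
      intro i
      refine ((integrable_exp_mul_sum_coord N₀ β).const_mul (2 * κ)).mono' (by fun_prop)
        (ae_of_all _ fun v => ?_)
      rw [Real.norm_eq_abs, abs_mul, abs_mul, abs_of_pos (by positivity : (0 : ℝ) < 2 * κ),
        abs_of_pos (Real.exp_pos _)]
      exact mul_le_mul_of_nonneg_right (mul_le_of_le_one_right (by positivity) (Real.abs_sin_le_one _))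
        (Real.exp_pos _).le
    rw [integral_finsetSum _ fun i _ => hterm i]
    have hi : ∀ i : Fin (N₀ + 1), ∫ v, 2 * κ * Real.sin (v i 0) * Real.exp (β * ∑ j, v j 0) ∂piGauss N₀ =
        2 * κ * (E1 * (Real.exp (-(1 / 2)) * Real.sin β)) * E1 ^ N₀ := by
      intro i
      have := integral_mul_exp_mul_sum_coord N₀ β (h := fun x => 2 * κ * Real.sin x) (by fun_prop) i
      simp only at this
      rw [this]
      have h1d : ∫ x, 2 * κ * Real.sin x * Real.exp (β * x) ∂gaussianReal 0 1 =
          2 * κ * (E1 * (Real.exp (-(1 / 2)) * Real.sin β)) := by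
        simp_rw [mul_assoc]
        rw [integral_const_mul, integral_const_mul, integral_sin_mul_exp_gaussianReal β, ← hE1]
      rw [h1d]
    simp only [hi, Finset.sum_const, Finset.card_univ, Fintype.card_fin, nsmul_eq_mul]
    push_cast
    ring
  -- `A = E_Q F = (N+1)·2κ e^{-1/2} sin β`
  have hE1pos : 0 < E1 := by rw [hE1]; exact Real.exp_pos _
  have hA : ∫ z, F z ∂Q = ((N₀ : ℝ) + 1) * (2 * κ * (Real.exp (-(1 / 2)) * Real.sin β)) := by
    rw [hQ, integral_tilted]
    have : (fun z => (Real.exp (V z) / ∫ x, Real.exp (V x) ∂G) • F z) =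
        fun z => (∫ x, Real.exp (V x) ∂G)⁻¹ * (F z * Real.exp (V z)) := by
      funext z; simp only [smul_eq_mul]; ring
    rw [this, integral_const_mul, hnumF, hZ, pow_succ]
    field_simp
  -- the Gibbs bound on `B = E_Q V`: `Z · e^{B} ≤ ∫ e^{2V} dG = E2^{N+1}`
  have hV2exp : Integrable (fun z => Real.exp (2 * V z)) G := by
    have := hexpV (2 * β)
    refine this.congr (ae_of_all _ fun z => ?_)
    simp only [hV]
    ring_nf
  have hJ2 := tilted_jensen' (μ := G) (V := V) (Y := fun z => 2 * V z) hVexp hV2exp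
    (by simpa [two_mul] using hVQ)
  have hB2 : ∫ z, (2 * V z - V z) ∂Q = ∫ z, V z ∂Q := by
    congr 1; funext z; ring
  rw [hB2] at hJ2
  set E2 : ℝ := Real.exp ((2 * β) ^ 2 / 2) with hE2
  have hZ2 : ∫ z, Real.exp (2 * V z) ∂G = E2 ^ (N₀ + 1) := by
    have := integral_velOf_localGibbsLaw hσ2 N₀ Φ
      (H := fun v : Fin (N₀ + 1) → V3 => Real.exp ((2 * β) * ∑ i, v i 0)) (by fun_prop)
    rw [integral_exp_mul_sum_coord] at this
    rw [← this]
    congr 1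
    funext z
    show Real.exp (2 * V z) = Real.exp ((2 * β) * ∑ i, (velOf z) i 0)
    rw [hV]
    congr 1
    show 2 * (β * Pobs z) = 2 * β * ∑ i, (velOf z) i 0
    rw [mul_assoc]
    rfl
  rw [hZ2, hZ] at hJ2
  -- combine: `Z² e^{A} ≤ e^{δ(N+1)} · E2^{N+1}`
  rw [hmean, hA, hZ] at hJ
  set A : ℝ := ((N₀ : ℝ) + 1) * (2 * κ * (Real.exp (-(1 / 2)) * Real.sin β)) with hAdef
  set B : ℝ := ∫ z, V z ∂Q with hBdef
  have hJ' : E1 ^ (N₀ + 1) * Real.exp (A - B) ≤ Real.exp (δ * (N₀ + 1)) := hJ.trans hI1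
  have hprod : (E1 ^ (N₀ + 1) * Real.exp (A - B)) * (E1 ^ (N₀ + 1) * Real.exp B) ≤
      Real.exp (δ * (N₀ + 1)) * E2 ^ (N₀ + 1) :=
    mul_le_mul hJ' hJ2 (by positivity) (by positivity)
  have hE1pow : E1 ^ (N₀ + 1) = Real.exp (((N₀ : ℝ) + 1) * (β ^ 2 / 2)) := by
    rw [hE1, ← Real.exp_nat_mul]
    congr 1
    push_cast
    ring
  have hE2pow : E2 ^ (N₀ + 1) = Real.exp (((N₀ : ℝ) + 1) * (2 * β ^ 2)) := by
    rw [hE2, ← Real.exp_nat_mul]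
    congr 1
    push_cast
    ring
  have hlhs : (E1 ^ (N₀ + 1) * Real.exp (A - B)) * (E1 ^ (N₀ + 1) * Real.exp B) =
      Real.exp (((N₀ : ℝ) + 1) * β ^ 2 + A) := by
    rw [hE1pow, ← Real.exp_add, ← Real.exp_add, ← Real.exp_add]
    congr 1
    ring
  have hrhs : Real.exp (δ * (N₀ + 1)) * E2 ^ (N₀ + 1) = Real.exp (((N₀ : ℝ) + 1) * (δ + 2 * β ^ 2)) := by
    rw [hE2pow, ← Real.exp_add]
    congr 1
    ring
  rw [hlhs, hrhs, Real.exp_le_exp] at hprod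
  -- per particle: `2κ e^{-1/2} sin β ≤ δ + β²`, contradicting the numbers
  have hn : (0 : ℝ) < (N₀ : ℝ) + 1 := by positivity
  have hpp : 2 * κ * (Real.exp (-(1 / 2)) * Real.sin β) ≤ δ + β ^ 2 := by
    have : ((N₀ : ℝ) + 1) * (2 * κ * (Real.exp (-(1 / 2)) * Real.sin β)) ≤ ((N₀ : ℝ) + 1) * (δ + β ^ 2) := by
      rw [hAdef] at hprod; linarith
    exact le_of_mul_le_mul_left this hn
  have he : 1 / 2 ≤ Real.exp (-(1 / 2)) := by linarith [Real.add_one_le_exp (-(1 / 2) : ℝ)]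
  have hsin : β - β ^ 3 / 6 < Real.sin β := Real.sin_gt_sub_cube hβpos
  have hsinpos : 0 ≤ Real.sin β := Real.sin_nonneg_of_nonneg_of_le_pi hβpos.le (by linarith [Real.pi_gt_three])
  have hβsq : β ^ 2 ≤ 1 / 16 := by
    have := pow_le_pow_left₀ hβpos.le hβle 2
    norm_num at this
    exact this
  have hβ3 : β ^ 3 / 6 ≤ β / 96 := by
    have : β ^ 3 ≤ β * (1 / 16) := by
      rw [show β ^ 3 = β * β ^ 2 by ring]
      exact mul_le_mul_of_nonneg_left hβsq hβpos.le
    linarith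
  have hs : 95 / 96 * β ≤ Real.sin β := by linarith
  have h1 : κ * (95 / 96 * β) ≤ 2 * κ * (Real.exp (-(1 / 2)) * Real.sin β) := by
    calc κ * (95 / 96 * β) ≤ κ * Real.sin β := mul_le_mul_of_nonneg_left hs hκ.le
      _ = 2 * κ * (1 / 2 * Real.sin β) := by ring
      _ ≤ 2 * κ * (Real.exp (-(1 / 2)) * Real.sin β) :=
          mul_le_mul_of_nonneg_left (mul_le_mul_of_nonneg_right he hsinpos) (by positivity)
  have h2 : κ * (95 / 96 * β) ≤ δ + β ^ 2 := h1.trans hpp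
  -- numbers: β = m/4, δ = m²/20, m ≤ κ, m > 0
  have hkm : m * m ≤ κ * m := mul_le_mul_of_nonneg_right hmκ hm0.le
  have h3 : 95 / 384 * (κ * m) ≤ 9 / 80 * (m * m) := by
    have e1 : κ * (95 / 96 * β) = 95 / 384 * (κ * m) := by rw [hβ]; ring
    have e2 : δ + β ^ 2 = 9 / 80 * (m * m) := by rw [hδ, hβ]; ring
    linarith [h2, e1, e2]
  have hY : 0 < m * m := mul_pos hm0 hm0
  linarith [hkm, h3, hY]


end OrthMomentum


/-! ## (a.1″) Orthogonality to the ENERGY is load-bearing at EVERY amplitude (cycle 2)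

Landing copies: `Theorems/CorrectorPressureDecay/Negative/OrthEnergyTools.lean`, `…/OrthEnergyWitness.lean`,
`…/OrthEnergy.lean`. The energy twin of (a.1′): the clause is weakened to `g ⊥ span(1, v)` (the `|v|²` term dropped)
and X is FALSE for every κ. Tilt: the conserved centred kinetic energy, `V = −(t/2)Σᵢ(|vᵢ|² − 3)` (COOLING; bounded
above, so `e^V`, `e^{2V}` are integrable and `V ∈ L¹` of its own tilt); tilted one-body law `N(0, I/(1+t))`; two
tilted Jensens give per particle `2κ E[ĝ(sZ)] ≤ δ + (3/2)·log((1+t)²/(1+2t)) ≤ δ + (3/2)t²` (`cool_ratio_le`), while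
the EVEN witness `ĝ(x) = c_E − x²/(10+x²)` has a FIRST-order cooling response `E[ĝ(sZ)] ≥ (1−s²)/25 ≥ t/50`
(exact Gaussian moments `E Z² = 1`, `E Z⁴ = 3`): false for `t = min(κ,1)/100`, `δ = min(κ,1)²/10⁵`. -/

section OrthEnergy

open Literature.MathematicalPhysics.KineticTheory
open Summit.AtomisticToContinuum.HydrodynamicLimit.Theorems.BoltzmannGreenKuboOrthMomentum (velOf measurable_velOf
  integral_velOf_localGibbsLaw integrable_velOf_localGibbsLaw QE QE_flow measurable_QE measurePreserving_coord
  integral_pow_four_gaussianReal)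

/-! ## §A Coordinates of `γ₃` are i.i.d. `γ₁` -/

/-- Products of coordinate functions integrate coordinatewise against the standard Gaussian on `ℝ³`. [folklore] -/
theorem integral_prod_coord_stdGaussian (f : Fin 3 → ℝ → ℝ) (hf : ∀ k, Measurable (f k)) :
    ∫ w, ∏ k, f k (w k) ∂stdGaussian V3 = ∏ k, ∫ x, f k x ∂gaussianReal 0 1 := by
  have hmeas : Measurable (fun w : V3 => ∏ k, f k (w k)) :=
    Finset.measurable_prod _ fun k _ => (hf k).comp (EuclideanSpace.proj (𝕜 := ℝ) k).continuous.measurable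
  rw [← map_pi_eq_stdGaussian, integral_map (PiLp.continuous_toLp 2 _).measurable.aemeasurable
    hmeas.aestronglyMeasurable]
  have : (fun x : Fin 3 → ℝ => ∏ k, f k ((WithLp.toLp 2 x : V3) k)) = fun x => ∏ k, f k (x k) := by
    funext x
    simp
  rw [this]
  exact integral_fintype_prod_eq_prod f

/-- `e^{−c‖w‖²/2} = ∏ₖ e^{−c wₖ²/2}` on `ℝ³`. [folklore] -/
theorem exp_neg_mul_norm_sq_eq_prod (c : ℝ) (w : V3) :
    Real.exp (-(c / 2) * ‖w‖ ^ 2) = ∏ k : Fin 3, Real.exp (-(c / 2) * (w k) ^ 2) := by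
  rw [Summit.AtomisticToContinuum.HydrodynamicLimit.Theorems.BoltzmannGreenKuboForallN.norm_sq_eq_three,
    Fin.prod_univ_three, ← Real.exp_add, ← Real.exp_add]
  congr 1
  ring

/-! ## §B The cooled one-dimensional Gaussian -/

/-- `∫ e^{−cx²/2} dγ₁ = (√(1+c))⁻¹` for `c > −1`. [folklore] -/
theorem integral_exp_neg_mul_sq_gaussianReal {c : ℝ} (hc : -1 < c) :
    ∫ x, Real.exp (-(c / 2) * x ^ 2) ∂gaussianReal 0 1 = (Real.sqrt (1 + c))⁻¹ := by
  rw [integral_gaussianReal_eq_integral_smul one_ne_zero]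
  simp only [smul_eq_mul, gaussianPDFReal_def, NNReal.coe_one, mul_one, sub_zero]
  have hpt : ∀ x : ℝ, (Real.sqrt (2 * Real.pi))⁻¹ * Real.exp (-x ^ 2 / 2) * Real.exp (-(c / 2) * x ^ 2) =
      (Real.sqrt (2 * Real.pi))⁻¹ * Real.exp (-((1 + c) / 2) * x ^ 2) := by
    intro x
    rw [mul_assoc, ← Real.exp_add]
    congr 2
    ring
  simp_rw [hpt]
  rw [integral_const_mul, integral_gaussian ((1 + c) / 2)]
  have h1c : 0 < 1 + c := by linarith
  have h2π : (0 : ℝ) ≤ 2 * Real.pi := by positivity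
  have hs : Real.sqrt (2 * Real.pi) ≠ 0 := (Real.sqrt_pos.2 (by positivity)).ne'
  rw [show Real.pi / ((1 + c) / 2) = 2 * Real.pi / (1 + c) by field_simp, Real.sqrt_div h2π]
  field_simp

/-- **Scaling identity**: `∫ f(x) e^{−cx²/2} dγ₁ = s ∫ f(s y) dγ₁(y)`, `s = (√(1+c))⁻¹`, `c > −1` (the law `γ₁` tilted
by `−cx²/2` is `N(0, 1/(1+c))`, the law of `sZ`). [folklore] -/
theorem integral_mul_exp_neg_mul_sq_gaussianReal (f : ℝ → ℝ) {c : ℝ} (hc : -1 < c) :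
    ∫ x, f x * Real.exp (-(c / 2) * x ^ 2) ∂gaussianReal 0 1 =
      (Real.sqrt (1 + c))⁻¹ * ∫ y, f ((Real.sqrt (1 + c))⁻¹ * y) ∂gaussianReal 0 1 := by
  set s : ℝ := (Real.sqrt (1 + c))⁻¹ with hs
  have h1c : 0 < 1 + c := by linarith
  have hsq : Real.sqrt (1 + c) ^ 2 = 1 + c := Real.sq_sqrt h1c.le
  have hsqpos : 0 < Real.sqrt (1 + c) := Real.sqrt_pos.2 h1c
  have hspos : 0 < s := by rw [hs]; positivity
  rw [integral_gaussianReal_eq_integral_smul one_ne_zero, integral_gaussianReal_eq_integral_smul one_ne_zero]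
  simp only [smul_eq_mul, gaussianPDFReal_def, NNReal.coe_one, mul_one, sub_zero]
  -- `G(y) = pdf(y) f(s y)`; the left integrand is `G(s⁻¹ x)`
  set G : ℝ → ℝ := fun y => (Real.sqrt (2 * Real.pi))⁻¹ * Real.exp (-y ^ 2 / 2) * f (s * y) with hG
  have hleft : ∀ x : ℝ, (Real.sqrt (2 * Real.pi))⁻¹ * Real.exp (-x ^ 2 / 2) * (f x * Real.exp (-(c / 2) * x ^ 2)) =
      G (s⁻¹ * x) := by
    intro x
    have hx : s * (s⁻¹ * x) = x := by rw [← mul_assoc, mul_inv_cancel₀ hspos.ne', one_mul]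
    simp only [hG, hx]
    have : Real.exp (-x ^ 2 / 2) * Real.exp (-(c / 2) * x ^ 2) = Real.exp (-(s⁻¹ * x) ^ 2 / 2) := by
      rw [← Real.exp_add]
      congr 1
      rw [hs, inv_inv, mul_pow, hsq]
      ring
    calc (Real.sqrt (2 * Real.pi))⁻¹ * Real.exp (-x ^ 2 / 2) * (f x * Real.exp (-(c / 2) * x ^ 2))
        = (Real.sqrt (2 * Real.pi))⁻¹ * (Real.exp (-x ^ 2 / 2) * Real.exp (-(c / 2) * x ^ 2)) * f x := by ring
      _ = (Real.sqrt (2 * Real.pi))⁻¹ * Real.exp (-(s⁻¹ * x) ^ 2 / 2) * f x := by rw [this]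
  simp_rw [hleft]
  rw [Measure.integral_comp_mul_left G s⁻¹, inv_inv, abs_of_pos hspos, smul_eq_mul]

/-! ## §C The even witness profile -/

/-- The bounded increasing profile `hE(u) = u/(10 + u)` (of `u = x² ≥ 0`). -/
def hE (u : ℝ) : ℝ := u / (10 + u)

/-- `0 ≤ hE(u) ≤ 1` for `u ≥ 0`. [folklore] -/
theorem hE_bounds {u : ℝ} (hu : 0 ≤ u) : 0 ≤ hE u ∧ hE u ≤ 1 := by
  have hden : 0 < 10 + u := by linarith
  refine ⟨div_nonneg hu hden.le, ?_⟩
  rw [hE, div_le_one hden]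
  linarith

/-- **First-order cooling response**: `hE(u) − hE(λu) ≥ (1 − λ)(u/10 − u²/50)` for `0 ≤ λ ≤ 1`, `u ≥ 0`. [folklore] -/
theorem hE_sub_hE_mul_ge {u lam : ℝ} (hu : 0 ≤ u) (hl0 : 0 ≤ lam) (hl1 : lam ≤ 1) :
    (1 - lam) * (u / 10 - u ^ 2 / 50) ≤ hE u - hE (lam * u) := by
  have hden : 0 < 10 + u := by linarith
  have hden' : 0 < 10 + lam * u := by nlinarith
  -- exact difference
  have hdiff : hE u - hE (lam * u) = 10 * u * (1 - lam) / ((10 + u) * (10 + lam * u)) := by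
    rw [hE, hE, div_sub_div _ _ hden.ne' hden'.ne']
    congr 1
    ring
  rw [hdiff]
  -- lower the denominator: `(10+u)(10+λu) ≤ (10+u)²`, and `10u/(10+u)² ≥ u/10 − u²/50`
  have hstep1 : 10 * u * (1 - lam) / ((10 + u) * (10 + u)) ≤ 10 * u * (1 - lam) / ((10 + u) * (10 + lam * u)) := by
    apply div_le_div_of_nonneg_left (by nlinarith) (by positivity)
    exact mul_le_mul_of_nonneg_left (by nlinarith) hden.le
  refine le_trans ?_ hstep1
  rw [le_div_iff₀ (by positivity)]
  nlinarith [mul_nonneg hu hu, mul_nonneg (mul_nonneg hu hu) hu, sub_nonneg.2 hl1, mul_nonneg hu (sub_nonneg.2 hl1)]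

/-- `E γ₁[x²] = 1` (second derivative of the mgf `t ↦ e^{t²/2}` at `0`). [folklore] -/
theorem integral_sq_gaussianReal : ∫ x, x ^ 2 ∂gaussianReal 0 1 = 1 := by
  have h1 : ∫ x, x ^ 2 ∂gaussianReal 0 1 = iteratedDeriv 2 (mgf (fun x => x) (gaussianReal 0 1)) 0 := by
    rw [iteratedDeriv_mgf_zero] <;> simp
  rw [h1, mgf_fun_id_gaussianReal]
  have hf : (fun t : ℝ => Real.exp (0 * t + ((1 : NNReal) : ℝ) * t ^ 2 / 2)) = fun t => Real.exp (t ^ 2 / 2) := by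
    funext t; simp
  rw [hf]
  have hq : ∀ t : ℝ, HasDerivAt (fun t : ℝ => t ^ 2 / 2) t t := by
    intro t
    have h := (hasDerivAt_pow 2 t).div_const 2
    refine h.congr_deriv ?_
    norm_num
  have e0 : ∀ t : ℝ, HasDerivAt (fun t : ℝ => Real.exp (t ^ 2 / 2)) (Real.exp (t ^ 2 / 2) * t) t :=
    fun t => (hq t).exp
  have d1 : deriv (fun t : ℝ => Real.exp (t ^ 2 / 2)) = fun t => Real.exp (t ^ 2 / 2) * t :=
    funext fun t => (e0 t).deriv
  have hp1 : ∀ t : ℝ, HasDerivAt (fun t : ℝ => t) 1 t := fun t => hasDerivAt_id' t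
  have e1 : ∀ t : ℝ, HasDerivAt (fun t : ℝ => Real.exp (t ^ 2 / 2) * t)
      (Real.exp (t ^ 2 / 2) * t * t + Real.exp (t ^ 2 / 2) * 1) t := fun t => (e0 t).mul (hp1 t)
  have d2 : deriv (fun t : ℝ => Real.exp (t ^ 2 / 2) * t) = fun t => Real.exp (t ^ 2 / 2) * (1 + t ^ 2) := by
    funext t
    rw [(e1 t).deriv]
    ring
  rw [iteratedDeriv_succ, iteratedDeriv_one, d1, d2]
  norm_num

/-! ## §D Integrability of a bounded-above tilt under its own tilted law -/

/-- `|x| eˣ ≤ C e^C + 1` for `x ≤ C`, `0 ≤ C`. [folklore] -/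
theorem abs_mul_exp_le {x C : ℝ} (hC : 0 ≤ C) (hx : x ≤ C) : |x| * Real.exp x ≤ C * Real.exp C + 1 := by
  rcases le_or_gt 0 x with h0 | h0
  · rw [abs_of_nonneg h0]
    have : x * Real.exp x ≤ C * Real.exp C :=
      mul_le_mul hx (Real.exp_le_exp.2 hx) (Real.exp_pos _).le hC
    linarith
  · rw [abs_of_neg h0]
    have h1 : -x ≤ Real.exp (-x) := by linarith [Real.add_one_le_exp (-x)]
    have h2 : -x * Real.exp x ≤ Real.exp (-x) * Real.exp x :=
      mul_le_mul_of_nonneg_right h1 (Real.exp_pos _).le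
    rw [← Real.exp_add, neg_add_cancel, Real.exp_zero] at h2
    have h3 : 0 ≤ C * Real.exp C := by positivity
    linarith

/-! ## The witness `ĝ(x) = c_E − hE(x²)` -/

/-- The centring constant `c_E = E γ₁[hE(Z²)] ∈ [0, 1]`. -/
def cE : ℝ := ∫ y, hE (y ^ 2) ∂gaussianReal 0 1

/-- `y ↦ hE((c y)²)` is continuous. [folklore] -/
theorem continuous_hE_comp_sq (c : ℝ) : Continuous fun y : ℝ => hE ((c * y) ^ 2) := by
  unfold hE
  refine ((continuous_const.mul continuous_id).pow 2).div
    (continuous_const.add ((continuous_const.mul continuous_id).pow 2)) fun y => ?_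
  positivity

/-- `y ↦ hE((c y)²)` is `γ₁`-integrable (bounded by `1`). [folklore] -/
theorem integrable_hE_comp_sq (c : ℝ) : Integrable (fun y : ℝ => hE ((c * y) ^ 2)) (gaussianReal 0 1) :=
  integrable_of_abs_le (continuous_hE_comp_sq c).measurable (C := 1) fun y => by
    rw [abs_of_nonneg (hE_bounds (sq_nonneg _)).1]; exact (hE_bounds (sq_nonneg _)).2

/-- `0 ≤ c_E ≤ 1`. [folklore] -/
theorem cE_bounds : 0 ≤ cE ∧ cE ≤ 1 := by
  unfold cE
  refine ⟨integral_nonneg fun y => (hE_bounds (sq_nonneg y)).1, ?_⟩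
  have : ∫ y, hE (y ^ 2) ∂gaussianReal 0 1 ≤ ∫ _y, (1 : ℝ) ∂gaussianReal 0 1 :=
    integral_mono_of_nonneg (ae_of_all _ fun y => (hE_bounds (sq_nonneg y)).1) (integrable_const 1)
      (ae_of_all _ fun y => (hE_bounds (sq_nonneg y)).2)
  simpa using this

/-- The witness profile `ĝ(x) = c_E − x²/(10 + x²)`. -/
def gt (x : ℝ) : ℝ := cE - hE (x ^ 2)

/-- `ĝ` is continuous. [folklore] -/
theorem continuous_gt : Continuous gt := by
  have := continuous_hE_comp_sq 1
  simp only [one_mul] at this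
  exact continuous_const.sub this

/-- `|ĝ| ≤ 1`. [folklore] -/
theorem abs_gt_le (x : ℝ) : |gt x| ≤ 1 := by
  have h := hE_bounds (sq_nonneg x)
  have hc := cE_bounds
  rw [gt, abs_le]
  constructor <;> linarith

/-- `ĝ` is even. [folklore] -/
theorem gt_neg (x : ℝ) : gt (-x) = gt x := by simp [gt]

/-- `ĝ` is `γ₁`-centred. [folklore] -/
theorem integral_gt : ∫ x, gt x ∂gaussianReal 0 1 = 0 := by
  have hint : Integrable (fun y : ℝ => hE (y ^ 2)) (gaussianReal 0 1) := by
    simpa only [one_mul] using integrable_hE_comp_sq 1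
  unfold gt
  rw [integral_sub (integrable_const _) hint, integral_const]
  simp [cE]

/-- **The cooling response is first order**: `E γ₁[ĝ(s·)] ≥ (1 − s²)/25` for `0 ≤ s ≤ 1`. [folklore] -/
theorem integral_gt_mul_ge {s : ℝ} (hs0 : 0 ≤ s) (hs1 : s ≤ 1) :
    (1 - s ^ 2) * (1 / 25) ≤ ∫ y, gt (s * y) ∂gaussianReal 0 1 := by
  have hint1 : Integrable (fun y : ℝ => hE (y ^ 2)) (gaussianReal 0 1) := by
    simpa only [one_mul] using integrable_hE_comp_sq 1
  have hints : Integrable (fun y : ℝ => hE ((s * y) ^ 2)) (gaussianReal 0 1) := integrable_hE_comp_sq s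
  have h2 : Integrable (fun y : ℝ => y ^ 2) (gaussianReal 0 1) := by
    have h := (memLp_id_gaussianReal' (μ := 0) (v := 1) 2 (by simp)).integrable_norm_pow (by norm_num)
    refine h.congr (Eventually.of_forall fun x => ?_)
    simp only [id, Real.norm_eq_abs, sq_abs]
  have h4 : Integrable (fun y : ℝ => y ^ 4) (gaussianReal 0 1) := by
    have h := (memLp_id_gaussianReal' (μ := 0) (v := 1) 4 (by simp)).integrable_norm_pow (by norm_num)
    refine h.congr (Eventually.of_forall fun x => ?_)
    simp only [id, Real.norm_eq_abs]
    rw [show (4 : ℕ) = 2 * 2 from rfl, pow_mul, sq_abs, ← pow_mul]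
  -- `ĝ(s y) = (hE(y²) − hE(s² y²)) + ĝ(y)`, and `ĝ` integrates to 0
  have hsplit : ∀ y : ℝ, gt (s * y) = (hE (y ^ 2) - hE ((s * y) ^ 2)) + gt y := fun y => by
    simp only [gt]; ring
  simp_rw [hsplit]
  have hI1 : Integrable (fun y => hE (y ^ 2) - hE ((s * y) ^ 2)) (gaussianReal 0 1) := hint1.sub hints
  have hIg : Integrable gt (gaussianReal 0 1) := integrable_of_abs_le continuous_gt.measurable abs_gt_le
  rw [integral_add hI1 hIg, integral_gt, add_zero]
  -- pointwise first-order response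
  have hpt : ∀ y : ℝ, (1 - s ^ 2) * (y ^ 2 / 10 - y ^ 4 / 50) ≤ hE (y ^ 2) - hE ((s * y) ^ 2) := by
    intro y
    have h := hE_sub_hE_mul_ge (u := y ^ 2) (lam := s ^ 2) (sq_nonneg y) (sq_nonneg s)
      (pow_le_one₀ hs0 hs1)
    rw [show (s * y) ^ 2 = s ^ 2 * y ^ 2 by ring]
    calc (1 - s ^ 2) * (y ^ 2 / 10 - y ^ 4 / 50) = (1 - s ^ 2) * (y ^ 2 / 10 - (y ^ 2) ^ 2 / 50) := by ring
      _ ≤ _ := h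
  have hIp : Integrable (fun y : ℝ => (1 - s ^ 2) * (y ^ 2 / 10 - y ^ 4 / 50)) (gaussianReal 0 1) :=
    ((h2.div_const 10).sub (h4.div_const 50)).const_mul _
  calc (1 - s ^ 2) * (1 / 25) = ∫ y, (1 - s ^ 2) * (y ^ 2 / 10 - y ^ 4 / 50) ∂gaussianReal 0 1 := by
        rw [integral_const_mul, integral_sub (h2.div_const 10) (h4.div_const 50), integral_div, integral_div,
          integral_sq_gaussianReal, integral_pow_four_gaussianReal]
        norm_num
    _ ≤ _ := integral_mono hIp hI1 hpt

/-! ## Velocity-only product integrals under `G_N` -/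

/-- `∫ ∏ᵢ f(vᵢ) dG_N = (∫ f dγ₃)^{N+1}` (positions integrate out; velocities i.i.d.). [folklore] -/
theorem integral_prod_vel {σ : ℝ} (hσ : σ ≤ 1 / 2) (N : ℕ) (Φ : Flow σ N) {f : V3 → ℝ} (hf : Measurable f) :
    ∫ z, ∏ i, f ((z i).2) ∂(localGibbsLaw σ (fun _ => 1) (fun _ => 0) (fun _ => 1) N Φ) =
      (∫ w, f w ∂stdGaussian V3) ^ (N + 1) := by
  have := integral_velOf_localGibbsLaw hσ N Φ (H := fun v : Fin (N + 1) → V3 => ∏ i, f (v i))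
    (Finset.measurable_prod _ fun i _ => hf.comp (measurable_pi_apply i))
  rw [integral_fintype_prod_eq_prod (fun (_ : Fin (N + 1)) => f)] at this
  simp only [Finset.prod_const, Finset.card_univ, Fintype.card_fin] at this
  exact this

/-- One distinguished factor: `∫ (Σᵢ h(vᵢ)) ∏ⱼ f(vⱼ) dG_N = (N+1)(∫ h f dγ₃)(∫ f dγ₃)^N` for bounded measurable
`h, f`. [folklore] -/
theorem integral_sum_mul_prod_vel {σ : ℝ} (hσ : σ ≤ 1 / 2) (N : ℕ) (Φ : Flow σ N) {h f : V3 → ℝ}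
    (hh : Measurable h) (hf : Measurable f) {Ch Cf : ℝ} (hhb : ∀ w, |h w| ≤ Ch) (hfb : ∀ w, |f w| ≤ Cf) :
    ∫ z, (∑ i, h ((z i).2)) * ∏ j, f ((z j).2) ∂(localGibbsLaw σ (fun _ => 1) (fun _ => 0) (fun _ => 1) N Φ) =
      ((N : ℝ) + 1) * (∫ w, h w * f w ∂stdGaussian V3) * (∫ w, f w ∂stdGaussian V3) ^ N := by
  classical
  have hH : Measurable fun v : Fin (N + 1) → V3 => (∑ i, h (v i)) * ∏ j, f (v j) :=
    (Finset.measurable_sum _ fun i _ => hh.comp (measurable_pi_apply i)).mul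
      (Finset.measurable_prod _ fun j _ => hf.comp (measurable_pi_apply j))
  have := integral_velOf_localGibbsLaw hσ N Φ hH
  refine this.trans ?_
  -- each summand is a product with one distinguished factor
  set F : Fin (N + 1) → Fin (N + 1) → V3 → ℝ := fun i j w => (if j = i then h w else 1) * f w with hF
  have hprod : ∀ (i : Fin (N + 1)) (v : Fin (N + 1) → V3), h (v i) * ∏ j, f (v j) = ∏ j, F i j (v j) := by
    intro i v
    rw [hF]
    simp only
    rw [Finset.prod_mul_distrib, Finset.prod_ite_eq' Finset.univ i (fun j => h (v j)), if_pos (Finset.mem_univ i)]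
  have hCf : 0 ≤ Cf := (abs_nonneg _).trans (hfb 0)
  have hterm : ∀ i : Fin (N + 1), Integrable (fun v : Fin (N + 1) → V3 => h (v i) * ∏ j, f (v j))
      (Measure.pi fun _ : Fin (N + 1) => stdGaussian V3) := by
    intro i
    refine integrable_of_abs_le ((hh.comp (measurable_pi_apply i)).mul
      (Finset.measurable_prod _ fun j _ => hf.comp (measurable_pi_apply j))) (C := Ch * Cf ^ (N + 1)) fun v => ?_
    rw [abs_mul, Finset.abs_prod]
    refine mul_le_mul (hhb _) ?_ (by positivity) ((abs_nonneg _).trans (hhb 0))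
    calc ∏ j, |f (v j)| ≤ ∏ _j : Fin (N + 1), Cf := Finset.prod_le_prod (fun j _ => abs_nonneg _) fun j _ => hfb _
      _ = Cf ^ (N + 1) := by simp
  simp_rw [Finset.sum_mul]
  rw [integral_finsetSum _ fun i _ => hterm i]
  have hi : ∀ i : Fin (N + 1), ∫ v, h (v i) * ∏ j, f (v j) ∂Measure.pi (fun _ : Fin (N + 1) => stdGaussian V3) =
      (∫ w, h w * f w ∂stdGaussian V3) * (∫ w, f w ∂stdGaussian V3) ^ N := by
    intro i
    simp_rw [hprod i]
    rw [integral_fintype_prod_eq_prod (F i)]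
    have hsplit := (Finset.mul_prod_erase Finset.univ (fun j => ∫ w, F i j w ∂stdGaussian V3) (Finset.mem_univ i)).symm
    rw [hsplit]
    have h1 : ∫ w, F i i w ∂stdGaussian V3 = ∫ w, h w * f w ∂stdGaussian V3 := by simp [hF]
    have h2 : ∀ j ∈ Finset.univ.erase i, ∫ w, F i j w ∂stdGaussian V3 = ∫ w, f w ∂stdGaussian V3 := by
      intro j hj
      simp [hF, Finset.ne_of_mem_erase hj]
    rw [h1, Finset.prod_congr rfl h2, Finset.prod_const, Finset.card_erase_of_mem (Finset.mem_univ i),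
      Finset.card_univ, Fintype.card_fin, Nat.add_sub_cancel]
  simp only [hi, Finset.sum_const, Finset.card_univ, Fintype.card_fin, nsmul_eq_mul]
  push_cast
  ring

/-- The cooled one-body factor `f_c(w) = e^{−(c/2)(‖w‖² − 3)}` integrates to `e^{3c/2} p(c)³`,
`p(c) = ∫ e^{−cx²/2} dγ₁ = (√(1+c))⁻¹`. [folklore] -/
theorem integral_coolFactor {c : ℝ} (hc : -1 < c) :
    ∫ w, Real.exp (-(c / 2) * (‖w‖ ^ 2 - 3)) ∂stdGaussian V3 =
      Real.exp (3 * c / 2) * (Real.sqrt (1 + c))⁻¹ ^ 3 := by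
  have hpt : ∀ w : V3, Real.exp (-(c / 2) * (‖w‖ ^ 2 - 3)) =
      Real.exp (3 * c / 2) * ∏ k : Fin 3, Real.exp (-(c / 2) * (w k) ^ 2) := by
    intro w
    rw [← exp_neg_mul_norm_sq_eq_prod, ← Real.exp_add]
    congr 1
    ring
  simp_rw [hpt]
  rw [integral_const_mul, integral_prod_coord_stdGaussian (fun _ => fun x => Real.exp (-(c / 2) * x ^ 2))
    (fun _ => by fun_prop)]
  simp only [Finset.prod_const, Finset.card_univ, Fintype.card_fin]
  rw [integral_exp_neg_mul_sq_gaussianReal hc]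

/-- … and against a function of the first coordinate: `∫ k(w₀) f_c(w) dγ₃ = e^{3c/2} (∫ k e^{−cx²/2} dγ₁) p(c)²`.
[folklore] -/
theorem integral_mul_coolFactor {c : ℝ} (hc : -1 < c) {k : ℝ → ℝ} (hk : Measurable k) :
    ∫ w, k (w 0) * Real.exp (-(c / 2) * (‖w‖ ^ 2 - 3)) ∂stdGaussian V3 =
      Real.exp (3 * c / 2) * ((∫ x, k x * Real.exp (-(c / 2) * x ^ 2) ∂gaussianReal 0 1) *
        (Real.sqrt (1 + c))⁻¹ ^ 2) := by
  set f : Fin 3 → ℝ → ℝ := fun j x => (if j = 0 then k x else 1) * Real.exp (-(c / 2) * x ^ 2) with hf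
  have hpt : ∀ w : V3, k (w 0) * Real.exp (-(c / 2) * (‖w‖ ^ 2 - 3)) =
      Real.exp (3 * c / 2) * ∏ j : Fin 3, f j (w j) := by
    intro w
    have h3 : Real.exp (-(c / 2) * (‖w‖ ^ 2 - 3)) = Real.exp (3 * c / 2) * ∏ j : Fin 3, Real.exp (-(c / 2) * (w j) ^ 2) := by
      rw [← exp_neg_mul_norm_sq_eq_prod, ← Real.exp_add]
      congr 1
      ring
    rw [h3, hf]
    simp only [Fin.prod_univ_three, Fin.isValue, if_true, show (1 : Fin 3) ≠ 0 by decide,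
      show (2 : Fin 3) ≠ 0 by decide, if_false, one_mul]
    ring
  simp_rw [hpt]
  rw [integral_const_mul, integral_prod_coord_stdGaussian f (fun j => by
    simp only [hf]; split_ifs <;> fun_prop)]
  congr 1
  simp only [hf, Fin.prod_univ_three, Fin.isValue, if_true, show (1 : Fin 3) ≠ 0 by decide,
    show (2 : Fin 3) ≠ 0 by decide, if_false, one_mul]
  rw [integral_exp_neg_mul_sq_gaussianReal hc]
  ring

/-- The key scalar inequality between the two cooled partition functions:
`(√(1+2t))⁻³ ≤ (√(1+t))⁻⁶ e^{3t²/2}`, i.e. `(1+t)² ≤ (1+2t) e^{t²}`. [folklore] -/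
theorem cool_ratio_le {t : ℝ} (ht : 0 ≤ t) :
    (Real.sqrt (1 + 2 * t))⁻¹ ^ 3 ≤ ((Real.sqrt (1 + t))⁻¹ ^ 3) ^ 2 * Real.exp (3 / 2 * t ^ 2) := by
  have h1t : 0 < 1 + t := by linarith
  have h2t : 0 < 1 + 2 * t := by linarith
  set r : ℝ := Real.sqrt (1 + 2 * t) with hr
  have hrpos : 0 < r := Real.sqrt_pos.2 h2t
  have hr2 : r ^ 2 = 1 + 2 * t := Real.sq_sqrt h2t.le
  have hs2 : Real.sqrt (1 + t) ^ 2 = 1 + t := Real.sq_sqrt h1t.le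
  have hspos : 0 < Real.sqrt (1 + t) := Real.sqrt_pos.2 h1t
  -- `(1+t)² ≤ (1+2t) e^{t²}`, hence `1 + t ≤ r e^{t²/2}`
  have hexp : t ^ 2 + 1 ≤ Real.exp (t ^ 2) := Real.add_one_le_exp _
  have hsq : (1 + t) ^ 2 ≤ (r * Real.exp (t ^ 2 / 2)) ^ 2 := by
    rw [mul_pow, hr2, ← Real.exp_nat_mul]
    rw [show ((2 : ℕ) : ℝ) * (t ^ 2 / 2) = t ^ 2 by push_cast; ring]
    nlinarith [Real.exp_pos (t ^ 2)]
  have hlin : 1 + t ≤ r * Real.exp (t ^ 2 / 2) := by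
    have := Real.sqrt_le_sqrt hsq
    rwa [Real.sqrt_sq h1t.le, Real.sqrt_sq (by positivity)] at this
  have hcube : (1 + t) ^ 3 ≤ (r * Real.exp (t ^ 2 / 2)) ^ 3 := pow_le_pow_left₀ h1t.le hlin 3
  -- rewrite both sides in terms of `(1+t)³` and `r³`
  have hL : (Real.sqrt (1 + 2 * t))⁻¹ ^ 3 = (r ^ 3)⁻¹ := by rw [← hr, inv_pow]
  have hR : ((Real.sqrt (1 + t))⁻¹ ^ 3) ^ 2 * Real.exp (3 / 2 * t ^ 2) = ((1 + t) ^ 3)⁻¹ * Real.exp (t ^ 2 / 2) ^ 3 := by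
    rw [← pow_mul, inv_pow, show (3 * 2 : ℕ) = 2 * 3 from rfl, pow_mul, hs2, ← Real.exp_nat_mul]
    congr 2
    push_cast
    ring
  rw [hL, hR, inv_le_comm₀ (by positivity) (by positivity)]
  rw [mul_inv, inv_inv, ← div_eq_mul_inv, div_le_iff₀ (by positivity)]
  calc (1 + t) ^ 3 ≤ (r * Real.exp (t ^ 2 / 2)) ^ 3 := hcube
    _ = r ^ 3 * Real.exp (t ^ 2 / 2) ^ 3 := by ring

/-! ## The refutation -/

/-- `CorrectorPressureDecay` with the orthogonality clause WEAKENED to `g ⊥ span(1, v)` (the energy term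
`c₂‖v‖²` deleted; all other tokens verbatim). A variant statement refuted below, not a fact. -/
def CorrectorPressureDecayWithoutOrthEnergy : Prop :=
  ∀ (a θ : ℝ) (u₀ : V3), 0 < a → 0 < θ → ∃ σ₀ : ℝ, 0 < σ₀ ∧ ∀ σ : ℝ, 0 < σ → σ < σ₀ →
    (∀ (N : ℕ) (Φ : Flow σ N),
      IsProbabilityMeasure (localGibbsLaw σ (fun _ => a) (fun _ => u₀) (fun _ => θ) N Φ)) ∧
    ∃ κ : ℝ, 0 < κ ∧ ∀ (φ : T3 → ℝ) (g : V3 → ℝ), Continuous φ → Continuous g → (∀ x, |φ x| ≤ 1) →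
      (∀ v, |g v| ≤ κ) →
      (∀ (c₀ : ℝ) (b : V3), ∫ v, g v * (c₀ + inner ℝ b v) ∂stdGaussian V3 = 0) →
      ∀ δ : ℝ, 0 < δ → ∃ τ₀ : ℝ, 0 < τ₀ ∧ ∃ N₀ : ℕ, ∀ N : ℕ, N₀ ≤ N → ∀ Φ : Flow σ N,
        ∃ lag : ℝ, 0 < lag ∧ ∃ W : Phase N → ℝ, Measurable W ∧ (∃ C : ℝ, ∀ z, |W z| ≤ C) ∧
          ∫⁻ z, ENNReal.ofReal (Real.exp (2 * ((∑ i, φ (z i).1 * g ((Real.sqrt θ)⁻¹ • ((z i).2 - u₀))) -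
              lag⁻¹ * (W (Φ.flow lag z) - W z))))
            ∂(localGibbsLaw σ (fun _ => a) (fun _ => u₀) (fun _ => θ) N Φ) ≤
            ENNReal.ofReal (Real.exp (δ * (N + 1))) ∧
          ∫⁻ z, ENNReal.ofReal (Real.exp (4 * (τ₀ * ((N + 1 : ℕ) : ℝ) ^ (-(1 / 3 : ℝ)))⁻¹ * |W z|))
            ∂(localGibbsLaw σ (fun _ => a) (fun _ => u₀) (fun _ => θ) N Φ) ≤
            ENNReal.ofReal (Real.exp (δ * (N + 1)))

/-- The witness `g(v) = κ ĝ(v₀)` is `γ`-orthogonal to `span(1, v)` (centred in `v₀`, even under `v ↦ −v`).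
[folklore] -/
theorem gt_coord_orth (κ c₀ : ℝ) (b : V3) :
    ∫ v, κ * gt (v 0) * (c₀ + inner ℝ b v) ∂stdGaussian V3 = 0 := by
  have hgm : Measurable fun v : V3 => gt (v 0) :=
    continuous_gt.measurable.comp (EuclideanSpace.proj (𝕜 := ℝ) (0 : Fin 3)).continuous.measurable
  have hI1 : Integrable (fun v : V3 => κ * gt (v 0) * c₀) (stdGaussian V3) :=
    integrable_of_abs_le ((measurable_const.mul hgm).mul measurable_const) (C := |κ| * 1 * |c₀|) fun v => by
      rw [abs_mul, abs_mul]; gcongr; exact abs_gt_le _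
  have hodd : ∫ v, κ * gt (v 0) * inner ℝ b v ∂stdGaussian V3 = 0 := by
    refine Summit.AtomisticToContinuum.HydrodynamicLimit.Theorems.CorrectorPressureDecayNegative.integral_stdGaussian_eq_zero_of_odd
      (LinearIsometryEquiv.neg ℝ) fun v => ?_
    have h0 : (LinearIsometryEquiv.neg ℝ v) 0 = -(v 0) := rfl
    rw [h0, gt_neg, LinearIsometryEquiv.coe_neg, inner_neg_right]
    ring
  have hI2 : Integrable (fun v : V3 => κ * gt (v 0) * inner ℝ b v) (stdGaussian V3) := by
    have hb : Integrable (fun v : V3 => |κ| * ‖b‖ * (1 + ‖v‖) ^ 1) (stdGaussian V3) :=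
      (Literature.Analysis.UnboundedOperators.integrable_one_add_norm_pow_stdGaussian 1).const_mul _
    refine hb.mono' ((measurable_const.mul hgm).mul (measurable_const.inner measurable_id)).aestronglyMeasurable
      (ae_of_all _ fun v => ?_)
    rw [Real.norm_eq_abs, abs_mul, abs_mul, pow_one]
    have h1 := abs_gt_le (v 0)
    have h2 : |inner ℝ b v| ≤ ‖b‖ * ‖v‖ := abs_real_inner_le_norm b v
    have hk := abs_nonneg κ
    calc |κ| * |gt (v 0)| * |inner ℝ b v| ≤ |κ| * 1 * (‖b‖ * ‖v‖) := by gcongr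
      _ ≤ |κ| * ‖b‖ * (1 + ‖v‖) := by nlinarith [norm_nonneg b, norm_nonneg v]
  have hsplit : ∀ v : V3, κ * gt (v 0) * (c₀ + inner ℝ b v) = κ * gt (v 0) * c₀ + κ * gt (v 0) * inner ℝ b v :=
    fun v => by ring
  simp_rw [hsplit]
  rw [integral_add hI1 hI2, hodd, add_zero, integral_mul_const, integral_const_mul,
    integral_coord_stdGaussian 0 continuous_gt.measurable, integral_gt, mul_zero, zero_mul]

/-- **Orthogonality to the ENERGY is load-bearing at every amplitude: X so weakened is FALSE.** Witness
`a = θ = 1`, `u₀ = 0`, `σ = min(σ₀/2, 1/4)`, `φ ≡ 1`, `g = κ ĝ(v₀)` (the prover's own `κ`), `m = min(κ, 1)`,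
cooling `t = m/100`, `δ = m²/10⁵`, `N = N₀`, any flow: the energy tilt `−(t/2)Σᵢ(|vᵢ|² − 3)` of `G_N` is
flow-invariant (`QE_flow` a.e.), so by two tilted Jensens the tilted flux mean per particle obeys
`κ t/25 ≤ 2κ E[ĝ(sZ)] ≤ δ + (3/2)t²`, false for these numbers. [folklore] -/
theorem not_correctorPressureDecayWithoutOrthEnergy : ¬ CorrectorPressureDecayWithoutOrthEnergy := by
  intro h
  obtain ⟨σ₀, hσ₀, hσ⟩ := h 1 1 0 one_pos one_pos
  set σ : ℝ := min (σ₀ / 2) 4⁻¹ with hσdef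
  have hσpos : 0 < σ := lt_min (by linarith) (by norm_num)
  have hσlt : σ < σ₀ := (min_le_left _ _).trans_lt (by linarith)
  have hσ2 : σ ≤ 1 / 2 := (min_le_right _ _).trans (by norm_num)
  have hσ2' : σ < 2⁻¹ := (min_le_right _ _).trans_lt (by norm_num)
  obtain ⟨hprob, κ, hκ, hmain⟩ := hσ σ hσpos hσlt
  -- parameters
  set m : ℝ := min κ 1 with hm
  have hm0 : 0 < m := lt_min hκ one_pos
  have hmκ : m ≤ κ := min_le_left _ _
  have hm1 : m ≤ 1 := min_le_right _ _
  set t : ℝ := m / 100 with ht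
  have htpos : 0 < t := by positivity
  have ht1 : t ≤ 1 := by rw [ht]; linarith
  set δ : ℝ := m ^ 2 / 100000 with hδ
  have hδpos : 0 < δ := by positivity
  -- the witness
  set g : V3 → ℝ := fun v => κ * gt (v 0) with hg
  have h0c : Continuous fun w : V3 => w 0 := (EuclideanSpace.proj (𝕜 := ℝ) (0 : Fin 3)).continuous
  have hgc : Continuous g := continuous_const.mul (continuous_gt.comp h0c)
  have hgκ : ∀ v, |g v| ≤ κ := fun v => by
    rw [hg, abs_mul, abs_of_pos hκ]
    exact mul_le_of_le_one_right hκ.le (abs_gt_le _)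
  obtain ⟨τ₀, _hτ₀, N₀, hN⟩ := hmain (fun _ => 1) g continuous_const hgc (fun _ => by simp) hgκ
    (fun c₀ b => gt_coord_orth κ c₀ b) δ hδpos
  obtain ⟨Φ⟩ := nonempty_flow hσpos hσ2' N₀
  obtain ⟨lag, hlag, W, hWm, ⟨CW, hW⟩, h1, _h2⟩ := hN N₀ le_rfl Φ
  haveI := hprob N₀ Φ
  set G := localGibbsLaw σ (fun _ => (1 : ℝ)) (fun _ => (0 : V3)) (fun _ => (1 : ℝ)) N₀ Φ with hGdef
  have hT : MeasurePreserving (Φ.flow lag) G G := measurePreserving_flow_localGibbsLaw 1 1 N₀ Φ lag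
  have hgood : G Φ.goodᶜ = 0 := by
    rw [hGdef, localGibbsLaw_eq]
    exact localGibbsMeasure_absolutelyContinuous σ _ _ _ N₀ Φ Φ.measure_compl_good
  -- the invariant COOLING tilt `V = −(t/2) Q_E`, bounded above by `CV`
  set V : Phase N₀ → ℝ := fun z => -(t / 2) * QE z with hV
  have hVm : Measurable V := measurable_const.mul measurable_QE
  have hVinv : ∀ᵐ z ∂G, V (Φ.flow lag z) = V z := by
    have : ∀ᵐ z ∂G, z ∈ Φ.good := mem_ae_iff.2 hgood
    filter_upwards [this] with z hz
    simp only [hV, QE_flow Φ hz lag]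
  set CV : ℝ := 3 * t / 2 * ((N₀ : ℝ) + 1) with hCV
  have hCV0 : 0 ≤ CV := by positivity
  have hVle : ∀ z, V z ≤ CV := by
    intro z
    have hQ : -(3 * ((N₀ : ℝ) + 1)) ≤ QE z := by
      unfold QE
      calc -(3 * ((N₀ : ℝ) + 1)) = ∑ _i : Fin (N₀ + 1), (-3 : ℝ) := by simp; ring
        _ ≤ ∑ i : Fin (N₀ + 1), (‖(z i).2‖ ^ 2 - 3) :=
            Finset.sum_le_sum fun i _ => by nlinarith [sq_nonneg ‖(z i).2‖]
    rw [hV, hCV]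
    nlinarith
  -- `e^{cV}` is bounded, hence integrable, for `c ≥ 0`
  have hexpcV : ∀ c : ℝ, 0 ≤ c → Integrable (fun z => Real.exp (c * V z)) G := by
    intro c hc
    refine (integrable_const (Real.exp (c * CV))).mono'
      (Real.continuous_exp.measurable.comp (measurable_const.mul hVm)).aestronglyMeasurable (ae_of_all _ fun z => ?_)
    rw [Real.norm_eq_abs, abs_of_pos (Real.exp_pos _), Real.exp_le_exp]
    exact mul_le_mul_of_nonneg_left (hVle z) hc
  have hVexp : Integrable (fun z => Real.exp (V z)) G := by simpa using hexpcV 1 zero_le_one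
  have hV2exp : Integrable (fun z => Real.exp (2 * V z)) G := hexpcV 2 (by norm_num)
  -- the tilted law `Q` is flow-invariant
  set Q : Measure (Phase N₀) := G.tilted V with hQ
  haveI hQprob : IsProbabilityMeasure Q := isProbabilityMeasure_tilted hVexp
  have hTQ : MeasurePreserving (Φ.flow lag) Q Q := measurePreserving_tilted_ae hT hVm hVinv
  -- the defect integrand `Y = F − 2 lag⁻¹ (W∘Φ − W)`, `F = Σ 2κ ĝ((vᵢ)₀)`
  set F : Phase N₀ → ℝ := fun z => ∑ i, 2 * κ * gt ((z i).2 0) with hF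
  have hgtm : Measurable fun w : V3 => gt (w 0) := continuous_gt.measurable.comp h0c.measurable
  have hFm : Measurable F :=
    Finset.measurable_sum _ fun i _ => measurable_const.mul (hgtm.comp (measurable_pi_apply i).snd)
  have hFb : ∀ z, |F z| ≤ ∑ _i : Fin (N₀ + 1), 2 * κ := fun z =>
    (Finset.abs_sum_le_sum_abs _ _).trans (Finset.sum_le_sum fun i _ => by
      rw [abs_mul, abs_of_pos (by positivity : (0 : ℝ) < 2 * κ)]
      exact mul_le_of_le_one_right (by positivity) (abs_gt_le _))
  set Y : Phase N₀ → ℝ := fun z => F z - 2 * lag⁻¹ * (W (Φ.flow lag z) - W z) with hY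
  have hrw1 : ∀ z : Phase N₀, Real.exp (2 * ((∑ i, (fun _ : T3 => (1 : ℝ)) (z i).1 *
      g ((Real.sqrt 1)⁻¹ • ((z i).2 - 0))) - lag⁻¹ * (W (Φ.flow lag z) - W z))) = Real.exp (Y z) := by
    intro z
    simp only [hY, hF, hg, Real.sqrt_one, inv_one, sub_zero, one_smul, one_mul]
    congr 1
    rw [mul_sub, Finset.mul_sum]
    congr 1
    · exact Finset.sum_congr rfl fun i _ => by ring
    · ring
  simp_rw [hrw1] at h1
  have hWΦm : Measurable fun z => W (Φ.flow lag z) := hWm.comp (Φ.measurable_flow lag)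
  have hYm : Measurable Y := hFm.sub (measurable_const.mul (hWΦm.sub hWm))
  have hYb : ∀ z, |Y z| ≤ (∑ _i : Fin (N₀ + 1), 2 * κ) + |2 * lag⁻¹| * (CW + CW) := by
    intro z
    calc |Y z| ≤ |F z| + |2 * lag⁻¹ * (W (Φ.flow lag z) - W z)| := abs_sub _ _
      _ = |F z| + |2 * lag⁻¹| * |W (Φ.flow lag z) - W z| := by
          rw [abs_mul (2 * lag⁻¹) (W (Φ.flow lag z) - W z)]
      _ ≤ _ := by
          gcongr
          · exact hFb z
          · exact (abs_sub _ _).trans (add_le_add (hW _) (hW _))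
  have hYexp : Integrable (fun z => Real.exp (Y z)) G := integrable_exp_of_abs_le hYm hYb
  have hI1 : ∫ z, Real.exp (Y z) ∂G ≤ Real.exp (δ * (N₀ + 1)) := by
    rw [← ofReal_integral_eq_lintegral_ofReal hYexp (ae_of_all _ fun _ => (Real.exp_pos _).le),
      ENNReal.ofReal_le_ofReal_iff (Real.exp_pos _).le] at h1
    exact h1
  -- integrability of `V` under `Q` (`V` bounded above)
  have hVQ : Integrable V Q := by
    rw [hQ, integrable_tilted_iff hVexp]
    refine (integrable_const (CV * Real.exp CV + 1)).mono'
      ((Real.continuous_exp.measurable.comp hVm).smul hVm).aestronglyMeasurable (ae_of_all _ fun z => ?_)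
    rw [smul_eq_mul, Real.norm_eq_abs, abs_mul, abs_of_pos (Real.exp_pos _), mul_comm]
    exact abs_mul_exp_le hCV0 (hVle z)
  have hYQ : Integrable Y Q := integrable_of_abs_le hYm hYb
  have hYV : Integrable (fun z => Y z - V z) Q := hYQ.sub hVQ
  -- TILTED JENSEN, twice
  have hJ := tilted_jensen' (μ := G) hVexp hYexp hYV
  have hJ2 := tilted_jensen' (μ := G) (V := V) (Y := fun z => 2 * V z) hVexp hV2exp (by simpa [two_mul] using hVQ)
  have hB2 : ∫ z, (2 * V z - V z) ∂Q = ∫ z, V z ∂Q := by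
    congr 1; funext z; ring
  rw [hB2] at hJ2
  -- `∫ (Y − V) dQ = E_Q F − E_Q V` (the coboundary drops by invariance of `Q`)
  have hFQ : Integrable F Q := integrable_of_abs_le hFm hFb
  have hWQ : Integrable W Q := integrable_of_abs_le hWm hW
  have hWΦQ : Integrable (fun z => W (Φ.flow lag z)) Q := integrable_of_abs_le hWΦm fun z => hW _
  have hWT : ∫ z, W (Φ.flow lag z) ∂Q = ∫ z, W z ∂Q := by
    rw [← integral_map hTQ.measurable.aemeasurable hWm.aestronglyMeasurable, hTQ.map_eq]
  have hmean : ∫ z, (Y z - V z) ∂Q = (∫ z, F z ∂Q) - ∫ z, V z ∂Q := by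
    have hD : Integrable (fun z => 2 * lag⁻¹ * (W (Φ.flow lag z) - W z)) Q := (hWΦQ.sub hWQ).const_mul _
    have hFD : Integrable (fun z => F z - 2 * lag⁻¹ * (W (Φ.flow lag z) - W z)) Q := hFQ.sub hD
    have e1 : (fun z => Y z - V z) = fun z => (F z - 2 * lag⁻¹ * (W (Φ.flow lag z) - W z)) - V z := rfl
    rw [e1, integral_sub hFD hVQ, integral_sub hFQ hD, integral_const_mul, integral_sub hWΦQ hWQ, hWT,
      sub_self, mul_zero, sub_zero]
  -- the cooled partition functions `z₁ = e^{3t/2} p³`, `z₂ = e^{3t} q³` and the tilted flux mean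
  have ht' : -1 < t := by linarith
  have h2t' : -1 < 2 * t := by linarith
  set pp : ℝ := (Real.sqrt (1 + t))⁻¹ with hpp
  have hpppos : 0 < pp := by rw [hpp]; exact inv_pos.2 (Real.sqrt_pos.2 (by linarith))
  set z₁ : ℝ := Real.exp (3 * t / 2) * pp ^ 3 with hz₁
  have hz₁pos : 0 < z₁ := by positivity
  set fc : V3 → ℝ := fun w => Real.exp (-(t / 2) * (‖w‖ ^ 2 - 3)) with hfc
  have hfcm : Measurable fc := by simp only [hfc]; fun_prop
  have hfcb : ∀ w, |fc w| ≤ Real.exp (3 * t / 2) := by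
    intro w
    rw [hfc, abs_of_pos (Real.exp_pos _), Real.exp_le_exp]
    nlinarith [sq_nonneg ‖w‖]
  have hVprod : ∀ z : Phase N₀, Real.exp (V z) = ∏ i, fc ((z i).2) := by
    intro z
    simp only [hV, hfc, QE, Finset.mul_sum, Real.exp_sum]
  have hZ : ∫ z, Real.exp (V z) ∂G = z₁ ^ (N₀ + 1) := by
    simp_rw [hVprod]
    rw [integral_prod_vel hσ2 N₀ Φ hfcm, integral_coolFactor ht']
  have hnumF : ∫ z, F z * Real.exp (V z) ∂G =
      ((N₀ : ℝ) + 1) * (Real.exp (3 * t / 2) *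
        ((∫ x, 2 * κ * gt x * Real.exp (-(t / 2) * x ^ 2) ∂gaussianReal 0 1) * pp ^ 2)) * z₁ ^ N₀ := by
    simp_rw [hVprod]
    have hhb : ∀ w : V3, |2 * κ * gt (w 0)| ≤ 2 * κ := fun w => by
      rw [abs_mul, abs_of_pos (by positivity : (0:ℝ) < 2 * κ)]
      exact mul_le_of_le_one_right (by positivity) (abs_gt_le _)
    have := integral_sum_mul_prod_vel hσ2 N₀ Φ (h := fun w => 2 * κ * gt (w 0)) (f := fc)
      (measurable_const.mul hgtm) hfcm (Ch := 2 * κ) (Cf := Real.exp (3 * t / 2)) hhb hfcb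
    rw [this, integral_coolFactor ht',
      integral_mul_coolFactor ht' (k := fun x => 2 * κ * gt x) (measurable_const.mul continuous_gt.measurable)]
  -- `A = E_Q F = (N+1)·2κ ∫ ĝ(pp·y) dγ₁(y)`
  have hA : ∫ z, F z ∂Q = ((N₀ : ℝ) + 1) * (2 * κ * ∫ y, gt (pp * y) ∂gaussianReal 0 1) := by
    rw [hQ, integral_tilted]
    have : (fun z => (Real.exp (V z) / ∫ x, Real.exp (V x) ∂G) • F z) =
        fun z => (∫ x, Real.exp (V x) ∂G)⁻¹ * (F z * Real.exp (V z)) := by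
      funext z; simp only [smul_eq_mul]; ring
    rw [this, integral_const_mul, hnumF, hZ]
    have hsc0 := integral_mul_exp_neg_mul_sq_gaussianReal gt ht'
    rw [← hpp] at hsc0
    have hsc : ∫ x, 2 * κ * gt x * Real.exp (-(t / 2) * x ^ 2) ∂gaussianReal 0 1 =
        2 * κ * (pp * ∫ y, gt (pp * y) ∂gaussianReal 0 1) := by
      simp_rw [mul_assoc]
      rw [integral_const_mul, integral_const_mul, hsc0]
    rw [hsc, hz₁, pow_succ]
    field_simp
  -- `Z₂ = ∫ e^{2V} dG = z₂^{N+1}` with `z₂ ≤ z₁² e^{3t²/2}`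
  set z₂ : ℝ := Real.exp (3 * (2 * t) / 2) * (Real.sqrt (1 + 2 * t))⁻¹ ^ 3 with hz₂
  have hZ2 : ∫ z, Real.exp (2 * V z) ∂G = z₂ ^ (N₀ + 1) := by
    have h2V : ∀ z : Phase N₀, Real.exp (2 * V z) = ∏ i, Real.exp (-(2 * t / 2) * (‖(z i).2‖ ^ 2 - 3)) := by
      intro z
      simp only [hV, QE, Finset.mul_sum, Real.exp_sum]
      refine Finset.prod_congr rfl fun i _ => ?_
      congr 1; ring
    simp_rw [h2V]
    rw [integral_prod_vel hσ2 N₀ Φ (f := fun w => Real.exp (-(2 * t / 2) * (‖w‖ ^ 2 - 3))) (by fun_prop),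
      integral_coolFactor h2t']
  have hz₂le : z₂ ≤ z₁ ^ 2 * Real.exp (3 / 2 * t ^ 2) := by
    rw [hz₂, hz₁, mul_pow, ← Real.exp_nat_mul]
    have e : ((2 : ℕ) : ℝ) * (3 * t / 2) = 3 * (2 * t) / 2 := by push_cast; ring
    rw [e, mul_assoc]
    exact mul_le_mul_of_nonneg_left (cool_ratio_le htpos.le) (Real.exp_pos _).le
  -- combine: `z₁^{2n} e^{A} ≤ e^{δ n} z₂^{n} ≤ e^{δn} z₁^{2n} e^{3t²n/2}`
  rw [hmean, hA, hZ] at hJ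
  rw [hZ2, hZ] at hJ2
  set A : ℝ := ((N₀ : ℝ) + 1) * (2 * κ * ∫ y, gt (pp * y) ∂gaussianReal 0 1) with hAdef
  set B : ℝ := ∫ z, V z ∂Q with hBdef
  have hJ' : z₁ ^ (N₀ + 1) * Real.exp (A - B) ≤ Real.exp (δ * (N₀ + 1)) := hJ.trans hI1
  have hprod : (z₁ ^ (N₀ + 1) * Real.exp (A - B)) * (z₁ ^ (N₀ + 1) * Real.exp B) ≤
      Real.exp (δ * (N₀ + 1)) * z₂ ^ (N₀ + 1) :=
    mul_le_mul hJ' hJ2 (by positivity) (by positivity)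
  have hz₂n : z₂ ^ (N₀ + 1) ≤ (z₁ ^ 2 * Real.exp (3 / 2 * t ^ 2)) ^ (N₀ + 1) :=
    pow_le_pow_left₀ (by positivity) hz₂le _
  have hlhs : (z₁ ^ (N₀ + 1) * Real.exp (A - B)) * (z₁ ^ (N₀ + 1) * Real.exp B) =
      (z₁ ^ 2) ^ (N₀ + 1) * Real.exp A := by
    have he : Real.exp (A - B) * Real.exp B = Real.exp A := by rw [← Real.exp_add, sub_add_cancel]
    calc (z₁ ^ (N₀ + 1) * Real.exp (A - B)) * (z₁ ^ (N₀ + 1) * Real.exp B)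
        = z₁ ^ (N₀ + 1) * z₁ ^ (N₀ + 1) * (Real.exp (A - B) * Real.exp B) := by ring
      _ = (z₁ ^ 2) ^ (N₀ + 1) * Real.exp A := by rw [he]; ring
  have hrhs : Real.exp (δ * (N₀ + 1)) * (z₁ ^ 2 * Real.exp (3 / 2 * t ^ 2)) ^ (N₀ + 1) =
      (z₁ ^ 2) ^ (N₀ + 1) * Real.exp (((N₀ : ℝ) + 1) * (δ + 3 / 2 * t ^ 2)) := by
    rw [mul_pow, ← Real.exp_nat_mul]
    have he : Real.exp (δ * (N₀ + 1)) * Real.exp (((N₀ + 1 : ℕ) : ℝ) * (3 / 2 * t ^ 2)) =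
        Real.exp (((N₀ : ℝ) + 1) * (δ + 3 / 2 * t ^ 2)) := by
      rw [← Real.exp_add]
      congr 1
      push_cast
      ring
    calc Real.exp (δ * (N₀ + 1)) * ((z₁ ^ 2) ^ (N₀ + 1) * Real.exp (((N₀ + 1 : ℕ) : ℝ) * (3 / 2 * t ^ 2)))
        = (z₁ ^ 2) ^ (N₀ + 1) * (Real.exp (δ * (N₀ + 1)) * Real.exp (((N₀ + 1 : ℕ) : ℝ) * (3 / 2 * t ^ 2))) := by
          ring
      _ = _ := by rw [he]
  have hfin : (z₁ ^ 2) ^ (N₀ + 1) * Real.exp A ≤ (z₁ ^ 2) ^ (N₀ + 1) * Real.exp (((N₀ : ℝ) + 1) * (δ + 3 / 2 * t ^ 2)) := by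
    rw [← hlhs, ← hrhs]
    exact hprod.trans (mul_le_mul_of_nonneg_left hz₂n (Real.exp_pos _).le)
  have hAle : A ≤ ((N₀ : ℝ) + 1) * (δ + 3 / 2 * t ^ 2) := by
    have := le_of_mul_le_mul_left hfin (by positivity : (0 : ℝ) < (z₁ ^ 2) ^ (N₀ + 1))
    exact Real.exp_le_exp.1 this
  -- per particle: `2κ E[ĝ(pp·)] ≤ δ + (3/2)t²`, while `E[ĝ(pp·)] ≥ (1 − pp²)/25 ≥ t/50`
  have hn : (0 : ℝ) < (N₀ : ℝ) + 1 := by positivity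
  have hpp1 : pp ≤ 1 := by
    rw [hpp, inv_le_one_iff₀]
    right
    rw [Real.one_le_sqrt]
    linarith
  have hppsq : pp ^ 2 = (1 + t)⁻¹ := by
    rw [hpp, inv_pow, Real.sq_sqrt (by linarith)]
  have hgain : (1 - pp ^ 2) * (1 / 25) ≤ ∫ y, gt (pp * y) ∂gaussianReal 0 1 := integral_gt_mul_ge hpppos.le hpp1
  have h1pp : t / 2 ≤ 1 - pp ^ 2 := by
    have h1t : (0 : ℝ) < 1 + t := by linarith
    have e : 1 - pp ^ 2 = t / (1 + t) := by
      rw [hppsq, eq_div_iff h1t.ne', sub_mul, inv_mul_cancel₀ h1t.ne']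
      ring
    rw [e]
    exact div_le_div_of_nonneg_left htpos.le h1t (by linarith)
  have hpp' : 2 * κ * ∫ y, gt (pp * y) ∂gaussianReal 0 1 ≤ δ + 3 / 2 * t ^ 2 := by
    have := hAle
    rw [hAdef] at this
    exact le_of_mul_le_mul_left this hn
  have hchain : 2 * κ * (t / 2 * (1 / 25)) ≤ δ + 3 / 2 * t ^ 2 := by
    have h1 : t / 2 * (1 / 25) ≤ ∫ y, gt (pp * y) ∂gaussianReal 0 1 :=
      le_trans (mul_le_mul_of_nonneg_right h1pp (by norm_num)) hgain
    exact (mul_le_mul_of_nonneg_left h1 (by positivity)).trans hpp'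
  -- numbers: t = m/100, δ = m²/10⁵, m ≤ κ, m > 0
  have hkm : m * m ≤ κ * m := mul_le_mul_of_nonneg_right hmκ hm0.le
  have h3 : κ * m / 2500 ≤ m * m / 100000 + 3 / 2 * (m * m) / 10000 := by
    have e1 : 2 * κ * (t / 2 * (1 / 25)) = κ * m / 2500 := by rw [ht]; ring
    have e2 : δ + 3 / 2 * t ^ 2 = m * m / 100000 + 3 / 2 * (m * m) / 10000 := by rw [hδ, ht]; ring
    linarith [hchain, e1, e2]
  have hY' : 0 < m * m := mul_pos hm0 hm0
  linarith [hkm, h3, hY']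


end OrthEnergy

/-! ## (a.3″) Collisions are load-bearing — UNCONDITIONAL (cycle 2)

With `FreeFlow.freeFlow₀` the hypothesis `FreeFlowZeroDiameter` of (a.3) is a theorem, and the certificate is not
needed: under the free flight `2F = Σ 2g(vᵢ)` is invariant, so the LD Mazur floor bounds the defect from below by the
static moment for EVERY lag and corrector — the cost clause is not used. Landing copy:
`Theorems/CorrectorPressureDecay/Negative/ZeroDiameter.lean`. -/

section ZeroDiameterUnconditional

open Literature.MathematicalPhysics.KineticTheory

/-- **H₀ discharged**: the free gas is a diameter-`0` hard-sphere flow, for every `N`. -/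
theorem freeFlowZeroDiameter_holds : FreeFlowZeroDiameter :=
  fun N => ⟨Summit.AtomisticToContinuum.HydrodynamicLimit.Theorems.CorrectorPressureDecayNegative.FreeFlow.freeFlow₀ N,
    fun _ _ => rfl⟩

/-- **Collisions are load-bearing: X is FALSE at `σ = 0` (unconditional).** Witness `a = θ = 1`, `u₀ = 0`, `φ ≡ 1`,
`g = gW κ` (the prover's own `κ`), `δ = ½ log E_γ e^{2g} > 0`, `N = N₀`, `Φ = freeFlow₀ N₀`: by
`integral_exp_le_integral_exp_sub_coboundary_of_invariant` the defect is `≥ (E_γ e^{2g})^{N+1} = e^{2δ(N+1)}`. -/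
theorem not_correctorPressureDecayZeroDiameter : ¬ CorrectorPressureDecayZeroDiameter := by
  intro h
  obtain ⟨hprob, κ, hκ, hmain⟩ := h 1 1 0 one_pos one_pos
  set M : ℝ := ∫ v, Real.exp (2 * gW κ v) ∂stdGaussian V3 with hM
  have hM1 : 1 < M := by
    have h1 := one_add_integral_sq_le_integral_exp_gW κ
    have h2 := integral_gW_sq_pos hκ.ne'
    rw [hM]; linarith
  set δ : ℝ := Real.log M / 2 with hδ
  have hlogpos : 0 < Real.log M := Real.log_pos hM1
  have hδpos : 0 < δ := by positivity
  obtain ⟨τ₀, _hτ₀, N₀, hN⟩ := hmain (fun _ => 1) (gW κ) continuous_const (continuous_gW κ) (fun _ => by simp)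
    (abs_gW_le hκ.le) (gW_orthogonal κ) δ hδpos
  set Φ : Flow 0 N₀ := Summit.AtomisticToContinuum.HydrodynamicLimit.Theorems.CorrectorPressureDecayNegative.FreeFlow.freeFlow₀ N₀
    with hΦ
  obtain ⟨lag, _hlag, W, hWm, ⟨CW, hW⟩, h1, _h2⟩ := hN N₀ le_rfl Φ
  haveI := hprob N₀ Φ
  set G := localGibbsLaw 0 (fun _ => (1 : ℝ)) (fun _ => (0 : V3)) (fun _ => (1 : ℝ)) N₀ Φ with hGdef
  set F : Phase N₀ → ℝ := fun z => ∑ i, 2 * gW κ (z i).2 with hF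
  have hFm : Measurable F := by
    have hc := continuous_gW κ
    have : Continuous F := by
      simp only [hF]
      fun_prop
    exact this.measurable
  have hFb : ∀ z, |F z| ≤ ∑ _i : Fin (N₀ + 1), 2 * κ := fun z =>
    (Finset.abs_sum_le_sum_abs _ _).trans (Finset.sum_le_sum fun i _ => by
      rw [abs_mul, abs_two]; exact mul_le_mul_of_nonneg_left (abs_gW_le hκ.le _) two_pos.le)
  have hFinv : ∀ z : Phase N₀, F (Φ.flow lag z) = F z := by
    intro z
    simp only [hF, hΦ, Summit.AtomisticToContinuum.HydrodynamicLimit.Theorems.CorrectorPressureDecayNegative.FreeFlow.freeFlow₀,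
      Summit.AtomisticToContinuum.HydrodynamicLimit.Theorems.CorrectorPressureDecayNegative.FreeFlow.freeFlow_flow,
      Literature.Analysis.FluidPDE.freeFlight_apply]
  have hinv : MeasurePreserving (Φ.flow lag) G G := measurePreserving_flow_localGibbsLaw 1 1 N₀ Φ lag
  have hrw1 : ∀ z : Phase N₀, Real.exp (2 * ((∑ i, (fun _ : T3 => (1 : ℝ)) (z i).1 *
      gW κ ((Real.sqrt 1)⁻¹ • ((z i).2 - 0))) - lag⁻¹ * (W (Φ.flow lag z) - W z))) =
      Real.exp (F z - (2 * lag⁻¹) * (W (Φ.flow lag z) - W z)) := by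
    intro z
    simp only [hF, Real.sqrt_one, inv_one, sub_zero, one_smul, one_mul]
    congr 1
    rw [← Finset.mul_sum]
    ring
  simp_rw [hrw1] at h1
  have hfloor := integral_exp_le_integral_exp_sub_coboundary_of_invariant hinv hFm hWm hFb hW hFinv (2 * lag⁻¹)
  have hYb : ∀ z, |F z - 2 * lag⁻¹ * (W (Φ.flow lag z) - W z)| ≤ (∑ _i : Fin (N₀ + 1), 2 * κ) +
      |2 * lag⁻¹| * (CW + CW) := by
    intro z
    calc |F z - 2 * lag⁻¹ * (W (Φ.flow lag z) - W z)| ≤ |F z| + |2 * lag⁻¹ * (W (Φ.flow lag z) - W z)| :=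
          abs_sub _ _
      _ = |F z| + |2 * lag⁻¹| * |W (Φ.flow lag z) - W z| := by rw [abs_mul]
      _ ≤ _ := by
          gcongr
          · exact hFb z
          · exact (abs_sub _ _).trans (add_le_add (hW _) (hW _))
  have hYint : Integrable (fun z => Real.exp (F z - 2 * lag⁻¹ * (W (Φ.flow lag z) - W z))) G :=
    integrable_exp_of_abs_le (hFm.sub (measurable_const.mul ((hWm.comp (Φ.measurable_flow lag)).sub hWm))) hYb
  rw [← ofReal_integral_eq_lintegral_ofReal hYint (ae_of_all _ fun _ => (Real.exp_pos _).le)] at h1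
  have hstat : ∫⁻ z, ENNReal.ofReal (Real.exp (F z)) ∂G = (ENNReal.ofReal M) ^ (N₀ + 1) := by
    simp only [hF]
    rw [hGdef, localGibbsLaw_eq, lintegral_exp_sum_vel_localGibbsMeasure one_pos one_pos 0 (by norm_num) N₀
      ((continuous_gW κ).measurable.const_mul 2), gaussMeasure_zero_one,
      ← ofReal_integral_eq_lintegral_ofReal (integrable_exp_mul_gW 2 κ) (ae_of_all _ fun _ => (Real.exp_pos _).le)]
  have hFint : Integrable (fun z => Real.exp (F z)) G := integrable_exp_of_abs_le hFm hFb
  have hstat' : ENNReal.ofReal (∫ z, Real.exp (F z) ∂G) = (ENNReal.ofReal M) ^ (N₀ + 1) := by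
    rw [ofReal_integral_eq_lintegral_ofReal hFint (ae_of_all _ fun _ => (Real.exp_pos _).le), hstat]
  have hchain : (ENNReal.ofReal M) ^ (N₀ + 1) ≤ ENNReal.ofReal (Real.exp (δ * (N₀ + 1))) := by
    rw [← hstat']
    exact (ENNReal.ofReal_le_ofReal hfloor).trans h1
  have hfl : Real.exp (2 * δ) = M := by
    rw [show 2 * δ = Real.log M by rw [hδ]; ring, Real.exp_log (by linarith)]
  rw [← hfl, ← ENNReal.ofReal_pow (Real.exp_pos _).le, ← Real.exp_nat_mul,
    ENNReal.ofReal_le_ofReal_iff (Real.exp_pos _).le, Real.exp_le_exp] at hchain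
  push_cast at hchain
  nlinarith

end ZeroDiameterUnconditional

/-! ## (c.2) The lag must be SHORTER than the cost window: X with `c·h₀ ≤ lag` is FALSE for every c > 0 (cycle 2)

"Lag rigidity" (crux NOTES S3) as a theorem. Landing copy: `Theorems/CorrectorPressureDecay/Negative/LagWindow.lean`.
Mechanism: three Gibbs inequalities (`tilted_jensen`) under `Q = G_N` tilted by `ε₀F`, `F = Σᵢ g(vᵢ)`,
`ε₀ = 2c/(1+c)` — the defect clause, the cost clause tested with `(4c/lag)W∘Φ_lag` (invariance of `G_N`,
`4c/lag ≤ 4/h₀`), the cost clause with `−(4c/lag)W` — combined with weights `(2c, 1, 1)`: the corrector terms AND the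
tilted mean `E_Q F` cancel exactly, and the product formula leaves `δ ≥ log E_γ e^{ε₀ g} > 0`. So every witness of
X at tolerance δ has `log E_γ exp((2lag/(lag+h₀))g) ≤ δ`, i.e. `lag ≲ h₀ √δ / s_g`; the route's fixed kinetic lag
`λℓ` against `h₀ = τ₀ℓ`, `τ₀ ≥ 2κT/δ`, is consistent (`lag/h₀ = λδ/(2κT)`). -/

section LagWindow

open Literature.MathematicalPhysics.KineticTheory

/-- `CorrectorPressureDecay` STRENGTHENED by the conjunct `c·h₀ ≤ lag` (`h₀ = τ₀ (N+1)^{-1/3}`, the cost scale; `c` a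
fixed ratio): the corrector's lag is at least `c` certificate windows. All other tokens verbatim. Refuted below for
every `c > 0`. -/
def CorrectorPressureDecayLagGeWindow (c : ℝ) : Prop :=
  ∀ (a θ : ℝ) (u₀ : V3), 0 < a → 0 < θ → ∃ σ₀ : ℝ, 0 < σ₀ ∧ ∀ σ : ℝ, 0 < σ → σ < σ₀ →
    (∀ (N : ℕ) (Φ : Flow σ N),
      IsProbabilityMeasure (localGibbsLaw σ (fun _ => a) (fun _ => u₀) (fun _ => θ) N Φ)) ∧
    ∃ κ : ℝ, 0 < κ ∧ ∀ (φ : T3 → ℝ) (g : V3 → ℝ), Continuous φ → Continuous g → (∀ x, |φ x| ≤ 1) →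
      (∀ v, |g v| ≤ κ) →
      (∀ (c₀ c₂ : ℝ) (b : V3), ∫ v, g v * (c₀ + inner ℝ b v + c₂ * ‖v‖ ^ 2) ∂stdGaussian V3 = 0) →
      ∀ δ : ℝ, 0 < δ → ∃ τ₀ : ℝ, 0 < τ₀ ∧ ∃ N₀ : ℕ, ∀ N : ℕ, N₀ ≤ N → ∀ Φ : Flow σ N,
        ∃ lag : ℝ, 0 < lag ∧ c * (τ₀ * ((N + 1 : ℕ) : ℝ) ^ (-(1 / 3 : ℝ))) ≤ lag ∧
          ∃ W : Phase N → ℝ, Measurable W ∧ (∃ C : ℝ, ∀ z, |W z| ≤ C) ∧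
          ∫⁻ z, ENNReal.ofReal (Real.exp (2 * ((∑ i, φ (z i).1 * g ((Real.sqrt θ)⁻¹ • ((z i).2 - u₀))) -
              lag⁻¹ * (W (Φ.flow lag z) - W z))))
            ∂(localGibbsLaw σ (fun _ => a) (fun _ => u₀) (fun _ => θ) N Φ) ≤
            ENNReal.ofReal (Real.exp (δ * (N + 1))) ∧
          ∫⁻ z, ENNReal.ofReal (Real.exp (4 * (τ₀ * ((N + 1 : ℕ) : ℝ) ^ (-(1 / 3 : ℝ)))⁻¹ * |W z|))
            ∂(localGibbsLaw σ (fun _ => a) (fun _ => u₀) (fun _ => θ) N Φ) ≤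
            ENNReal.ofReal (Real.exp (δ * (N + 1)))

/-- Sanity: the strengthened variant implies the crux (drop the extra conjunct). -/
theorem correctorPressureDecay_of_lagGeWindow {c : ℝ} (h : CorrectorPressureDecayLagGeWindow c) :
    CorrectorPressureDecay := by
  intro a θ u₀ ha hθ
  obtain ⟨σ₀, hσ₀, H⟩ := h a θ u₀ ha hθ
  refine ⟨σ₀, hσ₀, fun σ hσ hσlt => ?_⟩
  obtain ⟨hP, κ, hκ, Hκ⟩ := H σ hσ hσlt
  refine ⟨hP, κ, hκ, fun φ g hφ hg hφ1 hgκ horth δ hδ => ?_⟩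
  obtain ⟨τ₀, hτ₀, N₀, HN⟩ := Hκ φ g hφ hg hφ1 hgκ horth δ hδ
  refine ⟨τ₀, hτ₀, N₀, fun N hN Φ => ?_⟩
  obtain ⟨lag, hlag, _, W, hWm, hWb, h1, h2⟩ := HN N hN Φ
  exact ⟨lag, hlag, W, hWm, hWb, h1, h2⟩

/-- From `∫⁻ ofReal (exp Y) ≤ ofReal (exp b)` to the Bochner inequality `∫ exp Y ≤ exp b`. -/
theorem integral_exp_le_of_lintegral_le {X : Type*} [MeasurableSpace X] {μ : Measure X} [IsFiniteMeasure μ]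
    {Y : X → ℝ} (hYm : Measurable Y) {C : ℝ} (hY : ∀ x, |Y x| ≤ C) {b : ℝ}
    (h : ∫⁻ x, ENNReal.ofReal (Real.exp (Y x)) ∂μ ≤ ENNReal.ofReal (Real.exp b)) :
    ∫ x, Real.exp (Y x) ∂μ ≤ Real.exp b := by
  rw [← ofReal_integral_eq_lintegral_ofReal (integrable_exp_of_abs_le hYm hY)
    (ae_of_all _ fun _ => (Real.exp_pos _).le), ENNReal.ofReal_le_ofReal_iff (Real.exp_pos _).le] at h
  exact h

/-- **LAG RIGIDITY (the inequality).** In the crux's frame with `a = θ = 1`, `u₀ = 0`, `φ ≡ 1` and ANY bounded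
measurable one-body `g` (no orthogonality or amplitude needed): if a lag `lag > 0`, a bounded measurable corrector `W`
and a cost scale `h₀ > 0` satisfy the crux's two clauses at tolerance `δ` — defect
`∫ exp(2(Σᵢ g(vᵢ) − lag⁻¹(W∘Φ_lag − W))) dG_N ≤ e^{δ(N+1)}` and cost `∫ exp(4h₀⁻¹|W|) dG_N ≤ e^{δ(N+1)}` — then
`log E_γ exp((2·lag/(lag + h₀))·g) ≤ δ`. Proof: three Gibbs inequalities (`tilted_jensen`) under `G_N` tilted by
`ε₀ Σ g(vᵢ)`, `ε₀ = 2lag/(lag+h₀)`: the defect clause; the cost clause tested with `(4/h₀)·W∘Φ_lag` (invariance of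
`G_N`); the cost clause with `−(4/h₀)·W`; the weights `(2lag/h₀, 1, 1)` cancel the corrector terms AND the tilted
mean of `Σg` exactly, and the product formula `∫e^{ε₀Σg}dG_N = (E_γe^{ε₀g})^{N+1}` leaves the claim. For `g ⊥ 1`
with `s² = E_γ g²` this reads `lag/(lag+h₀) ≲ √δ/s`: the lag of any witness is asymptotically SHORTER than the cost
window. [folklore] -/
theorem lagRigidity {σ : ℝ} (hσ2 : σ ≤ 1 / 2) {N : ℕ} (Φ : Flow σ N)
    (hprob : IsProbabilityMeasure (localGibbsLaw σ (fun _ => (1 : ℝ)) (fun _ => (0 : V3)) (fun _ => (1 : ℝ)) N Φ))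
    {g : V3 → ℝ} (hgm : Measurable g) {K : ℝ} (hgK : ∀ v, |g v| ≤ K) {δ h₀ lag : ℝ} (hh₀ : 0 < h₀)
    (hlag : 0 < lag) {W : Phase N → ℝ} (hWm : Measurable W) {CW : ℝ} (hW : ∀ z, |W z| ≤ CW)
    (h1 : ∫⁻ z, ENNReal.ofReal (Real.exp (2 * ((∑ i, g (z i).2) - lag⁻¹ * (W (Φ.flow lag z) - W z))))
      ∂(localGibbsLaw σ (fun _ => (1 : ℝ)) (fun _ => (0 : V3)) (fun _ => (1 : ℝ)) N Φ) ≤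
      ENNReal.ofReal (Real.exp (δ * (N + 1))))
    (h2 : ∫⁻ z, ENNReal.ofReal (Real.exp (4 * h₀⁻¹ * |W z|))
      ∂(localGibbsLaw σ (fun _ => (1 : ℝ)) (fun _ => (0 : V3)) (fun _ => (1 : ℝ)) N Φ) ≤
      ENNReal.ofReal (Real.exp (δ * (N + 1)))) :
    Real.log (∫ v, Real.exp (2 * lag / (lag + h₀) * g v) ∂stdGaussian V3) ≤ δ := by
  haveI := hprob
  set G := localGibbsLaw σ (fun _ => (1 : ℝ)) (fun _ => (0 : V3)) (fun _ => (1 : ℝ)) N Φ with hGdef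
  set c : ℝ := lag / h₀ with hc
  have hcpos : 0 < c := by positivity
  set ε₀ : ℝ := 2 * lag / (lag + h₀) with hε₀
  have hε₀pos : 0 < ε₀ := by positivity
  have hε₀c : ε₀ * (1 + c) = 2 * c := by
    rw [hε₀, hc]
    field_simp
    ring
  set M : ℝ := ∫ v, Real.exp (ε₀ * g v) ∂stdGaussian V3 with hM
  have hexpg : Integrable (fun v => Real.exp (ε₀ * g v)) (stdGaussian V3) :=
    integrable_exp_of_abs_le (hgm.const_mul ε₀) (C := ε₀ * K) fun v => by
      rw [abs_mul, abs_of_pos hε₀pos]; exact mul_le_mul_of_nonneg_left (hgK v) hε₀pos.le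
  have hMpos : 0 < M := by rw [hM]; exact integral_exp_pos hexpg
  -- the one-body sum `F = Σ g(vᵢ)` and the tilt potential `V = ε₀ F`
  set F : Phase N → ℝ := fun z => ∑ i, g (z i).2 with hF
  set V : Phase N → ℝ := fun z => ∑ i, ε₀ * g (z i).2 with hV
  have hVF : ∀ z, V z = ε₀ * F z := fun z => by simp only [hV, hF, Finset.mul_sum]
  have hFm : Measurable F := Finset.measurable_sum _ fun i _ => hgm.comp (measurable_pi_apply i).snd
  have hVm : Measurable V := Finset.measurable_sum _ fun i _ => (hgm.comp (measurable_pi_apply i).snd).const_mul ε₀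
  have hK0 : 0 ≤ K := (abs_nonneg _).trans (hgK 0)
  have hFb : ∀ z, |F z| ≤ ∑ _i : Fin (N + 1), K := fun z =>
    (Finset.abs_sum_le_sum_abs _ _).trans (Finset.sum_le_sum fun i _ => hgK _)
  have hVb : ∀ z, |V z| ≤ ε₀ * ∑ _i : Fin (N + 1), K := fun z => by
    rw [hVF, abs_mul, abs_of_pos hε₀pos]
    exact mul_le_mul_of_nonneg_left (hFb z) hε₀pos.le
  have hT : MeasurePreserving (Φ.flow lag) G G := measurePreserving_flow_localGibbsLaw 1 1 N Φ lag
  have hWΦm : Measurable fun z => W (Φ.flow lag z) := hWm.comp (Φ.measurable_flow lag)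
  have hWΦ : ∀ z, |W (Φ.flow lag z)| ≤ CW := fun z => hW _
  -- (i) the defect clause as a Bochner inequality for `Y₁ = 2F − 2 lag⁻¹ (W∘Φ − W)`
  set Y₁ : Phase N → ℝ := fun z => 2 * F z - 2 * lag⁻¹ * (W (Φ.flow lag z) - W z) with hY₁
  have hrw1 : ∀ z : Phase N, Real.exp (2 * ((∑ i, g (z i).2) - lag⁻¹ * (W (Φ.flow lag z) - W z))) =
      Real.exp (Y₁ z) := by
    intro z
    simp only [hY₁, hF]
    congr 1
    ring
  simp_rw [hrw1] at h1
  have hY₁m : Measurable Y₁ := (hFm.const_mul 2).sub (measurable_const.mul (hWΦm.sub hWm))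
  have hY₁b : ∀ z, |Y₁ z| ≤ 2 * (∑ _i : Fin (N + 1), K) + |2 * lag⁻¹| * (CW + CW) := by
    intro z
    calc |Y₁ z| ≤ |2 * F z| + |2 * lag⁻¹ * (W (Φ.flow lag z) - W z)| := abs_sub _ _
      _ = 2 * |F z| + |2 * lag⁻¹| * |W (Φ.flow lag z) - W z| := by
          rw [abs_mul 2 (F z), abs_mul (2 * lag⁻¹) (W (Φ.flow lag z) - W z), abs_two]
      _ ≤ _ := by
          gcongr
          · exact hFb z
          · exact (abs_sub _ _).trans (add_le_add (hW _) (hW _))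
  have hI1 : ∫ z, Real.exp (Y₁ z) ∂G ≤ Real.exp (δ * (N + 1)) := integral_exp_le_of_lintegral_le hY₁m hY₁b h1
  -- (ii) the cost clause as a Bochner inequality, then for `Y₂ = (4/h₀) W∘Φ` and `Y₃ = −(4/h₀) W`
  set a : ℝ := 4 * h₀⁻¹ with ha
  have hapos : 0 < a := by positivity
  have hcostm : Measurable fun z => a * |W z| := measurable_const.mul hWm.abs
  have hcostb : ∀ z, abs (a * |W z|) ≤ a * CW := by
    intro z
    rw [abs_mul, abs_abs, abs_of_pos hapos]
    exact mul_le_mul_of_nonneg_left (hW z) hapos.le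
  have hI0 : ∫ z, Real.exp (a * |W z|) ∂G ≤ Real.exp (δ * (N + 1)) :=
    integral_exp_le_of_lintegral_le hcostm hcostb h2
  have hcostint : Integrable (fun z => Real.exp (a * |W z|)) G := integrable_exp_of_abs_le hcostm hcostb
  set Y₂ : Phase N → ℝ := fun z => a * W (Φ.flow lag z) with hY₂
  set Y₃ : Phase N → ℝ := fun z => -(a * W z) with hY₃
  have hY₂m : Measurable Y₂ := measurable_const.mul hWΦm
  have hY₃m : Measurable Y₃ := (measurable_const.mul hWm).neg
  have hY₂b : ∀ z, |Y₂ z| ≤ a * CW := by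
    intro z
    rw [hY₂, abs_mul, abs_of_pos hapos]
    exact mul_le_mul_of_nonneg_left (hW _) hapos.le
  have hY₃b : ∀ z, |Y₃ z| ≤ a * CW := by
    intro z
    rw [hY₃, abs_neg, abs_mul, abs_of_pos hapos]
    exact mul_le_mul_of_nonneg_left (hW _) hapos.le
  have hptw : ∀ w : ℝ, a * w ≤ a * |w| := fun w => mul_le_mul_of_nonneg_left (le_abs_self w) hapos.le
  have hI2 : ∫ z, Real.exp (Y₂ z) ∂G ≤ Real.exp (δ * (N + 1)) := by
    have hcomp : ∫ z, Real.exp (Y₂ z) ∂G = ∫ z, Real.exp (a * W z) ∂G := by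
      have hgm' : AEStronglyMeasurable (fun z => Real.exp (a * W z)) (Measure.map (Φ.flow lag) G) :=
        (Real.continuous_exp.measurable.comp (measurable_const.mul hWm)).aestronglyMeasurable
      have him := integral_map (μ := G) (hT.measurable.aemeasurable) hgm'
      rw [hT.map_eq] at him
      simp only [hY₂]
      exact him.symm
    rw [hcomp]
    have hb4 : ∀ z, |a * W z| ≤ a * CW := by
      intro z
      rw [abs_mul, abs_of_pos hapos]
      exact mul_le_mul_of_nonneg_left (hW _) hapos.le
    exact (integral_mono (integrable_exp_of_abs_le (measurable_const.mul hWm) hb4) hcostint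
      fun z => Real.exp_le_exp.2 (hptw (W z))).trans hI0
  have hI3 : ∫ z, Real.exp (Y₃ z) ∂G ≤ Real.exp (δ * (N + 1)) := by
    refine (integral_mono (integrable_exp_of_abs_le hY₃m hY₃b) hcostint fun z => Real.exp_le_exp.2 ?_).trans hI0
    simp only [hY₃]
    have := hptw (-W z)
    rwa [abs_neg, mul_neg] at this
  -- the three Gibbs inequalities under `Q = G.tilted V`
  set Z : ℝ := ∫ z, Real.exp (V z) ∂G with hZ
  have hJ1 := tilted_jensen (μ := G) hVm hY₁m hVb hY₁b
  have hJ2 := tilted_jensen (μ := G) hVm hY₂m hVb hY₂b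
  have hJ3 := tilted_jensen (μ := G) hVm hY₃m hVb hY₃b
  -- the static value `Z = M^{N+1}`, so `log Z = (N+1) log M`
  have hZval : Z = M ^ (N + 1) := by
    have hl : ∫⁻ z, ENNReal.ofReal (Real.exp (V z)) ∂G = (ENNReal.ofReal M) ^ (N + 1) := by
      simp only [hV]
      rw [hGdef, localGibbsLaw_eq, lintegral_exp_sum_vel_localGibbsMeasure one_pos one_pos 0 hσ2 N
        (hgm.const_mul ε₀), gaussMeasure_zero_one, hM]
      congr 1
      rw [← ofReal_integral_eq_lintegral_ofReal hexpg (ae_of_all _ fun _ => (Real.exp_pos _).le)]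
    have hVint : Integrable (fun z => Real.exp (V z)) G := integrable_exp_of_abs_le hVm hVb
    have h' : ENNReal.ofReal Z = ENNReal.ofReal (M ^ (N + 1)) := by
      rw [hZ, ofReal_integral_eq_lintegral_ofReal hVint (ae_of_all _ fun _ => (Real.exp_pos _).le), hl,
        ENNReal.ofReal_pow hMpos.le]
    have hZnn : 0 ≤ Z := integral_nonneg fun _ => (Real.exp_pos _).le
    exact (ENNReal.ofReal_eq_ofReal_iff hZnn (by positivity)).1 h'
  have hlogZ : Real.log Z = (N + 1 : ℝ) * Real.log M := by
    rw [hZval, Real.log_pow]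
    push_cast
    ring
  have hZpos : 0 < Z := by rw [hZval]; positivity
  -- take logs: `log Z + mₖ ≤ δ (N+1)`
  have hlog : ∀ {m b : ℝ} {I : ℝ}, Z * Real.exp m ≤ I → I ≤ Real.exp b → Real.log Z + m ≤ b := by
    intro m b I hle hIb
    have hpos : 0 < Z * Real.exp m := mul_pos hZpos (Real.exp_pos _)
    have := Real.log_le_log hpos (hle.trans hIb)
    rwa [Real.log_mul hZpos.ne' (Real.exp_pos _).ne', Real.log_exp, Real.log_exp] at this
  have hL1 := hlog hJ1 hI1
  have hL2 := hlog hJ2 hI2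
  have hL3 := hlog hJ3 hI3
  -- evaluate the tilted means by linearity
  haveI : IsProbabilityMeasure (G.tilted V) := isProbabilityMeasure_tilted (integrable_exp_of_abs_le hVm hVb)
  set Q := G.tilted V with hQ
  have hFi : Integrable F Q := integrable_of_abs_le hFm hFb
  have hWi : Integrable W Q := integrable_of_abs_le hWm hW
  have hWΦi : Integrable (fun z => W (Φ.flow lag z)) Q := integrable_of_abs_le hWΦm hWΦ
  set f : ℝ := ∫ z, F z ∂Q with hf
  set A : ℝ := ∫ z, W (Φ.flow lag z) ∂Q with hA
  set B : ℝ := ∫ z, W z ∂Q with hB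
  have hm1 : ∫ z, (Y₁ z - V z) ∂Q = (2 - ε₀) * f - 2 * lag⁻¹ * (A - B) := by
    have e : (fun z => Y₁ z - V z) = fun z => (2 - ε₀) * F z - 2 * lag⁻¹ * (W (Φ.flow lag z) - W z) := by
      funext z; simp only [hY₁]; rw [hVF]; ring
    have hD : Integrable (fun z => W (Φ.flow lag z) - W z) Q := hWΦi.sub hWi
    have hcD : Integrable (fun z => 2 * lag⁻¹ * (W (Φ.flow lag z) - W z)) Q := hD.const_mul (2 * lag⁻¹)
    have hcF : Integrable (fun z => (2 - ε₀) * F z) Q := hFi.const_mul (2 - ε₀)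
    rw [e, integral_sub hcF hcD, integral_const_mul, integral_const_mul, integral_sub hWΦi hWi]
  have hm2 : ∫ z, (Y₂ z - V z) ∂Q = a * A - ε₀ * f := by
    have e : (fun z => Y₂ z - V z) = fun z => a * W (Φ.flow lag z) - ε₀ * F z := by
      funext z; simp only [hY₂]; rw [hVF]
    have hc2 : Integrable (fun z => a * W (Φ.flow lag z)) Q := hWΦi.const_mul a
    have hcF : Integrable (fun z => ε₀ * F z) Q := hFi.const_mul ε₀
    rw [e, integral_sub hc2 hcF, integral_const_mul, integral_const_mul]
  have hm3 : ∫ z, (Y₃ z - V z) ∂Q = -(a * B) - ε₀ * f := by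
    have e : (fun z => Y₃ z - V z) = fun z => -(a * W z) - ε₀ * F z := by
      funext z; simp only [hY₃]; rw [hVF]
    have hc3 : Integrable (fun z => -(a * W z)) Q := (hWi.const_mul a).neg
    have hcF : Integrable (fun z => ε₀ * F z) Q := hFi.const_mul ε₀
    rw [e, integral_sub hc3 hcF, integral_neg, integral_const_mul, integral_const_mul]
  rw [hm1, hlogZ] at hL1
  rw [hm2, hlogZ] at hL2
  rw [hm3, hlogZ] at hL3
  -- linear bookkeeping with weights (2c, 1, 1), `c = lag/h₀` (so `a = 4c/lag`): corrector terms and `f` cancel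
  set P : ℝ := (N + 1 : ℝ) * Real.log M with hPdef
  set α : ℝ := lag⁻¹ * A with hα
  set β : ℝ := lag⁻¹ * B with hβ
  have hac : a = 4 * c * lag⁻¹ := by rw [ha, hc]; field_simp
  have e1 : P + ((2 - ε₀) * f - 2 * α + 2 * β) ≤ δ * (N + 1) := by
    have : (2 - ε₀) * f - 2 * lag⁻¹ * (A - B) = (2 - ε₀) * f - 2 * α + 2 * β := by rw [hα, hβ]; ring
    linarith [hL1, this]
  have e2 : P + (4 * c * α - ε₀ * f) ≤ δ * (N + 1) := by
    have : a * A - ε₀ * f = 4 * c * α - ε₀ * f := by rw [hac, hα]; ring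
    linarith [hL2, this]
  have e3 : P + (-(4 * c * β) - ε₀ * f) ≤ δ * (N + 1) := by
    have : -(a * B) - ε₀ * f = -(4 * c * β) - ε₀ * f := by rw [hac, hβ]; ring
    linarith [hL3, this]
  have e1' : 2 * c * (P + ((2 - ε₀) * f - 2 * α + 2 * β)) ≤ 2 * c * (δ * (N + 1)) :=
    mul_le_mul_of_nonneg_left e1 (by positivity)
  have hx : 2 * c * (P + ((2 - ε₀) * f - 2 * α + 2 * β)) + (P + (4 * c * α - ε₀ * f)) +
      (P + (-(4 * c * β) - ε₀ * f)) = (2 * c + 2) * P + (2 * c * (2 - ε₀) - 2 * ε₀) * f := by ring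
  have hy : 2 * c * (δ * (N + 1)) + δ * (N + 1) + δ * (N + 1) = (2 * c + 2) * (δ * (N + 1)) := by ring
  have hcoef : 2 * c * (2 - ε₀) - 2 * ε₀ = 0 := by linear_combination (-2) * hε₀c
  have hsum := add_le_add (add_le_add e1' e2) e3
  rw [hx, hy, hcoef, zero_mul, add_zero] at hsum
  -- divide by `(2c + 2)(N + 1) > 0`
  have hk : 0 < 2 * c + 2 := by positivity
  have hP' : P ≤ δ * (N + 1) := le_of_mul_le_mul_left (by linarith [hsum]) hk
  have hn : (0 : ℝ) < N + 1 := by positivity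
  rw [hPdef] at hP'
  have := (mul_comm _ _).trans_le hP'  -- Real.log M * (N+1) ≤ δ * (N+1)
  exact le_of_mul_le_mul_right this hn

/-- **`c·h₀ ≤ lag` is impossible, for every fixed ratio `c > 0`: X so strengthened is FALSE.** Witness
`a = θ = 1`, `u₀ = 0`, `σ = min(σ₀/2, 1/4)`, `φ ≡ 1`, `g = gW κ` (the prover's own `κ`), `ε₀ = 2c/(1+c)`,
`δ = ½ log E_γ e^{ε₀ g}`, `N = N₀`, any flow (flows exist: Alexander). Apply `lagRigidity` at the LONGER cost scale
`h₀' = lag/c ≥ h₀` (the cost clause is monotone in the scale), where `2lag/(lag + h₀') = ε₀`: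
`log E_γ e^{ε₀ g} ≤ δ = ½ log E_γ e^{ε₀ g}`, contradicting `E_γ e^{ε₀ g} > 1`. [folklore] -/
theorem not_correctorPressureDecayLagGeWindow {c : ℝ} (hc : 0 < c) : ¬ CorrectorPressureDecayLagGeWindow c := by
  intro h
  obtain ⟨σ₀, hσ₀, hσ⟩ := h 1 1 0 one_pos one_pos
  set σ : ℝ := min (σ₀ / 2) 4⁻¹ with hσdef
  have hσpos : 0 < σ := lt_min (by linarith) (by norm_num)
  have hσlt : σ < σ₀ := (min_le_left _ _).trans_lt (by linarith)
  have hσ2 : σ ≤ 1 / 2 := (min_le_right _ _).trans (by norm_num)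
  have hσ2' : σ < 2⁻¹ := (min_le_right _ _).trans_lt (by norm_num)
  obtain ⟨hprob, κ, hκ, hmain⟩ := hσ σ hσpos hσlt
  set ε₀ : ℝ := 2 * c / (1 + c) with hε₀
  have hε₀pos : 0 < ε₀ := by positivity
  set M : ℝ := ∫ v, Real.exp (ε₀ * gW κ v) ∂stdGaussian V3 with hM
  have hgg : ∀ w : V3, ε₀ * gW κ w = 2 * gW (ε₀ * κ / 2) w := by
    intro w
    simp only [gW]
    ring
  have hM1 : 1 < M := by
    have hf1 := one_add_integral_sq_le_integral_exp_gW (ε₀ * κ / 2)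
    have hf2 := integral_gW_sq_pos (by positivity : ε₀ * κ / 2 ≠ 0)
    rw [hM]
    simp_rw [hgg]
    linarith
  set Λ : ℝ := Real.log M with hΛ
  have hΛpos : 0 < Λ := Real.log_pos hM1
  set δ : ℝ := Λ / 2 with hδ
  have hδpos : 0 < δ := by positivity
  obtain ⟨τ₀, hτ₀, N₀, hN⟩ := hmain (fun _ => 1) (gW κ) continuous_const (continuous_gW κ) (fun _ => by simp)
    (abs_gW_le hκ.le) (gW_orthogonal κ) δ hδpos
  obtain ⟨Φ⟩ := nonempty_flow hσpos hσ2' N₀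
  obtain ⟨lag, hlag, hlagge, W, hWm, ⟨CW, hW⟩, h1, h2⟩ := hN N₀ le_rfl Φ
  haveI := hprob N₀ Φ
  set G := localGibbsLaw σ (fun _ => (1 : ℝ)) (fun _ => (0 : V3)) (fun _ => (1 : ℝ)) N₀ Φ with hGdef
  set h₀ : ℝ := τ₀ * ((N₀ + 1 : ℕ) : ℝ) ^ (-(1 / 3 : ℝ)) with hh₀
  have hh₀pos : 0 < h₀ := mul_pos hτ₀ (Real.rpow_pos_of_pos (by positivity) _)
  -- the longer cost scale `h₀' = lag / c ≥ h₀`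
  set h₀' : ℝ := lag / c with hh₀'
  have hh₀'pos : 0 < h₀' := by positivity
  have hle : h₀ ≤ h₀' := by rw [hh₀', le_div_iff₀ hc, mul_comm]; exact hlagge
  have hrw1 : ∀ z : Phase N₀, Real.exp (2 * ((∑ i, (fun _ : T3 => (1 : ℝ)) (z i).1 *
      gW κ ((Real.sqrt 1)⁻¹ • ((z i).2 - 0))) - lag⁻¹ * (W (Φ.flow lag z) - W z))) =
      Real.exp (2 * ((∑ i, gW κ (z i).2) - lag⁻¹ * (W (Φ.flow lag z) - W z))) := by
    intro z
    simp only [Real.sqrt_one, inv_one, sub_zero, one_smul, one_mul]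
  simp_rw [hrw1] at h1
  have h2' : ∫⁻ z, ENNReal.ofReal (Real.exp (4 * h₀'⁻¹ * |W z|)) ∂G ≤ ENNReal.ofReal (Real.exp (δ * (N₀ + 1))) := by
    refine (lintegral_mono fun z => ENNReal.ofReal_le_ofReal (Real.exp_le_exp.2 ?_)).trans h2
    exact mul_le_mul_of_nonneg_right (mul_le_mul_of_nonneg_left (inv_anti₀ hh₀pos hle) (by norm_num))
      (abs_nonneg _)
  have hrig := lagRigidity hσ2 Φ (hprob N₀ Φ) (continuous_gW κ).measurable (abs_gW_le hκ.le) hh₀'pos hlag hWm hW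
    h1 h2'
  have hεeq : 2 * lag / (lag + h₀') = ε₀ := by
    rw [hh₀', hε₀]
    field_simp
    ring
  rw [hεeq, ← hM, ← hΛ] at hrig
  -- `Λ ≤ δ = Λ/2` with `Λ > 0`
  rw [hδ] at hrig
  linarith

end LagWindow

/-! ## (f) The kill criterion as a theorem: charged invariant events ⇒ ¬X (cycle 2)

`ChargedInvariantEvents` packages what a refutation of X must exhibit through the invariant-event floor: at drift
`u₀ = 0`, for σ arbitrarily small, for EVERY amplitude κ an admissible `(φ, g)` and a tolerance δ such that for
infinitely many `N` some flow `Φ` has a flow-invariant event `A` with `G_N(A) · exp(G_N(A)⁻¹ ∫_A 2F dG_N) > e^{δ(N+1)}`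
— an extensive LD-Drude weight carried by an exactly conserved (quasi-local) structure. We believe it FALSE for 3-d
hard spheres at small density (no such charge is known; see the docblock) and do NOT file it as a wanted construction;
the theorem records the logical channel and is the template of (a.2). -/

section KillCriterion

open Literature.MathematicalPhysics.KineticTheory

/-- H_charge: a family of flow-invariant events carrying an extensive exponential bias of an admissible fast one-body
observable, at every amplitude (zero drift). Believed false; NOT a wanted construction. -/
def ChargedInvariantEvents : Prop :=
  ∃ (a θ : ℝ), 0 < a ∧ 0 < θ ∧ ∀ σ₀ : ℝ, 0 < σ₀ → ∃ σ : ℝ, 0 < σ ∧ σ < σ₀ ∧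
    ∀ κ : ℝ, 0 < κ → ∃ (φ : T3 → ℝ) (g : V3 → ℝ), Continuous φ ∧ Continuous g ∧ (∀ x, |φ x| ≤ 1) ∧
      (∀ v, |g v| ≤ κ) ∧
      (∀ (c₀ c₂ : ℝ) (b : V3), ∫ v, g v * (c₀ + inner ℝ b v + c₂ * ‖v‖ ^ 2) ∂stdGaussian V3 = 0) ∧
      ∃ δ : ℝ, 0 < δ ∧ ∀ N₀ : ℕ, ∃ N : ℕ, N₀ ≤ N ∧ ∃ Φ : Flow σ N, ∃ A : Set (Phase N), MeasurableSet A ∧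
        (∀ t : ℝ, 0 < t → Φ.flow t ⁻¹' A = A) ∧
        localGibbsLaw σ (fun _ => a) (fun _ => 0) (fun _ => θ) N Φ A ≠ 0 ∧
        Real.exp (δ * (N + 1)) <
          (localGibbsLaw σ (fun _ => a) (fun _ => 0) (fun _ => θ) N Φ A).toReal *
            Real.exp ((localGibbsLaw σ (fun _ => a) (fun _ => 0) (fun _ => θ) N Φ A).toReal⁻¹ *
              ∫ z in A, 2 * ∑ i, φ (z i).1 * g ((Real.sqrt θ)⁻¹ • ((z i).2 - 0))
                ∂(localGibbsLaw σ (fun _ => a) (fun _ => 0) (fun _ => θ) N Φ))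

/-- **Charged invariant events refute X** (for every lag, corrector and cost scale): the invariant-event floor
`mul_exp_average_le_setIntegral_exp_sub_coboundary` bounds the defect integral over `A` from below by
`G_N(A) e^{avg_A 2F} > e^{δ(N+1)}`. -/
theorem correctorPressureDecay_false_of_chargedInvariantEvents (H : ChargedInvariantEvents) :
    ¬ CorrectorPressureDecay := by
  intro hX
  obtain ⟨a, θ, ha, hθ, Hσ⟩ := H
  obtain ⟨σ₀, hσ₀, HX⟩ := hX a θ 0 ha hθ
  obtain ⟨σ, hσ, hσlt, Hκ⟩ := Hσ σ₀ hσ₀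
  obtain ⟨hprob, κ, hκ, hmain⟩ := HX σ hσ hσlt
  obtain ⟨φ, g, hφ, hg, hφ1, hgκ, horth, δ, hδ, HN⟩ := Hκ κ hκ
  obtain ⟨τ₀, _hτ₀, N₀, hN⟩ := hmain φ g hφ hg hφ1 hgκ horth δ hδ
  obtain ⟨N, hN₀, Φ, A, hA, hinvA, hGA, hbig⟩ := HN N₀
  obtain ⟨lag, hlag, W, hWm, ⟨CW, hW⟩, h1, _h2⟩ := hN N hN₀ Φ
  haveI := hprob N Φ
  set G := localGibbsLaw σ (fun _ => a) (fun _ => (0 : V3)) (fun _ => θ) N Φ with hGdef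
  set F : Phase N → ℝ := fun z => 2 * ∑ i, φ (z i).1 * g ((Real.sqrt θ)⁻¹ • ((z i).2 - 0)) with hF
  have hFm : Measurable F := by
    have : Continuous F := by
      simp only [hF]
      fun_prop
    exact this.measurable
  have hκ0 : 0 ≤ κ := hκ.le
  have hFb : ∀ z, |F z| ≤ 2 * ∑ _i : Fin (N + 1), κ := by
    intro z
    rw [hF, abs_mul, abs_two]
    refine mul_le_mul_of_nonneg_left ((Finset.abs_sum_le_sum_abs _ _).trans (Finset.sum_le_sum fun i _ => ?_))
      two_pos.le
    rw [abs_mul]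
    calc |φ (z i).1| * |g ((Real.sqrt θ)⁻¹ • ((z i).2 - 0))| ≤ 1 * κ :=
          mul_le_mul (hφ1 _) (hgκ _) (abs_nonneg _) zero_le_one
      _ = κ := one_mul κ
  have hT : MeasurePreserving (Φ.flow lag) G G := measurePreserving_flow_localGibbsLaw a θ N Φ lag
  have hfloor := mul_exp_average_le_setIntegral_exp_sub_coboundary hT hA (hinvA lag hlag) hGA hFm hWm hFb hW
    (2 * lag⁻¹)
  -- the defect clause, as a Bochner integral of the same integrand
  have hrw1 : ∀ z : Phase N, Real.exp (2 * ((∑ i, φ (z i).1 * g ((Real.sqrt θ)⁻¹ • ((z i).2 - 0))) -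
      lag⁻¹ * (W (Φ.flow lag z) - W z))) = Real.exp (F z - 2 * lag⁻¹ * (W (Φ.flow lag z) - W z)) := by
    intro z
    simp only [hF]
    congr 1
    ring
  simp_rw [hrw1] at h1
  have hYm : Measurable fun z => F z - 2 * lag⁻¹ * (W (Φ.flow lag z) - W z) :=
    hFm.sub (measurable_const.mul ((hWm.comp (Φ.measurable_flow lag)).sub hWm))
  have hYb : ∀ z, |F z - 2 * lag⁻¹ * (W (Φ.flow lag z) - W z)| ≤ (2 * ∑ _i : Fin (N + 1), κ) +
      |2 * lag⁻¹| * (CW + CW) := by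
    intro z
    calc |F z - 2 * lag⁻¹ * (W (Φ.flow lag z) - W z)| ≤ |F z| + |2 * lag⁻¹ * (W (Φ.flow lag z) - W z)| :=
          abs_sub _ _
      _ = |F z| + |2 * lag⁻¹| * |W (Φ.flow lag z) - W z| := by
          rw [abs_mul (2 * lag⁻¹) (W (Φ.flow lag z) - W z)]
      _ ≤ _ := by
          gcongr
          · exact hFb z
          · exact (abs_sub _ _).trans (add_le_add (hW _) (hW _))
  have hYint : Integrable (fun z => Real.exp (F z - 2 * lag⁻¹ * (W (Φ.flow lag z) - W z))) G :=
    integrable_exp_of_abs_le hYm hYb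
  have hI1 : ∫ z, Real.exp (F z - 2 * lag⁻¹ * (W (Φ.flow lag z) - W z)) ∂G ≤ Real.exp (δ * (N + 1)) := by
    rw [← ofReal_integral_eq_lintegral_ofReal hYint (ae_of_all _ fun _ => (Real.exp_pos _).le),
      ENNReal.ofReal_le_ofReal_iff (Real.exp_pos _).le] at h1
    exact h1
  have hset : ∫ z in A, Real.exp (F z - 2 * lag⁻¹ * (W (Φ.flow lag z) - W z)) ∂G ≤
      ∫ z, Real.exp (F z - 2 * lag⁻¹ * (W (Φ.flow lag z) - W z)) ∂G :=
    setIntegral_le_integral hYint (ae_of_all _ fun _ => (Real.exp_pos _).le)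
  have := (hfloor.trans hset).trans hI1
  exact absurd (hbig.trans_le this) (lt_irrefl _)

end KillCriterion

/-! ## (d) Targets (cycle 2)

### The PICKED line `kinetic-entropy-collision-budget` (PICKED.md 02:55Z; skeleton registered 03:21Z by the lead, 6 stubs)

The drefute seat attacked all six stubs (crux dir `DREFUTE-kinetic-entropy-collision-budget.md`, 03:27Z): 0 false, 0 misstated;
stubs 1–4 and 6 re-derived TRUE, stub 5 `FastSectorDominance` (FSD) = the wall in entropy clothing, with the sharpening
(S5.1) "the A- and C-allowances carry no content" kernel-checked (`DrefuteSharpen.lean`). This file's theorems bear on the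
line as CROSS-CHECKS, all consistent (no target killed):
* (a.3″) ⇒ FSD must exclude `σ = 0`, and it does (`0 < σ`; there the optimiser is the static tilt, `fd ≍ k`).
* `lagRigidity` vs the line's witness: `lag = Hℓ/n`, `h₀ = τ₀ℓ`, `4κH ≤ δτ₀` give `lag/h₀ ≤ δ/(4κn)`, and the rigidity
  inequality asks `log E_γ exp((2lag/(lag+h₀))g) ≲ δ²s²/(8κ²n²) ≤ δ` — automatically true: the discrete Fejér design sits
  safely inside the admissible region (no tension, no free sharpening either).
* Stub 1's Donsker–Varadhan half is `tilted_jensen` (landing: `Negative/MazurFloor.lean`), importable by the lead.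
* Stub 6 (`DiscreteFejerCorrector`) is exactly the shot-noise-free transfer of caveat (e).6′; TRUE.
* FSD's only failure mode is an H-persistent FIRST-order fast deviation of the optimiser's one-body law at small N-body
  entropy — the one-body shadow of `ChargedInvariantEvents`/(f); by the EXACT-invariant discussion there it must be a
  metastable (not invariant) structure, i.e. FSD fails iff shared 10967 fails with a one-body witness. Nothing in this
  file's flow-independent arsenal can reach it; the empirical channel is the MD window-variance plateau ((e).7).

### The unpicked line `almost-invariant-duality` (skeleton of 00:39Z; audited before the pick was visible to this seat)

Verdicts on the four stubs (no kill; paper analysis except stub 2, which is CLOSED here):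
* `stub_correctorMinimax` (`CorrectorMinimax`, abstract Sion minimax) — TRUE: the cost ball
  `{|W| ≤ M, ∫e^{c|W|} ≤ K}` is convex, bounded and `L²`-norm closed (Fatou), hence weak*-compact in `L∞ = (L¹)*`
  (Mazur + Banach–Alaoglu); `W ↦ payoff` is affine and weak*-continuous because `T#(ρμ) ≪ μ`; `ρ ↦ payoff` is
  concave and sup-norm continuous on bounded densities; degenerate cases (`K < 1`: hypothesis fails at `ρ = 1`;
  `M = 0`) hold. No junk: all integrands bounded on a probability space.
* `stub_gibbsFlowInvariance` (`GibbsFlowInvariance`) — TRUE and PROVED: `gibbsFlowInvariance_holds` below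
  (= `HomInv.measurePreserving_flow_localGibbsLaw`, all drifts).
* `stub_thermodynamicSliceFloor` (`ThermodynamicSliceFloor`) — TRUE: Doob factorisation + clipping gives the profile
  `f(P,E)`; Gibbs' inequality on `σ(P,E)` bounds the dual value by `log E_G exp(2E[F|P,E])`; positions ⊥ velocities
  and exchangeability give `E[F|P,E] = (N+1) φ̄ m_N(P,E)`; equivalence of ensembles (Diaconis–Freedman, uniform on
  compacts of the reduced `(p, θ')`) + Cramér in `ℝ⁴` for `(p̂, θ̂')` (exponential moments of `|ṽ|²` exist for
  `t < ½`) + `|Ḡ(p,θ')| ≤ κ‖L_{p,θ'} − πL‖_{L²(γ)} = O(κ(|p|² + (θ'−1)²))` (orthogonality kills the first order) give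
  `sup[2φ̄Ḡ − I] = 0` for `κ < κ*` UNIVERSAL; consistent with (a.2) (κ large ⇒ false).
* `stub_almostInvariantRigidity` (`AlmostInvariantRigidity`) — ⇔ X given stubs 1–3 (`StatewiseDuality` ⇒ it by
  dropping the anchor hypothesis; X ⇒ `StatewiseDuality` by weak duality). Its `∃lag ∃M ∀ρ` order is forced by the
  single `T = Φ_lag` of the minimax. NO independent attack surface: killing it = killing X. By (c.2) its `lag` must
  satisfy `lag < h₀` (any witness family with `lag ≥ h₀` is refuted by the `F`-tilt `ρ ∝ e^{Σg}` itself, a product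
  state of entropy `O(N)` — a concrete test state for the lead's J- and F-witness constructions).
  NUDGE for stub 4 (quantitative, from (c.2)): on the WEAK product tilts `ρ_ε ∝ e^{εΣg(vᵢ)}` the debt is
  `2E_ρF − H(ρ|G_N) − δ(N+1) = (N+1)[2εs² − ε²s²/2 − δ + O(ε³)]`, positive for `δ/(2s²) ≲ ε ≲ 4`; the J-witness
  `W = ε′(h₀/8)log(ρ∘Φ_{−lag}/ρ)` pays a Jeffreys price `∝ ε²` (entropy production of a tilt of strength ε is
  quadratic in ε), so for `ε ≍ δ/s²` it pays `O(δ²)` against a debt `O(δ)`: weak tilts are F-witness (Cesàro /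
  time-decorrelation) territory — exactly the dual of shared 10967 — and no entropy-production witness closes them. -/

section Targets

open Literature.MathematicalPhysics.KineticTheory

/-- The skeleton's stub-2 statement `GibbsFlowInvariance`, restated verbatim (the skeleton file is not imported). -/
def GibbsFlowInvariance : Prop :=
  ∀ (σ a θ : ℝ) (u₀ : V3), 0 < σ → 0 < a → 0 < θ → ∀ (N : ℕ) (Φ : Flow σ N) (t : ℝ),
    MeasurePreserving (Φ.flow t) (localGibbsLaw σ (fun _ => a) (fun _ => u₀) (fun _ => θ) N Φ)
      (localGibbsLaw σ (fun _ => a) (fun _ => u₀) (fun _ => θ) N Φ)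

/-- **Stub 2 of line `almost-invariant-duality` holds** (positive; for the lead): every hard-sphere flow preserves
the constant-profile Gibbs law, for every drift. -/
theorem gibbsFlowInvariance_holds : GibbsFlowInvariance :=
  fun σ a θ u₀ _ _ _ N Φ t => HomInv.measurePreserving_flow_localGibbsLaw σ a θ u₀ N Φ t

end Targets

end Summit.AtomisticToContinuum.HydrodynamicLimit.Cruxes.CorrectorPressureDecay.Disproof
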